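/-
Copyright: statement-level skeleton of a published paper (lit-balaban cell, Phase-2 proof seat p39 gen 29). No proof claims
beyond what the kernel checks below.
-/
import Literature.MathematicalPhysics.QuantumFieldTheory.Balaban1983to89.B3Eq122ChargeWick
import Literature.MathematicalPhysics.QuantumFieldTheory.Balaban1983to89.B3Eq123RenormalizationConditions

/-!
# Bałaban, *(Higgs)₂,₃ quantum fields in a finite volume. III*, CMP 88 (1983) [Balaban1983Higgs3], p. 417: PRINT'S RECURSION
# FOR THE MASS COUNTERTERM (1.23) AT THE INDEX `(α,β) = (2,1)` — the `e²λ` coefficient of the two-point function (1.19) of the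
# action (1.20) WITH `δm² = δm²_{(2,0)}e² + δm²_{(0,1)}λ + δm²_{(2,1)}e²λ + δm²_{(4,0)}e⁴` INSERTED, DERIVED from the measure as a
# third joint cumulant of the free fields, and Wick's theorem at print's `δm²_{(0,1)}`: the first counterterm ① with its loop
# line corrected at order `e²`

statement-level skeleton of published theorems with citation tags; proofs where landed; nothing here is a claim about the
Yang–Mills mass gap.

[cite: Balaban1983Higgs3, (1.23), its graphs and the prose around it p.417 (PDF 7); (1.19)–(1.22) p.416 (PDF 6); (1.6)–(1.8),
(1.10) p.413 (PDF 3)].  Unit `lit-balaban-p39-g29` (Phase-2 proof seat p39, gen 29), free-target protocol G.5-34(d), ZERO head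
weight: OPTIONAL LOCATED MEMBER of rows **B3.Eq1.23** (the `(2,1)` step of *"solved recursively"*) and **B3.Eq1.19-1.22** ((1.19)'s
`e²λ` coefficient along the counterterm surface, in (1.21)'s letters) of `HOME/lit-balaban-r15/ROWS-B3.md` (owner r15; heads
unchanged); TAKING `HOME/STATUS.md` 2026-08-24T11:18Z, owner r15 g19 «WELCOME ∕ NO OBJECTION» 11:19:03Z with ONE docstring ask
(answered under «WHICH DISPLAYED TERMS» below).  BRICK 14 of this seat's series: BRICK 7 `B3Eq122ChargeWick` (the order-`e²`
two-point function: joint weight `J`, insertions `D₁`/`D₂`, majorant, vector covariance, bracket `Bk`, `∫D₂(0)e^{−S_0}F`, `twoPt`)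
is IMPORTED, and through it BRICK 1 `B3Eq122FirstOrderWick` (the `e = 0` sector: `legs`, the one-sided dominated differentiation in
`λ` `hasDerivWithinAt_gaussInt_exp_neg_of_le`, `integral_sumWick4`, `integral_sumWick4_mul_legs`), `B3WickVertexCalculus` (`wick4`
and the contraction rule `integral_wick4_mul`), `B3BilinearWick`, `B3WTCovariance` (`transl`, `translBond`), p26's `B3Eq123Counterterms` (the lattice `delta`) and r15's
`B3Sect1TwoPoint` (`dm2Graph`).  BRICK 10 `B3Eq123RenormalizationConditions` (the counterterm inserted as a curve
`δm² = ct(e)`; the conditions `(2,0)`, `(0,1)`), BRICK 11 `B3Eq119JointSmooth` (joint smoothness of (1.19) in `(e,λ)`, Schwarz),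
BRICK 12 `B3Eq123IndexZeroTwo` (`(0,2)` at `e = 0`) and BRICK 13 `B3Eq124VacuumChargeWick` are cited BY NAME only: their modules
were not built on the Lean farm at filing time (probe rc 75 «unbuilt», 2026-08-24T11:1xZ), so v1.0 re-derived the curve/majorant
lemmas of BRICK 10 §1–§4 (= BRICK 13 §1) that §2 needs as PRIVATE copies; v1.1 (gen 32, BRICK 10 built) IMPORTS
`B3Eq123RenormalizationConditions` instead and deletes the copies (nothing of record is redeclared; every public declaration below
is new and byte-identical to v1.0).

PDF held: `paper:balaban1983-higgs-2-3-quantum-fields-finite-volume` (journal page = PDF page + 410); p. 417 — (1.23), its picture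
and the prose around it — READ AS AN IMAGE on the ×2 render `run/shared/lean/pub/pub-balaban/b2b-balaban-ref1/pages/1983-cmp88-
higgs23-III/1983-cmp88-higgs23-III-p007-x2.png` (2026-08-24T11:1xZ), the formula and graph block RE-READ on 2× crops of that render
(2026-08-24T11:5xZ; the OCR layer of (1.23), l. 29–31 of the text page, is garbled and was not used); p. 416 on `…-p006-x2.png` as
quoted in BRICK 7's header.

THE PRINTED TEXT (verbatim, p. 417).  *"This equation can be solved recursively if δm² and Σ^ε are expanded into power series in
e, λ. In our case δm² will be defined by the terms of order ≦ 4. More exactly we write δm² = Σ_{2≦α+2β≦4} e^αλ^β δm²_{(α,β)} and we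
insert this into Σ^ε. This gives us an expansion of Σ^ε in coupling constants and we take a sum of terms of order ≦ 4:
Σ_{2≦α+2β≦4} e^αλ^βΣ^ε_{(α,β)}. The counterterms δm²_{(α,β)} are defined by the equations −δm²_{(α,β)} + Σ_{x∈T_ε}ε^dΣ^ε_{(α,β)}(x) =
0. … If a graph G representing Σ^ε_G(x−x′) has the external legs localized in x, x′, then δm²_G = Σ_{x′∈T_ε}ε^dΣ^ε_G(x−x′) will be
represented by the same graph G but with both external legs localized in x and with the summation over x′. For example the
expressions in (1.22) define the following counterterms: δm² = −4(N+2)λC^ε_0(0) + e²dC^ε(0)q² + (2·3/4!)de⁴ε²(C^ε(0))²q⁴ −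
e²Σ_{x′∈T_ε}ε^dΣ_{μ=1}^d q(∂^ε_μC^ε_0∂^{ε*}_μ)(x−x′)qC^ε(x−x′) + 2de⁴Σ_{x′∈T_ε}ε^dq²C^ε_0(x−x′)q²(C^ε(x−x′))² +
4²(2N+4)λ²Σ_{x′∈T_ε}ε^d(C^ε_0(x−x′))³ + e²Σ_{x′,x″∈T_ε}ε^{2d}Σ_{μ=1}^d q(∂^ε_μC^ε_0)(x−x″)δm₁²(C^ε_0∂^{ε*}_μ)(x″−x′)qC^ε(x−x′) + … =
[a row of nine graphs, all external legs at x: the λ-tadpole; the A-tadpole; the double A-tadpole; the cubic vertex at x with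
its vector line and scalar line to a second cubic vertex; the same with a second vector line; the λ² sunset; the cubic pair WITH
A λ-TADPOLE LOOP ON ITS INTERNAL SCALAR LINE; the cubic pair with an A-tadpole on its internal line; the cubic pair with a second
cubic pair inserted on its internal line] + … (1.23) where δm₁² denote a sum of terms δm²_{(α,β)} of the order α+2β = 2. Thus we
have determined the counterterm δm²."*  (Terms ①–⑦ in p26's `B3Eq123Counterterms` numbering: ① `−4(N+2)λC^ε_0(0)`, ②
`e²dC^ε(0)q²`, ③ the `e⁴ε²` double tadpole, ④ the order-`e²` vector exchange, ⑤ `2de⁴…`, ⑥ `4²(2N+4)λ²…`, ⑦ the `δm₁²`-insertion.)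
P. 416, (1.19)–(1.21), verbatim as quoted in BRICK 7's header: `G^ε_{ab}(x,x′) = ⟨φ_a(x)φ_b(x′)⟩^ε = (Z^ε)^{−1}∫dA∫dφ
e^{−S^ε(A,φ)}φ_a(x)φ_b(x′)` (1.19); `S^ε(A,φ) = ½⟨φ,(−Δ^ε_A + m²)φ⟩ + Σ_{x∈T_ε}ε^d(λ∣φ(x)∣⁴ + ½δm²∣φ(x)∣²) + ½⟨A,(−Δ^ε + μ₀²)A⟩`
(1.20); `G^ε = Σ_{n=0}^∞ C₀^ε[(−δm² + Σ^ε + ∂^{ε*}Σ₁^ε + Σ₁^{ε*}∂^ε + ∂^{ε*}Σ₂^ε∂^ε)C₀^ε]ⁿ` (1.21).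

WHAT WAS IN THE TREE BEFORE.  (1.23) is TYPED: p26 `B3Eq123Counterterms` (the displayed terms as kernels `sig1`…/`ct1`…, the
lattice `delta`, `recursion_order_four`), r15 `B3Sect1TwoPoint` (the per-graph counterterm `dm2Graph w Σ x = Σ_{x′}η^dΣ(x,x′)`;
`dm2Coeff`/`dm2Of123`: the series `Σe^αλ^βδm²_{(α,β)}`).  DERIVED from the measure (1.19)/(1.20) so far, index by index of print's recursion:
`(0,1)` and `(2,0)` (BRICK 10 `condition_01_iff` / `condition_20_iff`, on BRICK 1's and BRICK 7's Wick evaluations), `(0,2)` at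
`e = 0` (BRICK 12); on the vacuum side (1.24): `(2,0)` and every `(2k+1, β)` (BRICK 13).  NOT in the tree: any MIXED index — `α ≥ 1`
and `β ≥ 1` — of (1.23) derived from the measure, i.e. any graph with both a quartic vertex and a vector line.  This file derives
the first one, `(α,β) = (2,1)` (weight `α+2β = 4`, the top weight print keeps; the other mixed index in print's range, `(1,1)`,
is odd in `e` and vanishes — (1.23) displays no `eλ` or `e³` term; BRICK 13 §10 on the vacuum side; here §2's `N′(0) = Z′(0) = 0`
at every `λ ≥ 0`).

THE SETTING = BRICK 7's (`B3Eq122ChargeWick` §0–§4) plus the quartic coupling: the model torus `T^{(j)}_η` of `B3WT223Instance`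
(print's `T_ε`, `η = ε`, volume element `w = η^d`, difference quotient `c = η⁻¹`), scalar fields `φ : T → ℝ^N`, the vector field in
components with the Feynman-gauge Gaussian `W_A` (B1 (1.11)), the charge `e` entering through `U(ηeA_b) = exp(ηeA_b·q)` (`q` the
model's antisymmetric charge matrix), the joint weight `J_e(M) = W_A·e^{−½⟨φ,(−Δ^η_{A,e}+M)φ⟩}` at scalar mass `M`; propagators
`C₀ = C^ε_0 = B3WTPropagator.G w c m2`, `C^ε = G w c μ2` (vector covariance `⟨A_bA_{b′}⟩ = δ_{μ_bμ_{b′}}C^ε(b₋,b′₋)`), `C^ε_0(0) =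
C0 w c m2 = C₀(y,y)` (translation invariance).  **The two-point function of this file** is (1.19) for the action (1.20) at charge
`e` AND quartic coupling `λ ≥ 0`, WITH THE COUNTERTERM `δm²(e,λ) = δm²_{(2,0)}e² + δm²_{(0,1)}λ + δm²_{(2,1)}e²λ + δm²_{(4,0)}e⁴`
INSERTED (letters `d20, d01, d21, d40`, arbitrary reals): `G^{ct}_{ab}(x,x′; e,λ) = ∫dA dφ J_e(m²+δm²(e,λ))e^{−λΣ_yη^d∣φ(y)∣⁴}
φ_a(x)φ_b(x′) / ∫dA dφ J_e(m²+δm²(e,λ))e^{−λΣ_yη^d∣φ(y)∣⁴}`, written out as this quotient of integrals in every statement (no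
definition is introduced: theorems only; `legs a b x x′ φ = φ_a(x)φ_b(x′)` is BRICK 1's).  THE `(2,1)` DATUM is `∂_λ⁺∂²_e
G^{ct}∣_{e=λ=0}` = Mathlib's `derivWithin (λ ↦ iteratedDeriv 2 (e ↦ G^{ct}(e,λ)) 0) (Set.Ici 0) 0` («`e` first», two-sided, at every
fixed `λ ≥ 0`; then the right `λ`-derivative at `0⁺` — the quartic weight is integrable for `λ ≥ 0` only); print's coefficient of
`e²λ` is `(2!1!)⁻¹` times it.  Hypotheses throughout: `η^d > 0`, `m² > 0`, `μ₀² > 0`; any level `j`, mesh, dimension `d`, number of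
components `N`; from §6 on print's value `δm²_{(0,1)} = −4(N+2)C^ε_0(0)` (hypothesis `hd01`); in §9 a charge matrix with scalar
square `q² = q2·1` (hypothesis `hq2`; e.g. the rotation generator for `N = 2`).  The letters `X, Y, U, W, K` below are passed to the
theorems as functions with a defining hypothesis (`hX : ∀ φ, X φ = …`, …), so that every statement displays its own formula.

WHAT THIS FILE PROVES (theorems; no definition, no named fact, no `sorry`; standard axioms).
* §1 = BRICK 10 §1–§4 by import (v1.1): the counterterm is a mass shift (`J_e(m²+t) = J_e(m²)e^{−½tΣ_xη^d∣φ(x)∣²}`), the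
  `e`-derivatives of `J_e(m²+ct(e))F`, their majorants, dominated differentiation under `∫dA dφ` on a ball where `∣ct∣ ≤ m²/2`.
* §2 **the quotient `N(e)/Z(e)` of two such integrals**, `F₀ > 0` in the denominator (here `e^{−λU}`): `integral_J_mul_pos`,
  `hasDerivAt_quot_curve_of_ball`, (private) `integral_D1_J_curve_mul_zero` (`N′(0) = Z′(0) = 0` for every weight `F`: one
  vector leg against the even `A`-Gaussian; = BRICK 10's landed `integral_D1_J_massCurve_zero`, not importable yet), `hasDerivAt_deriv_quot_curve_zero_of_ball`, **`iteratedDeriv_two_quot_curve`**: `(N/Z)″(0) =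
  (N″(0)Z(0) − N(0)Z″(0))/Z(0)²`, `N″(0) = ∫[D₂(0) − ½ct″(0)Σ_xη^d∣φ(x)∣²]e^{−S^ε_0}F`.
* §3 **the values at `e = 0` as free-field moments**: `integral_J_zero_mul`, `integral_massForm_J_zero_mul` (the `A`-integral
  factors: BRICK 7 `J_zero`), `expGrowth_X`, `integral_W0_X_mul`, `integral_D2_J_zero_eq_X` / `integral_D2ct_J_zero_eq_X` (**the
  `A`-averaged second charge insertion `X(φ) = Σ_bη^dc²η²C^ε(b₋,b₋)⟪φ(b₋),q²φ(b₊)⟫ + Σ_{b,b′:μ=μ′}(η^dc²η)²C^ε(b₋,b′₋)⟪φ(b₋),qφ(b₊)⟫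
  ⟪φ(b′₋),qφ(b′₊)⟫`** — ② and ④ before the scalar contractions; BRICK 7 `integral_D2_J_zero`),
  **`iteratedDeriv_two_quot_curve_eq_moments`**: `(N/Z)″(0) = [M((X−κQ)F)·M(F₀) − M(F)·M((X−κQ)F₀)]/M(F₀)²`, `M(g) = ∫W₀g`,
  `κ = ½ct″(0)`, `Q = Σ_xη^d∣φ(x)∣²`.
* §4 **THE TWO-POINT FUNCTION WITH THE COUNTERTERM INSERTED, AS A FUNCTION OF `(e,λ)`**: `fibre_mass_split`, `twoPtCt_eq_quot`
  (the order-`λ` counterterm is a mass shift and moves into the Boltzmann factor: **`U = Σ_yη^d∣φ(y)∣⁴ + ½δm²_{(0,1)}Σ_yη^d∣φ(y)∣²`**;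
  the curve in `e` at fixed `λ` is `c_λ(e) = (δm²_{(2,0)} + δm²_{(2,1)}λ)e² + δm²_{(4,0)}e⁴`), `neg_le_U` (`U ≥ −∣T∣η^dδm²_{(0,1)}²/16`),
  `expGrowth_U`, `expGrowth_expU`, **`iteratedDeriv_two_twoPtCt_eq_moments`** (`∂²_eG^{ct}(·,λ)∣₀` for every `λ ≥ 0` as moments
  `I_λ(g) = ∫W₀e^{−λU}g`), **`hasDerivWithinAt_index21`**: the right `λ`-derivative at `0⁺` of that expression EXISTS (BRICK 1's
  one-sided dominated differentiation, `U` bounded below) and **`∂_λ⁺∂²_e G^{ct}∣₀ = −κ₃(L, Y, U) − δm²_{(2,1)}κ₂(L, Q)`, `Y = X −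
  δm²_{(2,0)}Q`**, in joint cumulants of the free scalar field (`L = φ_a(x)φ_b(x′)`, `κ₃(A,B,C) = ⟨ABC⟩ − ⟨AB⟩⟨C⟩ − ⟨AC⟩⟨B⟩ −
  ⟨A⟩⟨BC⟩ + 2⟨A⟩⟨B⟩⟨C⟩`, `κ₂(A,B) = ⟨AB⟩ − ⟨A⟩⟨B⟩`) — for ANY reals `δm²_{(2,0)}, δm²_{(0,1)}, δm²_{(2,1)}, δm²_{(4,0)}` (`δm²_{(4,0)}`
  does not enter); the `derivWithin` form is `(hasDerivWithinAt_index21 …).derivWithin (uniqueDiffOn_Ici 0 0 Set.self_mem_Ici)`.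
* §5 `integral_W0_massForm_legs`, **`kappa2_legs_massForm`: `κ₂(L,Q) = 2δ_{ab}Σ_zη^dC₀(x,z)C₀(x′,z)`** — the `n = 1` term
  `C₀(−δm²_{(2,1)})C₀` of (1.21), times `2!1!`.
* §6 AT PRINT'S `δm²_{(0,1)}`: **`U_eq_sumWick4_of_print`: `Σ_yη^d∣φ(y)∣⁴ + ½δm²_{(0,1)}Σ_yη^d∣φ(y)∣² = Σ_yη^d:∣φ(y)∣⁴: −
  ∣T∣η^dN(N+2)C^ε_0(0)²`** (`:∣φ∣⁴: = ∣φ∣⁴ − 2(N+2)C₀(0)∣φ∣² + N(N+2)C₀(0)²` = `B3WickVertexCalculus.wick4`, Glimm–Jaffe (9.1.5)): the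
  order-`λ` counterterm Wick-orders the quartic interaction EXACTLY; **`derivWithin_index21_at_print_d01`: `∂_λ⁺∂²_e G^{ct}∣₀ =
  −[⟨V_:·Y·L⟩ − ⟨L⟩⟨V_:·Y⟩] − δm²_{(2,1)}κ₂(L,Q)`**, `V_: = Σ_yη^d:∣φ(y)∣⁴:`, `⟨·⟩ = Z₀⁻¹∫W₀(·)` (`⟨V_:⟩ = ⟨V_:L⟩ = 0`: BRICK 1).
* §7 WICK'S THEOREM FOR THE WICK-ORDERED VERTEX (engine: `B3WickVertexCalculus.integral_wick4_mul` — all four legs of `:∣φ(y)∣⁴:`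
  are contracted, Glimm–Jaffe Cor. 8.3.2): **`integral_wick4_obs_legs`** (`∫W₀:∣φ(y)∣⁴:Fφ_a(x)φ_b(x′) = 4C₀(x,y)C₀(x′,y)·[δ_{ab}Σ_i
  ∫W₀F″_{ii} + ∫W₀F″_{ab} + ∫W₀F″_{ba}]` for an observable `F` with vanishing third derivatives at `y`), `integral_wick4_obs` (`= 0`
  without the legs), **`integral_wick4_bil_legs`** (a bilinear `⟪φ(u),Mφ(v)⟫` on the tadpole loop: `8Z₀C₀(x,y)C₀(x′,y)C₀(u,y)C₀(v,y)
  [δ_{ab}tr M + M_{ab} + M_{ba}]`), `derivAlong_cur`, **`derivAlong_cur_deriv`** (the second derivative of a current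
  `⟪φ(b₋),qφ(b₊)⟫` at one site vanishes: `q* = −q`), `integral_curDeriv_curDeriv` (`∫W₀J_b^{(i)}J_{b′}^{(k)} = Z₀(q²)_{ik}Bk(b,b′;y,y)`),
  **`integral_wick4_curcur_legs`** (④ on the tadpole loop: `8Z₀C₀(x,y)C₀(x′,y)Bk(b,b′;y,y)[δ_{ab}tr q² + 2(q²)_{ab}]`).
* §8 **THE INDEX `(2,1)` IN CLOSED FORM** (`integral_wick4_bil`, `integral_wick4_curcur`, `integral_wick4_Y` (`⟨:∣φ(y)∣⁴:·Y⟩ = 0`),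
  `integral_wick4_Y_legs`, `integral_W_Y`, `integral_W_Y_legs`, **`derivWithin_index21_explicit`**):
  **`∂_λ⁺∂²_e G^{ct}_{ab}(x,x′)∣₀ = −Σ_yη^d·8C₀(x,y)C₀(x′,y)·{[δ_{ab}tr q² + 2(q²)_{ab}]·[Σ_bη^dc²η²C^ε(b₋,b₋)C₀(b₋,y)C₀(b₊,y) +
  Σ_{b,b′:μ=μ′}(η^dc²η)²C^ε(b₋,b′₋)Bk(b,b′;y,y)] − δm²_{(2,0)}(N+2)δ_{ab}Σ_zη^dC₀(z,y)²} − 2δm²_{(2,1)}δ_{ab}Σ_zη^dC₀(x,z)C₀(x′,z)`**.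
* §9 DICTIONARY WITH (1.21)/(1.23), for `q² = q2·1` (`index21_eq_local_insertion`, `dm2Graph_local`, **`condition_21_iff`**,
  `K_transl`, **`K_eq_firstCounterterm_loopCorrected`**, **`condition_21_iff_loopCorrected`**): **`(2!1!)⁻¹∂_λ⁺∂²_e G^{ct}_{ab}(x,x′)∣₀
  = δ_{ab}Σ_yη^dC₀(x,y)[K(y) − δm²_{(2,1)}]C₀(y,x′)`** with the LOCAL kernel **`K(y) = −4(N+2)·[q2·(Σ_bη^dc²η²C^ε(b₋,b₋)C₀(b₋,y)
  C₀(b₊,y) + Σ_{b,b′:μ=μ′}(η^dc²η)²C^ε(b₋,b′₋)Bk(b,b′;y,y)) − δm²_{(2,0)}Σ_zη^dC₀(z,y)²] = −4(N+2)·[½∂²_eG_{aa}(y,y)∣_{e=0} −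
  δm²_{(2,0)}Σ_zη^dC₀(z,y)²]`** (`G = twoPt`, BRICK 7's (1.19) at `λ = δm² = 0`; no sum on `a`) — the `n = 1` term `C₀[Σ^ε_{(2,1)} −
  δm²_{(2,1)}δ^ε]C₀` of (1.21) with `Σ^ε_{(2,1)}(y,y′) = K(y)δ^ε(y−y′)`, `K` translation invariant; and print's defining equation
  *"−δm²_{(2,1)} + Σ_{x∈T_ε}ε^dΣ^ε_{(2,1)}(x) = 0"*, written with r15's `dm2Graph` and p26's lattice `delta`, **HOLDS IFF `δm²_{(2,1)}
  = K(x) = −4(N+2)·[½∂²_eG_{aa}(x,x)∣₀ − δm²_{(2,0)}Σ_zη^dC₀(z,x)²]`** — *"solved recursively"*: THE FIRST COUNTERTERM ① WITH ITS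
  LOOP PROPAGATOR `C^ε_0(0)` REPLACED BY THE ORDER-`e²` COEFFICIENT OF THE LOOP LINE WITH ITS COUNTERTERM `−δm²_{(2,0)}`.

WHICH DISPLAYED TERMS OF (1.22)/(1.23) THE `(2,1)` EQUATION PAIRS (owner r15's ask, 2026-08-24T11:19Z).  At weight `α+2β = 4`
print DISPLAYS two index-`(2,1)` letters: the picture «the cubic pair ④ with a λ-tadpole loop on its internal scalar line»
(second row of the graphs of (1.23), second graph) and the `λδm²_{(0,1)}`-part of ⑦ `e²Σ_{x′,x″}ε^{2d}Σ_μq(∂^ε_μC^ε_0)(x−x″)δm₁²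
(C^ε_0∂^{ε*}_μ)(x″−x′)qC^ε(x−x′)` («δm₁² … of the order α+2β = 2», i.e. `e²δm²_{(2,0)} + λδm²_{(0,1)}`).  In this file THESE TWO
CANCEL, and the cancellation is exhibited AT THE VERTEX, not graph by graph: with print's `δm²_{(0,1)} = −4(N+2)C^ε_0(0)` the
kernel finds `η^d∣φ(y)∣⁴ + ½δm²_{(0,1)}η^d∣φ(y)∣² = η^d:∣φ(y)∣⁴: − η^dN(N+2)C^ε_0(0)²` summed over `y` (`U_eq_sumWick4_of_print`) — the
single self-line of the plain quartic vertex, `+2(N+2)C^ε_0(0)·η^d∣φ(y)∣²` (the (1.6)-tadpole with all its pairings and the `O(N)`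
trace), against the counterterm vertex `½δm²_{(0,1)}η^d∣φ(y)∣² = −2(N+2)C^ε_0(0)·η^d∣φ(y)∣²`, equal and opposite on whatever line the
vertex sits; so «④ with the tadpole on its internal line» + ⑦[`λδm²_{(0,1)}`] `= 0`, and likewise every tadpole ∕ `δm²_{(0,1)}` pair
on the external lines (the one-particle-reducible chains `C₀X_{(2,0)}C₀X_{(0,1)}C₀` with `X_{(0,1)} = Σ^ε_{(0,1)} − δm²_{(0,1)}δ^ε ≡ 0`,
BRICK 10 `condition_01_iff`); the double self-line is the constant `−η^dN(N+2)C^ε_0(0)²`, which drops from every cumulant.  WHAT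
REMAINS at `(2,1)` — inside print's *"+ …"*, not displayed — is THE λ-TADPOLE ① WHOSE LOOP CARRIES THE SUBTRACTED ORDER-`e²`
SELF-ENERGY; in (1.22)/(1.23)-style letters (vertex and both external legs at `x`, loop point `x′`, bonds `b = ⟨x′, x′+εe_μ⟩`; the
kernel's own expressions are §8/§9 above, of which these are READINGS for `q² = q2·1`):
(a) ② on the loop: `−4(N+2)λe²q²·Σ_{x′∈T_ε}ε^dΣ_{μ=1}^d c²ε²C^ε(x′,x′)C^ε_0(x−x′)C^ε_0(x′+εe_μ−x)` (print's `e²dC^ε(0)q²`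
vertex ② inserted on the loop of ①; in the kernel the vertex is point-split along the bond, `⟪φ(b₋),q²φ(b₊)⟫` — B1 (1.8)₂,₀ +
(1.10)₂,₀, as in BRICKS 7/13 —, so the loop closes through the two ends of the bond, `C^ε_0(x−x′)C^ε_0(x′+εe_μ−x)` where print's
local ② would give `d·(C^ε_0(x−x′))²`);
(b) ④ on the loop: `−4(N+2)λe²q²·Σ_{b,b′: μ_b=μ_{b′}}(ε^dc²ε)²C^ε(b₋,b′₋)Bk(b,b′;x,x)`, `Bk` = BRICK 7's four-propagator bracket of the
two cubic vertices with one scalar leg of each at `x` and the scalar line between them (`c²Bk` is the `∂C₀·∂C₀·C₀` form,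
BRICK 7 `sq_mul_Bk_eq`), i.e. ④ `−e²Σ_μq(∂^ε_μC^ε_0∂^{ε*}_μ)qC^ε` inserted on the loop of ①;
(c) the `e²δm²_{(2,0)}`-part of ⑦'s sister insertion on the loop of ①: `+4(N+2)λe²δm²_{(2,0)}·Σ_{x′∈T_ε}ε^d(C^ε_0(x−x′))²`;
together (a)+(b)+(c) = `−4(N+2)λe²·[½∂²_eG_{aa}(x,x;e)∣_{e=0} − δm²_{(2,0)}Σ_{x′}ε^d(C^ε_0(x−x′))²]`, `G_{ab}(x,x′;e)` = BRICK 7's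
`twoPt` ((1.19) at `λ = δm² = 0`), no sum on `a` (`K_eq_firstCounterterm_loopCorrected`, `condition_21_iff_loopCorrected`).
Signs, factors and the index structure `δ_{ab}tr q² + 2(q²)_{ab}` (`= (N+2)q2·δ_{ab}` for `q² = q2·1`) are the kernel's (§8); the
identification of (a)–(c) with pictures is a reading, and print's own `Σ^ε_{(2,1)}` is not displayed.

HONEST SCOPE.  (i) The datum is «`e` first, then `λ` at `0⁺`»; its identification with the `(2,1)` coefficient of the joint
Taylor expansion of (1.19) in `(e,λ)` (Schwarz for the one-sided mixed partials) is BRICK 11 `B3Eq119JointSmooth` by name, not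
re-proved here.  (ii) The counterterm inserted is `δm²_{(2,0)}e² + δm²_{(0,1)}λ + δm²_{(2,1)}e²λ + δm²_{(4,0)}e⁴`; print's series also
has `δm²_{(0,2)}λ²` (weight 4), which cannot enter a first `λ`-derivative at `0` but whose Boltzmann factor `e^{−½λ²δm²_{(0,2)}Q}` needs
the `λ²`-exponent variant of BRICK 1's one-sided lemma (BRICK 12 §2, unbuilt on the farm) — OMITTED, said so; `δm²_{(1,1)}`,
`δm²_{(3,0)}` are zero in print and absent.  (iii) §6–§9 hold at print's `δm²_{(0,1)}` only (§2–§5 for any reals); §9 for `q² =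
q2·1` only (§8 for any antisymmetric `q`).  (iv) No `ε → 0` statement: everything is an identity on one lattice `T^{(j)}_η`, any
`d`, `N`.  (v) The carrier is BRICK 7's Feynman-gauge joint weight `J`; r01's `partitionFn` ∕ r15's typed (1.19) are reached only
through BRICK 7 §8's bridge to r15's typed Feynman-gauge action, so «the `e²λ` coefficient of (1.19)» is an identification of
READINGS, as in BRICKS 7/10/13.  (vi) v1.0's §1 (private copies of BRICK 10/13 §1, farm oleans then unbuilt) is deduplicated in v1.1 by the
import of BRICK 10; BRICK 13's own copy remains until that file is next touched.  (vii) Print's `Σ^ε_{(2,1)}` as a sum over 1PI graphs is not formalized as such: the file computes the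
full order-`e²λ` coefficient and finds it of the form `C₀[Kδ^ε − δm²_{(2,1)}δ^ε]C₀`.

References: [Balaban1983Higgs3] T. Bałaban, *(Higgs)₂,₃ quantum fields in a finite volume. III. Renormalization*, CMP 88 (1983)
411–445: (1.6)–(1.10) p. 413, (1.19)–(1.22) p. 416, (1.23) p. 417; [Balaban1982Higgs1] CMP 85 (1982) 603–636: (1.7), (1.11) pp.
604–605; [GlimmJaffeQP1987] J. Glimm, A. Jaffe, *Quantum Physics*, 2nd ed., Springer 1987: §8.3 (Cor. 8.3.2), §8.4–8.5, (9.1.5).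
Unit `lit-balaban-p39-g29`; v1.0; v1.1 (gen 32): §1's ≈ 390 lines of private copies → `import B3Eq123RenormalizationConditions`,
six call sites renamed (`…_curve` → `…_massCurve` with `.2`, `J_pos₀` → `J_pos'`, `mass_pos'` → `mass_pos_of_abs_le`, primes dropped);
every public statement byte-identical to v1.0.
-/

noncomputable section

open scoped BigOperators InnerProductSpace Topology

namespace Literature.MathematicalPhysics.QuantumFieldTheory.Balaban1983to89.B3Eq123IndexTwoOne

open _root_.MeasureTheory _root_.Filter
open LatticeFieldCalculus B3WT223Instance B3WTPropagator B3WTCovariance B3WickVertexCalculus B3BilinearWick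
  B3Eq122ChargeWick B3Eq123Counterterms B3Eq123RenormalizationConditions

variable {P : Params} {j N : ℕ} (C : HiggsLattice.ChargeData N) (η w c m2 μ2 : ℝ)

/-! ## §1 The counterterm as a mass shift along a curve `δm² = ct(e)`: the `e`-derivatives of `e^{−S^ε_e}F` and dominated
differentiation under `∫dA dφ` are BRICK 10 `B3Eq123RenormalizationConditions` §1–§4, IMPORTED (v1.1; v1.0 carried private
statement-identical copies here while that module was unbuilt on the Lean farm).  Kept: three private pieces of plumbing that are
private in BRICK 10 too. -/

omit C η w c m2 μ2 in
/-- membership in the ball `∣e∣ < r` in metric form. [folklore] -/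
private theorem abs_lt_of_mem_ball' {r e : ℝ} (he : e ∈ Metric.ball (0 : ℝ) r) : |e| < r := by
  rwa [Metric.mem_ball, dist_zero_right, Real.norm_eq_abs] at he

omit C η w c m2 μ2 in
/-- the ball `∣e∣ < r` is a neighbourhood of each of its points. [folklore] -/
private theorem ball_mem_nhds' {r e₀ : ℝ} (he₀ : |e₀| < r) : Metric.ball (0 : ℝ) r ∈ 𝓝 e₀ :=
  Metric.isOpen_ball.mem_nhds (by rwa [Metric.mem_ball, dist_zero_right, Real.norm_eq_abs])

omit C η w c μ2 in
/-- a ball on which the curve is controlled: `ct` twice differentiable, `ct″` continuous at `0`, `ct(0) = 0` ⇒ on some `∣e∣ < r`: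
`∣ct∣ ≤ m²/2`, `∣ct′∣ ≤ B`, `∣ct″∣ ≤ B`. [folklore] -/
private theorem exists_ball_bounds' (hm : 0 < m2) {ct ct' ct'' : ℝ → ℝ} (hd : ∀ e, HasDerivAt ct (ct' e) e)
    (hd' : ∀ e, HasDerivAt ct' (ct'' e) e) (hc'' : ContinuousAt ct'' 0) (h0 : ct 0 = 0) :
    ∃ r B : ℝ, 0 < r ∧ (∀ e, |e| < r → |ct e| ≤ m2 / 2) ∧ (∀ e, |e| < r → |ct' e| ≤ B) ∧
      (∀ e, |e| < r → |ct'' e| ≤ B) := by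
  have h1 : ∀ᶠ e in 𝓝 (0:ℝ), dist (ct e) (ct 0) < m2 / 2 :=
    Metric.tendsto_nhds.mp (hd 0).continuousAt (m2 / 2) (half_pos hm)
  have h2 : ∀ᶠ e in 𝓝 (0:ℝ), dist (ct' e) (ct' 0) < 1 := Metric.tendsto_nhds.mp (hd' 0).continuousAt 1 one_pos
  have h3 : ∀ᶠ e in 𝓝 (0:ℝ), dist (ct'' e) (ct'' 0) < 1 := Metric.tendsto_nhds.mp hc'' 1 one_pos
  obtain ⟨r, hr, hball⟩ := Metric.eventually_nhds_iff.mp (h1.and (h2.and h3))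
  have hmem : ∀ e : ℝ, |e| < r → dist e 0 < r := fun e he => by rwa [Real.dist_eq, sub_zero]
  refine ⟨r, max (|ct' 0| + 1) (|ct'' 0| + 1), hr, fun e he => ?_, fun e he => ?_, fun e he => ?_⟩
  · have h := (hball (hmem e he)).1
    rw [Real.dist_eq, h0, sub_zero] at h
    exact h.le
  · have h := (hball (hmem e he)).2.1
    rw [Real.dist_eq] at h
    have := abs_sub_abs_le_abs_sub (ct' e) (ct' 0)
    exact le_max_of_le_left (by linarith)
  · have h := (hball (hmem e he)).2.2
    rw [Real.dist_eq] at h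
    have := abs_sub_abs_le_abs_sub (ct'' e) (ct'' 0)
    exact le_max_of_le_right (by linarith)


/-! ## §2 The `e`-derivatives of a quotient `N(e)/Z(e)` of two integrals against `e^{−S^ε_e}` along a counterterm curve —
`N(e) = ∫e^{−S^ε_{e, m²+ct(e)}}F`, `Z(e) = ∫e^{−S^ε_{e, m²+ct(e)}}F₀` with `F₀ > 0` (below: `F₀ = e^{−λU}`, `F = e^{−λU}φ_a(x)φ_b(x′)`
at a FIXED quartic coupling `λ ≥ 0`, so that `N/Z` is the two-point function (1.19) of the action (1.20)) — `(N/Z)′ =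
(N′Z − NZ′)/Z²` on a ball, `N′(0) = Z′(0) = 0`, and `iteratedDeriv 2 (N/Z) 0 = (N″(0)Z(0) − N(0)Z″(0))/Z(0)²` with
`N″(0) = ∫[D₂(0) − ½ct″(0)Σ_xη^d∣φ(x)∣²]e^{−S^ε_0}F` (BRICK 7 §6 / BRICK 10 §14 pattern, for a general positive weight `F₀`) -/

/-- positivity of `∫dA dφ e^{−S^ε_e}F₀` for a positive observable `F₀` of the scalar field (any mass `M > 0`).
[cite: Balaban1983Higgs3, (1.19) p.416] -/
theorem integral_J_mul_pos (hw : 0 < w) {M : ℝ} (hM : 0 < M) (hμ : 0 < μ2) {F₀ : Cfg P j N → ℝ} (hF₀ : ExpGrowth F₀)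
    (hpos : ∀ φ, 0 < F₀ φ) (e : ℝ) : 0 < ∫ p : JCfg P j N, J C η w c M μ2 e p * F₀ p.2 := by
  have hint : Integrable (fun p : JCfg P j N => J C η w c M μ2 e p * F₀ p.2) := integrable_J_mul C η w c M μ2 hw hM hμ hF₀ e
  have hptw : ∀ p : JCfg P j N, 0 < J C η w c M μ2 e p * F₀ p.2 := fun p => mul_pos (J_pos' C η w c μ2 M e p) (hpos p.2)
  rw [integral_pos_iff_support_of_nonneg (fun p => (hptw p).le) hint]
  have hsupp : Function.support (fun p : JCfg P j N => J C η w c M μ2 e p * F₀ p.2) = Set.univ :=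
    Set.eq_univ_iff_forall.mpr fun p => Function.mem_support.mpr (hptw p).ne'
  rw [hsupp, Measure.volume_eq_prod, ← Set.univ_prod_univ, Measure.prod_prod]
  exact ENNReal.mul_pos (isOpen_univ.measure_pos volume Set.univ_nonempty).ne'
    (isOpen_univ.measure_pos volume Set.univ_nonempty).ne'

/-- **`(N/Z)′ = (N′Z − NZ′)/Z²` ON THE BALL** `∣e∣ < r` where `∣ct∣ ≤ m²/2`, `∣ct′∣ ≤ B`: `N′(e) = ∫[D₁(e) − ½ct′(e)Σ_xη^d∣φ(x)∣²]e^{−S^ε_e}F`,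
`Z′` likewise with `F₀` — the quotient of two integrals against the weight of (1.19)/(1.20) with the counterterm `δm² = ct(e)`
differentiated in the charge. [cite: Balaban1983Higgs3, (1.19)–(1.21) p.416, (1.23) p.417] -/
theorem hasDerivAt_quot_curve_of_ball (hw : 0 < w) (hm : 0 < m2) (hμ : 0 < μ2) {F F₀ : Cfg P j N → ℝ} (hF : ExpGrowth F)
    (hF₀ : ExpGrowth F₀) (hpos : ∀ φ, 0 < F₀ φ) {ct ct' : ℝ → ℝ} {r B : ℝ} (hd : ∀ e, |e| < r → HasDerivAt ct (ct' e) e)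
    (hct : ∀ e, |e| < r → |ct e| ≤ m2 / 2) (hct' : ∀ e, |e| < r → |ct' e| ≤ B) {e₀ : ℝ} (he₀ : |e₀| < r) :
    HasDerivAt (fun e => (∫ p : JCfg P j N, J C η w c (m2 + ct e) μ2 e p * F p.2) /
        ∫ p : JCfg P j N, J C η w c (m2 + ct e) μ2 e p * F₀ p.2)
      (((∫ p : JCfg P j N, (D1 C η w c e₀ (toVec p.1) p.2 - 1 / 2 * ct' e₀ * massForm w p.2) *
            J C η w c (m2 + ct e₀) μ2 e₀ p * F p.2) *
          (∫ p : JCfg P j N, J C η w c (m2 + ct e₀) μ2 e₀ p * F₀ p.2)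
        - (∫ p : JCfg P j N, J C η w c (m2 + ct e₀) μ2 e₀ p * F p.2) *
          (∫ p : JCfg P j N, (D1 C η w c e₀ (toVec p.1) p.2 - 1 / 2 * ct' e₀ * massForm w p.2) *
            J C η w c (m2 + ct e₀) μ2 e₀ p * F₀ p.2)) /
        (∫ p : JCfg P j N, J C η w c (m2 + ct e₀) μ2 e₀ p * F₀ p.2) ^ 2) e₀ := by
  have hN := (hasDerivAt_integral_J_massCurve C η w c m2 μ2 hw hm hμ hF hd hct hct' he₀).2
  have hZ := (hasDerivAt_integral_J_massCurve C η w c m2 μ2 hw hm hμ hF₀ hd hct hct' he₀).2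
  have hZ0 : (∫ p : JCfg P j N, J C η w c (m2 + ct e₀) μ2 e₀ p * F₀ p.2) ≠ 0 :=
    (integral_J_mul_pos C η w c μ2 hw (mass_pos_of_abs_le m2 hm (hct e₀ he₀)) hμ hF₀ hpos e₀).ne'
  exact hN.div hZ hZ0

/-- the order-`e` terms vanish at `e = 0`: with `ct(0) = ct′(0) = 0` the first-derivative integral `N′(0)` is BRICK 7's
`∫D₁(0)e^{−S_0}F = 0` (one vector leg against the even Gaussian) — a PRIVATE copy, for a general weight `F`, of BRICK 10's landed
`B3Eq123RenormalizationConditions.integral_D1_J_massCurve_zero` (that module is not importable on the farm at filing time, probe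
rc 75 «unbuilt» 2026-08-24T12:3xZ; to be replaced by the import when it builds). [cite: Balaban1983Higgs3, (1.21) p.416] -/
private theorem integral_D1_J_curve_mul_zero (hw : 0 < w) (hm : 0 < m2) (hμ : 0 < μ2) {F : Cfg P j N → ℝ} (hF : ExpGrowth F)
    {ct ct' : ℝ → ℝ} (h0 : ct 0 = 0) (h0' : ct' 0 = 0) :
    ∫ p : JCfg P j N, (D1 C η w c 0 (toVec p.1) p.2 - 1 / 2 * ct' 0 * massForm w p.2) *
      J C η w c (m2 + ct 0) μ2 0 p * F p.2 = 0 := by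
  have h := integral_D1_J_zero C η w c m2 μ2 hw hm hμ hF
  simp only [h0, h0', add_zero, mul_zero, zero_mul, sub_zero]
  exact h

/-- **THE SECOND DERIVATIVE OF `N/Z` AT `e = 0` EXISTS**: the quotient-rule expression `(N′Z − NZ′)/Z²` is differentiable at `0`
with derivative `(N″(0)Z(0) − N(0)Z″(0))/Z(0)²` (the cross terms carry `N′(0) = Z′(0) = 0`), where
**`N″(0) = ∫[D₂(0) − ½ct″(0)Σ_xη^d∣φ(x)∣²]e^{−S^ε_0}F`** — BRICK 7's second charge insertion `D₂(0)` (the quartic vertex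
(1.8)₂,₀+(1.10)₂,₀ and the square of the cubic one (1.8)₁,₀) and the mass vertex (1.7) with `−½·ct″(0)`.
[cite: Balaban1983Higgs3, (1.7), (1.8), (1.10) p.413, (1.19)–(1.21) p.416, (1.23) p.417] -/
theorem hasDerivAt_deriv_quot_curve_zero_of_ball (hw : 0 < w) (hm : 0 < m2) (hμ : 0 < μ2) {F F₀ : Cfg P j N → ℝ}
    (hF : ExpGrowth F) (hF₀ : ExpGrowth F₀) (hpos : ∀ φ, 0 < F₀ φ) {ct ct' ct'' : ℝ → ℝ} {r B : ℝ} (hr : 0 < r)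
    (hd : ∀ e, |e| < r → HasDerivAt ct (ct' e) e) (hd' : ∀ e, |e| < r → HasDerivAt ct' (ct'' e) e)
    (hct : ∀ e, |e| < r → |ct e| ≤ m2 / 2) (hct' : ∀ e, |e| < r → |ct' e| ≤ B) (hct'' : ∀ e, |e| < r → |ct'' e| ≤ B)
    (h0 : ct 0 = 0) (h0' : ct' 0 = 0) :
    HasDerivAt (fun e =>
      ((∫ p : JCfg P j N, (D1 C η w c e (toVec p.1) p.2 - 1 / 2 * ct' e * massForm w p.2) *
            J C η w c (m2 + ct e) μ2 e p * F p.2) *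
          (∫ p : JCfg P j N, J C η w c (m2 + ct e) μ2 e p * F₀ p.2)
        - (∫ p : JCfg P j N, J C η w c (m2 + ct e) μ2 e p * F p.2) *
          (∫ p : JCfg P j N, (D1 C η w c e (toVec p.1) p.2 - 1 / 2 * ct' e * massForm w p.2) *
            J C η w c (m2 + ct e) μ2 e p * F₀ p.2)) /
        (∫ p : JCfg P j N, J C η w c (m2 + ct e) μ2 e p * F₀ p.2) ^ 2)
      (((∫ p : JCfg P j N, (D2 C η w c 0 (toVec p.1) p.2 - 1 / 2 * ct'' 0 * massForm w p.2) * J C η w c m2 μ2 0 p * F p.2) *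
          (∫ p : JCfg P j N, J C η w c m2 μ2 0 p * F₀ p.2)
        - (∫ p : JCfg P j N, J C η w c m2 μ2 0 p * F p.2) *
          (∫ p : JCfg P j N, (D2 C η w c 0 (toVec p.1) p.2 - 1 / 2 * ct'' 0 * massForm w p.2) * J C η w c m2 μ2 0 p * F₀ p.2)) /
        (∫ p : JCfg P j N, J C η w c m2 μ2 0 p * F₀ p.2) ^ 2) 0 := by
  have h00 : |(0 : ℝ)| < r := by rwa [abs_zero]
  have hN := (hasDerivAt_integral_J_massCurve C η w c m2 μ2 hw hm hμ hF hd hct hct' h00).2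
  have hZ := (hasDerivAt_integral_J_massCurve C η w c m2 μ2 hw hm hμ hF₀ hd hct hct' h00).2
  have hN' := (hasDerivAt_integral_D1_J_massCurve C η w c m2 μ2 hw hm hμ hF hd hd' hct hct' hct'' h00).2
  have hZ' := (hasDerivAt_integral_D1_J_massCurve C η w c m2 μ2 hw hm hμ hF₀ hd hd' hct hct' hct'' h00).2
  have h0N := integral_D1_J_curve_mul_zero C η w c m2 μ2 hw hm hμ hF h0 h0'
  have h0Z := integral_D1_J_curve_mul_zero C η w c m2 μ2 hw hm hμ hF₀ h0 h0'
  have hZ0 : (∫ p : JCfg P j N, J C η w c (m2 + ct 0) μ2 0 p * F₀ p.2) ≠ 0 :=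
    (integral_J_mul_pos C η w c μ2 hw (mass_pos_of_abs_le m2 hm (hct 0 h00)) hμ hF₀ hpos 0).ne'
  have hnum := (hN'.mul hZ).sub (hN.mul hZ')
  have hden := hZ.pow 2
  have h := hnum.div hden (pow_ne_zero 2 hZ0)
  refine h.congr_deriv ?_
  rw [h0N, h0Z]
  simp only [h0, h0', add_zero, mul_zero, zero_mul, sub_zero, ne_eq, OfNat.ofNat_ne_zero, not_false_eq_true, zero_pow,
    Pi.pow_apply]
  have hZ00 : (∫ p : JCfg P j N, J C η w c m2 μ2 0 p * F₀ p.2) ≠ 0 := by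
    have h' := hZ0; rwa [h0, add_zero] at h'
  -- freeze the integrals
  set N2 : ℝ := ∫ p : JCfg P j N, (D2 C η w c 0 (toVec p.1) p.2 - 1 / 2 * ct'' 0 * massForm w p.2) *
    J C η w c m2 μ2 0 p * F p.2 with hN2
  set Z2 : ℝ := ∫ p : JCfg P j N, (D2 C η w c 0 (toVec p.1) p.2 - 1 / 2 * ct'' 0 * massForm w p.2) *
    J C η w c m2 μ2 0 p * F₀ p.2 with hZ2
  set N0 : ℝ := ∫ p : JCfg P j N, J C η w c m2 μ2 0 p * F p.2 with hN0
  set Z0 : ℝ := ∫ p : JCfg P j N, J C η w c m2 μ2 0 p * F₀ p.2 with hZ0'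
  field_simp
  ring

/-- **`iteratedDeriv 2 (N/Z) 0 = (N″(0)Z(0) − N(0)Z″(0))/Z(0)²`**, for every counterterm curve `ct` twice differentiable
(everywhere; `ct″` continuous at `0`) with `ct(0) = ct′(0) = 0`, every observable `F` and positive weight `F₀` of the scalar
field of exponential-linear growth. [cite: Balaban1983Higgs3, (1.19)–(1.21) p.416, (1.23) p.417] -/
theorem iteratedDeriv_two_quot_curve (hw : 0 < w) (hm : 0 < m2) (hμ : 0 < μ2) {F F₀ : Cfg P j N → ℝ} (hF : ExpGrowth F)
    (hF₀ : ExpGrowth F₀) (hpos : ∀ φ, 0 < F₀ φ) {ct ct' ct'' : ℝ → ℝ} (hd : ∀ e, HasDerivAt ct (ct' e) e)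
    (hd' : ∀ e, HasDerivAt ct' (ct'' e) e) (hc'' : ContinuousAt ct'' 0) (h0 : ct 0 = 0) (h0' : ct' 0 = 0) :
    iteratedDeriv 2 (fun e => (∫ p : JCfg P j N, J C η w c (m2 + ct e) μ2 e p * F p.2) /
        ∫ p : JCfg P j N, J C η w c (m2 + ct e) μ2 e p * F₀ p.2) 0 =
      ((∫ p : JCfg P j N, (D2 C η w c 0 (toVec p.1) p.2 - 1 / 2 * ct'' 0 * massForm w p.2) * J C η w c m2 μ2 0 p * F p.2) *
          (∫ p : JCfg P j N, J C η w c m2 μ2 0 p * F₀ p.2)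
        - (∫ p : JCfg P j N, J C η w c m2 μ2 0 p * F p.2) *
          (∫ p : JCfg P j N, (D2 C η w c 0 (toVec p.1) p.2 - 1 / 2 * ct'' 0 * massForm w p.2) * J C η w c m2 μ2 0 p * F₀ p.2)) /
        (∫ p : JCfg P j N, J C η w c m2 μ2 0 p * F₀ p.2) ^ 2 := by
  obtain ⟨r, B, hr, hct, hct', hct''⟩ := exists_ball_bounds' m2 hm hd hd' hc'' h0
  have hdr : ∀ e, |e| < r → HasDerivAt ct (ct' e) e := fun e _ => hd e
  have hdr' : ∀ e, |e| < r → HasDerivAt ct' (ct'' e) e := fun e _ => hd' e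
  have h00 : |(0 : ℝ)| < r := by rwa [abs_zero]
  have hev : deriv (fun e => (∫ p : JCfg P j N, J C η w c (m2 + ct e) μ2 e p * F p.2) /
        ∫ p : JCfg P j N, J C η w c (m2 + ct e) μ2 e p * F₀ p.2) =ᶠ[𝓝 0] fun e =>
      ((∫ p : JCfg P j N, (D1 C η w c e (toVec p.1) p.2 - 1 / 2 * ct' e * massForm w p.2) *
            J C η w c (m2 + ct e) μ2 e p * F p.2) *
          (∫ p : JCfg P j N, J C η w c (m2 + ct e) μ2 e p * F₀ p.2)
        - (∫ p : JCfg P j N, J C η w c (m2 + ct e) μ2 e p * F p.2) *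
          (∫ p : JCfg P j N, (D1 C η w c e (toVec p.1) p.2 - 1 / 2 * ct' e * massForm w p.2) *
            J C η w c (m2 + ct e) μ2 e p * F₀ p.2)) /
        (∫ p : JCfg P j N, J C η w c (m2 + ct e) μ2 e p * F₀ p.2) ^ 2 :=
    Filter.eventually_of_mem (ball_mem_nhds' h00) fun e he =>
      (hasDerivAt_quot_curve_of_ball C η w c m2 μ2 hw hm hμ hF hF₀ hpos hdr hct hct' (abs_lt_of_mem_ball' he)).deriv
  rw [iteratedDeriv_succ, iteratedDeriv_one, hev.deriv_eq]
  exact (hasDerivAt_deriv_quot_curve_zero_of_ball C η w c m2 μ2 hw hm hμ hF hF₀ hpos hr hdr hdr' hct hct' hct'' h0 h0').deriv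


/-! ## §3 The values at `e = 0`: the `A`-integrals done (BRICK 7 `J_zero`, `integral_D2_J_zero`), everything is a moment of
the free scalar field — `iteratedDeriv 2 (N/Z) 0 = [M((X − κQ)F)·M(F₀) − M(F)·M((X − κQ)F₀)]/M(F₀)²`, `M(g) = ∫W₀g`,
`κ = ½ct″(0)`, `Q = Σ_xη^d∣φ(x)∣²`, and **`X` = THE `A`-AVERAGED SECOND CHARGE INSERTION** `E_A[D₂(0;A,·)]`:
`X(φ) = Σ_b η^dc²η²·C^ε(b₋,b₋)·⟪φ(b₋),q²φ(b₊)⟫ + Σ_{b,b′: μ_b=μ_{b′}}(η^dc²η)²·C^ε(b₋,b′₋)·⟪φ(b₋),qφ(b₊)⟫⟪φ(b′₋),qφ(b′₊)⟫` (the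
`A`-tadpole `⟨A_b²⟩ = C^ε(b₋,b₋)` on the quartic vertex (1.8)₂,₀+(1.10)₂,₀, and the vector line `⟨A_bA_{b′}⟩ = δ_{μμ′}C^ε(b₋,b′₋)`
joining two cubic vertices (1.8)₁,₀ — print's ② and ④ before the scalar contractions) -/

/-- `∫dA dφ e^{−S_0}g(φ) = Z_A·∫W₀g` (`Z_A = ∫W_A`, `W₀ = e^{−½⟨φ,(−Δ^η_0+m²)φ⟩}`): at `e = 0` the two free Gaussians factor.
[cite: Balaban1983Higgs3, (1.20) p.416] -/
theorem integral_J_zero_mul (g : Cfg P j N → ℝ) :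
    ∫ p : JCfg P j N, J C η w c m2 μ2 0 p * g p.2 =
      (∫ A : Cfg P j P.d, WA η w c μ2 A) * ∫ φ : Cfg P j N, weight C η w c m2 (0 : VecField P j ℝ) φ * g φ := by
  have h := integral_prod_WA_W0 (P := P) (j := j) C η w c m2 μ2 (fun _ : Cfg P j P.d => (1 : ℝ)) g
  simp only [mul_one] at h
  rw [← h]
  exact integral_congr_ae (Filter.Eventually.of_forall fun p => by dsimp only; rw [J_zero]; ring)

/-- `∫dA dφ Σ_xη^d∣φ(x)∣²·e^{−S_0}g(φ) = Z_A·∫W₀·Σ_xη^d∣φ(x)∣²·g` (the mass vertex (1.7) against the rest, at `e = 0`).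
[cite: Balaban1983Higgs3, (1.7) p.413, (1.20) p.416] -/
theorem integral_massForm_J_zero_mul (g : Cfg P j N → ℝ) :
    ∫ p : JCfg P j N, massForm w p.2 * J C η w c m2 μ2 0 p * g p.2 =
      (∫ A : Cfg P j P.d, WA η w c μ2 A) *
        ∫ φ : Cfg P j N, weight C η w c m2 (0 : VecField P j ℝ) φ * (massForm w φ * g φ) := by
  rw [← integral_J_zero_mul C η w c m2 μ2 (fun φ => massForm w φ * g φ)]
  exact integral_congr_ae (Filter.Eventually.of_forall fun p => by dsimp only; ring)

omit m2 in
/-- the `A`-averaged second charge insertion `X` is an observable of exponential-linear growth (a polynomial in the field).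
[cite: Balaban1983Higgs3, (1.8), (1.10) p.413] -/
theorem expGrowth_X {X : Cfg P j N → ℝ}
    (hX : ∀ φ, X φ = (∑ b : PBond P j, w * (c ^ 2 * η ^ 2) * G w c μ2 b.src b.src * ⟪φ b.src, C.q (C.q (φ b.tgt))⟫_ℝ)
      + ∑ b : PBond P j, ∑ b' : PBond P j, (w * (c ^ 2 * η)) * (w * (c ^ 2 * η)) *
          (G w c μ2 b.src b'.src * if b.dir = b'.dir then 1 else 0) *
            (⟪φ b.src, C.q (φ b.tgt)⟫_ℝ * ⟪φ b'.src, C.q (φ b'.tgt)⟫_ℝ)) :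
    ExpGrowth X := by
  have e : X = fun φ => (∑ b : PBond P j, w * (c ^ 2 * η ^ 2) * G w c μ2 b.src b.src * ⟪φ b.src, C.q (C.q (φ b.tgt))⟫_ℝ)
      + ∑ b : PBond P j, ∑ b' : PBond P j, (w * (c ^ 2 * η)) * (w * (c ^ 2 * η)) *
          (G w c μ2 b.src b'.src * if b.dir = b'.dir then 1 else 0) *
            (⟪φ b.src, C.q (φ b.tgt)⟫_ℝ * ⟪φ b'.src, C.q (φ b'.tgt)⟫_ℝ) := funext hX
  rw [e]
  refine (ExpGrowth.sum _ fun b _ => ?_).add (ExpGrowth.sum _ fun b _ => ExpGrowth.sum _ fun b' _ => ?_)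
  · have h := (ExpGrowth.inner_op_apply (P := P) (j := j) b.src b.tgt (C.q.comp C.q)).const_mul
      (w * (c ^ 2 * η ^ 2) * G w c μ2 b.src b.src)
    simpa only [ContinuousLinearMap.coe_comp, Function.comp_apply] using h
  · exact ((ExpGrowth.inner_op_apply b.src b.tgt C.q).mul (ExpGrowth.inner_op_apply b'.src b'.tgt C.q)).const_mul _

/-- **`∫W₀·X·g` AS THE SUM OVER THE BONDS** (linearity of the integral over the finitely many vertices and lines of `X`).
[cite: Balaban1983Higgs3, (1.21)–(1.22) p.416] -/
theorem integral_W0_X_mul (hw : 0 < w) (hm : 0 < m2) {X : Cfg P j N → ℝ}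
    (hX : ∀ φ, X φ = (∑ b : PBond P j, w * (c ^ 2 * η ^ 2) * G w c μ2 b.src b.src * ⟪φ b.src, C.q (C.q (φ b.tgt))⟫_ℝ)
      + ∑ b : PBond P j, ∑ b' : PBond P j, (w * (c ^ 2 * η)) * (w * (c ^ 2 * η)) *
          (G w c μ2 b.src b'.src * if b.dir = b'.dir then 1 else 0) *
            (⟪φ b.src, C.q (φ b.tgt)⟫_ℝ * ⟪φ b'.src, C.q (φ b'.tgt)⟫_ℝ))
    {g : Cfg P j N → ℝ} (hg : ExpGrowth g) :
    ∫ φ : Cfg P j N, weight C η w c m2 (0 : VecField P j ℝ) φ * (X φ * g φ) =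
      (∑ b : PBond P j, w * (c ^ 2 * η ^ 2) * G w c μ2 b.src b.src *
          ∫ φ : Cfg P j N, weight C η w c m2 (0 : VecField P j ℝ) φ * (⟪φ b.src, C.q (C.q (φ b.tgt))⟫_ℝ * g φ))
        + ∑ b : PBond P j, ∑ b' : PBond P j, (w * (c ^ 2 * η)) * (w * (c ^ 2 * η)) *
            (G w c μ2 b.src b'.src * if b.dir = b'.dir then 1 else 0) *
              ∫ φ : Cfg P j N, weight C η w c m2 (0 : VecField P j ℝ) φ *
                (⟪φ b.src, C.q (φ b.tgt)⟫_ℝ * ⟪φ b'.src, C.q (φ b'.tgt)⟫_ℝ * g φ) := by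
  have hI1 : ∀ b : PBond P j, Integrable (fun φ : Cfg P j N => weight C η w c m2 (0 : VecField P j ℝ) φ *
      (⟪φ b.src, C.q (C.q (φ b.tgt))⟫_ℝ * g φ)) := fun b => by
    have h := ((ExpGrowth.inner_op_apply (P := P) (j := j) b.src b.tgt (C.q.comp C.q)).mul hg).integrable C η w c m2 hw hm
    simpa only [ContinuousLinearMap.coe_comp, Function.comp_apply] using h
  have hI2 : ∀ b b' : PBond P j, Integrable (fun φ : Cfg P j N => weight C η w c m2 (0 : VecField P j ℝ) φ *
      (⟪φ b.src, C.q (φ b.tgt)⟫_ℝ * ⟪φ b'.src, C.q (φ b'.tgt)⟫_ℝ * g φ)) := fun b b' =>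
    (((ExpGrowth.inner_op_apply b.src b.tgt C.q).mul (ExpGrowth.inner_op_apply b'.src b'.tgt C.q)).mul hg).integrable
      C η w c m2 hw hm
  have hexp : (fun φ : Cfg P j N => weight C η w c m2 (0 : VecField P j ℝ) φ * (X φ * g φ)) = fun φ =>
      (∑ b : PBond P j, (w * (c ^ 2 * η ^ 2) * G w c μ2 b.src b.src) *
          (weight C η w c m2 (0 : VecField P j ℝ) φ * (⟪φ b.src, C.q (C.q (φ b.tgt))⟫_ℝ * g φ)))
        + ∑ b : PBond P j, ∑ b' : PBond P j, ((w * (c ^ 2 * η)) * (w * (c ^ 2 * η)) *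
            (G w c μ2 b.src b'.src * if b.dir = b'.dir then 1 else 0)) *
              (weight C η w c m2 (0 : VecField P j ℝ) φ * (⟪φ b.src, C.q (φ b.tgt)⟫_ℝ * ⟪φ b'.src, C.q (φ b'.tgt)⟫_ℝ * g φ)) := by
    funext φ
    rw [hX, add_mul, mul_add, Finset.sum_mul, Finset.sum_mul, Finset.mul_sum, Finset.mul_sum]
    congr 1
    · exact Finset.sum_congr rfl fun b _ => by ring
    · refine Finset.sum_congr rfl fun b _ => ?_
      rw [Finset.sum_mul, Finset.mul_sum]
      exact Finset.sum_congr rfl fun b' _ => by ring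
  have hS1 : Integrable (fun φ : Cfg P j N => ∑ b : PBond P j, (w * (c ^ 2 * η ^ 2) * G w c μ2 b.src b.src) *
      (weight C η w c m2 (0 : VecField P j ℝ) φ * (⟪φ b.src, C.q (C.q (φ b.tgt))⟫_ℝ * g φ))) :=
    integrable_finsetSum _ fun b _ => (hI1 b).const_mul _
  have hS2 : Integrable (fun φ : Cfg P j N => ∑ b : PBond P j, ∑ b' : PBond P j, ((w * (c ^ 2 * η)) * (w * (c ^ 2 * η)) *
      (G w c μ2 b.src b'.src * if b.dir = b'.dir then 1 else 0)) *
        (weight C η w c m2 (0 : VecField P j ℝ) φ * (⟪φ b.src, C.q (φ b.tgt)⟫_ℝ * ⟪φ b'.src, C.q (φ b'.tgt)⟫_ℝ * g φ))) :=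
    integrable_finsetSum _ fun b _ => integrable_finsetSum _ fun b' _ => (hI2 b b').const_mul _
  rw [hexp, integral_add hS1 hS2, integral_finsetSum _ (fun b _ => (hI1 b).const_mul _),
    integral_finsetSum _ (fun b _ => integrable_finsetSum _ fun b' _ => (hI2 b b').const_mul _)]
  congr 1
  · exact Finset.sum_congr rfl fun b _ => by rw [integral_const_mul]
  · refine Finset.sum_congr rfl fun b _ => ?_
    rw [integral_finsetSum _ (fun b' _ => (hI2 b b').const_mul _)]
    exact Finset.sum_congr rfl fun b' _ => by rw [integral_const_mul]

/-- **`∫dA dφ D₂(0;A,φ)e^{−S_0}g(φ) = Z_A·∫W₀·X·g`**: integrating out the vector field at `e = 0` turns BRICK 7's second charge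
insertion into the scalar observable `X` (the `A`-tadpole `C^ε(b₋,b₋)` on the quartic vertex and the vector line
`δ_{μμ′}C^ε(b₋,b′₋)` between two cubic vertices). [cite: Balaban1983Higgs3, (1.8), (1.10) p.413, (1.21)–(1.22) p.416] -/
theorem integral_D2_J_zero_eq_X (hw : 0 < w) (hm : 0 < m2) (hμ : 0 < μ2) {X : Cfg P j N → ℝ}
    (hX : ∀ φ, X φ = (∑ b : PBond P j, w * (c ^ 2 * η ^ 2) * G w c μ2 b.src b.src * ⟪φ b.src, C.q (C.q (φ b.tgt))⟫_ℝ)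
      + ∑ b : PBond P j, ∑ b' : PBond P j, (w * (c ^ 2 * η)) * (w * (c ^ 2 * η)) *
          (G w c μ2 b.src b'.src * if b.dir = b'.dir then 1 else 0) *
            (⟪φ b.src, C.q (φ b.tgt)⟫_ℝ * ⟪φ b'.src, C.q (φ b'.tgt)⟫_ℝ))
    {g : Cfg P j N → ℝ} (hg : ExpGrowth g) :
    ∫ p : JCfg P j N, D2 C η w c 0 (toVec p.1) p.2 * J C η w c m2 μ2 0 p * g p.2 =
      (∫ A : Cfg P j P.d, WA η w c μ2 A) * ∫ φ : Cfg P j N, weight C η w c m2 (0 : VecField P j ℝ) φ * (X φ * g φ) := by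
  rw [integral_D2_J_zero C η w c m2 μ2 hw hm hμ hg, integral_W0_X_mul C η w c m2 μ2 hw hm hX hg]

/-- **THE SECOND-DERIVATIVE INTEGRAND AT `e = 0` WITH THE MASS VERTEX, integrated over `A`**:
`∫dA dφ [D₂(0) − ½sΣ_xη^d∣φ(x)∣²]e^{−S_0}g = Z_A·∫W₀·(X − ½sΣ_xη^d∣φ(x)∣²)·g`. [cite: Balaban1983Higgs3, (1.7), (1.8), (1.10) p.413,
(1.21)–(1.22) p.416] -/
theorem integral_D2ct_J_zero_eq_X (hw : 0 < w) (hm : 0 < m2) (hμ : 0 < μ2) {X : Cfg P j N → ℝ}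
    (hX : ∀ φ, X φ = (∑ b : PBond P j, w * (c ^ 2 * η ^ 2) * G w c μ2 b.src b.src * ⟪φ b.src, C.q (C.q (φ b.tgt))⟫_ℝ)
      + ∑ b : PBond P j, ∑ b' : PBond P j, (w * (c ^ 2 * η)) * (w * (c ^ 2 * η)) *
          (G w c μ2 b.src b'.src * if b.dir = b'.dir then 1 else 0) *
            (⟪φ b.src, C.q (φ b.tgt)⟫_ℝ * ⟪φ b'.src, C.q (φ b'.tgt)⟫_ℝ))
    {g : Cfg P j N → ℝ} (hg : ExpGrowth g) (s : ℝ) :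
    ∫ p : JCfg P j N, (D2 C η w c 0 (toVec p.1) p.2 - 1 / 2 * s * massForm w p.2) * J C η w c m2 μ2 0 p * g p.2 =
      (∫ A : Cfg P j P.d, WA η w c μ2 A) *
        ∫ φ : Cfg P j N, weight C η w c m2 (0 : VecField P j ℝ) φ * ((X φ - 1 / 2 * s * massForm w φ) * g φ) := by
  have hmF := expGrowth_massForm (P := P) (j := j) (N := N) w
  have hXg := expGrowth_X C η w c μ2 hX
  have i1 : Integrable (fun p : JCfg P j N => D2 C η w c 0 (toVec p.1) p.2 * J C η w c m2 μ2 0 p * g p.2) :=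
    (hasDerivAt_integral_D1_J_mul C η w c m2 μ2 hw hm hμ hg 0).1
  have i2 : Integrable (fun p : JCfg P j N => massForm w p.2 * J C η w c m2 μ2 0 p * g p.2) := by
    have h := integrable_J_mul C η w c m2 μ2 hw hm hμ (hmF.mul hg) 0
    exact h.congr (Filter.Eventually.of_forall fun p => by dsimp only; ring)
  have j1 : Integrable (fun φ : Cfg P j N => weight C η w c m2 (0 : VecField P j ℝ) φ * (X φ * g φ)) :=
    (hXg.mul hg).integrable C η w c m2 hw hm
  have j2 : Integrable (fun φ : Cfg P j N => weight C η w c m2 (0 : VecField P j ℝ) φ * (massForm w φ * g φ)) :=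
    (hmF.mul hg).integrable C η w c m2 hw hm
  have e1 : (fun p : JCfg P j N => (D2 C η w c 0 (toVec p.1) p.2 - 1 / 2 * s * massForm w p.2) * J C η w c m2 μ2 0 p * g p.2)
      = fun p => D2 C η w c 0 (toVec p.1) p.2 * J C η w c m2 μ2 0 p * g p.2
          - (1 / 2 * s) * (massForm w p.2 * J C η w c m2 μ2 0 p * g p.2) := by
    funext p; ring
  have e2 : (fun φ : Cfg P j N => weight C η w c m2 (0 : VecField P j ℝ) φ * ((X φ - 1 / 2 * s * massForm w φ) * g φ))
      = fun φ => weight C η w c m2 (0 : VecField P j ℝ) φ * (X φ * g φ)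
          - (1 / 2 * s) * (weight C η w c m2 (0 : VecField P j ℝ) φ * (massForm w φ * g φ)) := by
    funext φ; ring
  rw [e1, e2, integral_sub i1 (i2.const_mul _), integral_sub j1 (j2.const_mul _), integral_const_mul, integral_const_mul,
    integral_D2_J_zero_eq_X C η w c m2 μ2 hw hm hμ hX hg, integral_massForm_J_zero_mul C η w c m2 μ2 g]
  ring

/-- **`iteratedDeriv 2 (N/Z) 0` AS FREE-SCALAR-FIELD MOMENTS** (`Z_A` cancels):
`d²/de²∣₀ (N/Z) = [M((X − ½ct″(0)Q)F)·M(F₀) − M(F)·M((X − ½ct″(0)Q)F₀)] / M(F₀)²`, `M(g) = ∫W₀g`, `Q = Σ_xη^d∣φ(x)∣²`.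
[cite: Balaban1983Higgs3, (1.19)–(1.22) p.416, (1.23) p.417] -/
theorem iteratedDeriv_two_quot_curve_eq_moments (hw : 0 < w) (hm : 0 < m2) (hμ : 0 < μ2) {F F₀ : Cfg P j N → ℝ}
    (hF : ExpGrowth F) (hF₀ : ExpGrowth F₀) (hpos : ∀ φ, 0 < F₀ φ) {ct ct' ct'' : ℝ → ℝ} (hd : ∀ e, HasDerivAt ct (ct' e) e)
    (hd' : ∀ e, HasDerivAt ct' (ct'' e) e) (hc'' : ContinuousAt ct'' 0) (h0 : ct 0 = 0) (h0' : ct' 0 = 0)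
    {X : Cfg P j N → ℝ}
    (hX : ∀ φ, X φ = (∑ b : PBond P j, w * (c ^ 2 * η ^ 2) * G w c μ2 b.src b.src * ⟪φ b.src, C.q (C.q (φ b.tgt))⟫_ℝ)
      + ∑ b : PBond P j, ∑ b' : PBond P j, (w * (c ^ 2 * η)) * (w * (c ^ 2 * η)) *
          (G w c μ2 b.src b'.src * if b.dir = b'.dir then 1 else 0) *
            (⟪φ b.src, C.q (φ b.tgt)⟫_ℝ * ⟪φ b'.src, C.q (φ b'.tgt)⟫_ℝ)) :
    iteratedDeriv 2 (fun e => (∫ p : JCfg P j N, J C η w c (m2 + ct e) μ2 e p * F p.2) /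
        ∫ p : JCfg P j N, J C η w c (m2 + ct e) μ2 e p * F₀ p.2) 0 =
      ((∫ φ : Cfg P j N, weight C η w c m2 (0 : VecField P j ℝ) φ * ((X φ - 1 / 2 * ct'' 0 * massForm w φ) * F φ)) *
          (∫ φ : Cfg P j N, weight C η w c m2 (0 : VecField P j ℝ) φ * F₀ φ)
        - (∫ φ : Cfg P j N, weight C η w c m2 (0 : VecField P j ℝ) φ * F φ) *
          (∫ φ : Cfg P j N, weight C η w c m2 (0 : VecField P j ℝ) φ * ((X φ - 1 / 2 * ct'' 0 * massForm w φ) * F₀ φ))) /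
        (∫ φ : Cfg P j N, weight C η w c m2 (0 : VecField P j ℝ) φ * F₀ φ) ^ 2 := by
  rw [iteratedDeriv_two_quot_curve C η w c m2 μ2 hw hm hμ hF hF₀ hpos hd hd' hc'' h0 h0',
    integral_D2ct_J_zero_eq_X C η w c m2 μ2 hw hm hμ hX hF, integral_D2ct_J_zero_eq_X C η w c m2 μ2 hw hm hμ hX hF₀,
    integral_J_zero_mul C η w c m2 μ2 F, integral_J_zero_mul C η w c m2 μ2 F₀]
  have hZA : (∫ A : Cfg P j P.d, WA η w c μ2 A) ≠ 0 := (ZA_pos η w c μ2 hw hμ).ne'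
  have hM0 : (∫ φ : Cfg P j N, weight C η w c m2 (0 : VecField P j ℝ) φ * F₀ φ) ≠ 0 := by
    have hint : Integrable (fun φ : Cfg P j N => weight C η w c m2 (0 : VecField P j ℝ) φ * F₀ φ) :=
      hF₀.integrable C η w c m2 hw hm
    have hptw : ∀ φ : Cfg P j N, 0 < weight C η w c m2 (0 : VecField P j ℝ) φ * F₀ φ := fun φ =>
      mul_pos (weight_pos _ _) (hpos φ)
    refine ne_of_gt ?_
    rw [integral_pos_iff_support_of_nonneg (fun φ => (hptw φ).le) hint]
    have hsupp : Function.support (fun φ : Cfg P j N => weight C η w c m2 (0 : VecField P j ℝ) φ * F₀ φ) = Set.univ :=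
      Set.eq_univ_iff_forall.mpr fun φ => Function.mem_support.mpr (hptw φ).ne'
    rw [hsupp]
    exact isOpen_univ.measure_pos volume Set.univ_nonempty
  set ZA : ℝ := ∫ A : Cfg P j P.d, WA η w c μ2 A
  set a1 : ℝ := ∫ φ : Cfg P j N, weight C η w c m2 (0 : VecField P j ℝ) φ * ((X φ - 1 / 2 * ct'' 0 * massForm w φ) * F φ)
  set a2 : ℝ := ∫ φ : Cfg P j N, weight C η w c m2 (0 : VecField P j ℝ) φ * F₀ φ
  set a3 : ℝ := ∫ φ : Cfg P j N, weight C η w c m2 (0 : VecField P j ℝ) φ * F φ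
  set a4 : ℝ := ∫ φ : Cfg P j N, weight C η w c m2 (0 : VecField P j ℝ) φ * ((X φ - 1 / 2 * ct'' 0 * massForm w φ) * F₀ φ)
  field_simp


/-! ## §4 The two-point function (1.19) of the action (1.20) WITH `δm² = δm²_{(2,0)}e² + δm²_{(0,1)}λ + δm²_{(2,1)}e²λ + δm²_{(4,0)}e⁴`
INSERTED, as a function of `(e, λ)` (`λ ≥ 0`): the `λ`-dependent part of the counterterm and the quartic term form the Boltzmann
factor `e^{−λU}`, **`U = Σ_yη^d∣φ(y)∣⁴ + ½δm²_{(0,1)}Σ_yη^d∣φ(y)∣²`** (bounded below), which is §2's positive weight `F₀`;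
«`e` first»: `∂²_e G^{ct}(·,λ)∣₀` for every `λ ≥ 0` by §3, then the right `λ`-derivative at `0⁺` by BRICK 1's one-sided
dominated differentiation `hasDerivWithinAt_gaussInt_exp_neg_of_le` -/

/-- the letters `d20, d01, d21, d40` = `δm²_{(2,0)}, δm²_{(0,1)}, δm²_{(2,1)}, δm²_{(4,0)}`; **the counterterm of (1.20) splits**:
`e^{−S^ε_{e, m² + δm²(e,λ)}}·e^{−λV}·g = e^{−S^ε_{e, m² + (δm²_{(2,0)}+δm²_{(2,1)}λ)e² + δm²_{(4,0)}e⁴}}·e^{−λU}·g` with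
`U = V + ½δm²_{(0,1)}Σ_xη^d∣φ(x)∣²` (the order-`λ` counterterm is a mass shift, moved into the Boltzmann factor).
[cite: Balaban1983Higgs3, (1.20) p.416, (1.23) p.417] -/
theorem fibre_mass_split (d20 d01 d21 d40 e lam : ℝ) {U : Cfg P j N → ℝ}
    (hU : ∀ φ, U φ = (∑ y : Site P j, w * ‖φ y‖ ^ 4) + 1 / 2 * d01 * massForm w φ) (g : Cfg P j N → ℝ) (p : JCfg P j N) :
    J C η w c (m2 + (d20 * e ^ 2 + d01 * lam + d21 * (e ^ 2 * lam) + d40 * e ^ 4)) μ2 e p *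
        (Real.exp (-(lam * ∑ y : Site P j, w * ‖p.2 y‖ ^ 4)) * g p.2) =
      J C η w c (m2 + ((d20 + d21 * lam) * e ^ 2 + d40 * e ^ 4)) μ2 e p * (Real.exp (-(lam * U p.2)) * g p.2) := by
  have hm : m2 + (d20 * e ^ 2 + d01 * lam + d21 * (e ^ 2 * lam) + d40 * e ^ 4) =
      (m2 + ((d20 + d21 * lam) * e ^ 2 + d40 * e ^ 4)) + d01 * lam := by ring
  rw [hm, J_mass_add C η w c (m2 + ((d20 + d21 * lam) * e ^ 2 + d40 * e ^ 4)) μ2 (d01 * lam) e p, hU, mul_assoc,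
    ← mul_assoc (Real.exp _) (Real.exp _) (g p.2), ← Real.exp_add]
  rw [show -(1 / 2 : ℝ) * (d01 * lam) * massForm w p.2 + -(lam * ∑ y : Site P j, w * ‖p.2 y‖ ^ 4)
      = -(lam * ((∑ y : Site P j, w * ‖p.2 y‖ ^ 4) + 1 / 2 * d01 * massForm w p.2)) by ring]

/-- **(1.19) WITH THE COUNTERTERM, AS §2's QUOTIENT**: for every `λ`,
`G^{ct}(e,λ) = ∫e^{−S^ε_{e, m²+c_λ(e)}}e^{−λU}φ_a(x)φ_b(x′) / ∫e^{−S^ε_{e, m²+c_λ(e)}}e^{−λU}`, `c_λ(e) = (δm²_{(2,0)}+δm²_{(2,1)}λ)e² +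
δm²_{(4,0)}e⁴`. [cite: Balaban1983Higgs3, (1.19)–(1.20) p.416, (1.23) p.417] -/
theorem twoPtCt_eq_quot (d20 d01 d21 d40 lam : ℝ) {U : Cfg P j N → ℝ}
    (hU : ∀ φ, U φ = (∑ y : Site P j, w * ‖φ y‖ ^ 4) + 1 / 2 * d01 * massForm w φ) (a b : Fin N) (x x' : Site P j) :
    (fun e : ℝ => (∫ p : JCfg P j N, J C η w c (m2 + (d20 * e ^ 2 + d01 * lam + d21 * (e ^ 2 * lam) + d40 * e ^ 4)) μ2 e p *
          (Real.exp (-(lam * ∑ y : Site P j, w * ‖p.2 y‖ ^ 4)) * legs a b x x' p.2)) /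
        ∫ p : JCfg P j N, J C η w c (m2 + (d20 * e ^ 2 + d01 * lam + d21 * (e ^ 2 * lam) + d40 * e ^ 4)) μ2 e p *
          Real.exp (-(lam * ∑ y : Site P j, w * ‖p.2 y‖ ^ 4))) =
      fun e : ℝ => (∫ p : JCfg P j N, J C η w c (m2 + ((d20 + d21 * lam) * e ^ 2 + d40 * e ^ 4)) μ2 e p *
          (Real.exp (-(lam * U p.2)) * legs a b x x' p.2)) /
        ∫ p : JCfg P j N, J C η w c (m2 + ((d20 + d21 * lam) * e ^ 2 + d40 * e ^ 4)) μ2 e p * Real.exp (-(lam * U p.2)) := by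
  funext e
  have h1 := fun p : JCfg P j N => fibre_mass_split C η w c m2 μ2 d20 d01 d21 d40 e lam hU (legs a b x x') p
  have h2 := fun p : JCfg P j N => fibre_mass_split C η w c m2 μ2 d20 d01 d21 d40 e lam hU (fun _ => (1 : ℝ)) p
  simp only [mul_one] at h2
  rw [integral_congr_ae (Filter.Eventually.of_forall h1), integral_congr_ae (Filter.Eventually.of_forall h2)]

omit C η c m2 μ2 in
/-- **the interaction `U = Σ_yη^d(∣φ(y)∣⁴ + ½δm²_{(0,1)}∣φ(y)∣²)` is bounded below** (`t² + ½δt ≥ −δ²/16` per site; `δm²_{(0,1)} < 0`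
in print). [cite: Balaban1983Higgs3, (1.20) p.416, (1.23) p.417] -/
theorem neg_le_U (hw : 0 ≤ w) (d01 : ℝ) {U : Cfg P j N → ℝ}
    (hU : ∀ φ, U φ = (∑ y : Site P j, w * ‖φ y‖ ^ 4) + 1 / 2 * d01 * massForm w φ) (φ : Cfg P j N) :
    -(Fintype.card (Site P j) * (w * d01 ^ 2 / 16)) ≤ U φ := by
  rw [hU, massForm, Finset.mul_sum, ← Finset.sum_add_distrib]
  have hy : ∀ y : Site P j, -(w * d01 ^ 2 / 16) ≤ w * ‖φ y‖ ^ 4 + 1 / 2 * d01 * (w * ‖φ y‖ ^ 2) := fun y => by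
    nlinarith [mul_nonneg hw (sq_nonneg (‖φ y‖ ^ 2 + d01 / 4))]
  calc -(Fintype.card (Site P j) * (w * d01 ^ 2 / 16)) = ∑ _y : Site P j, -(w * d01 ^ 2 / 16) := by
        rw [Finset.sum_const, Finset.card_univ, nsmul_eq_mul]; ring
    _ ≤ _ := Finset.sum_le_sum fun y _ => hy y

omit C η c m2 μ2 in
/-- `U` is an observable of exponential-linear growth. [cite: Balaban1983Higgs3, (1.20) p.416] -/
theorem expGrowth_U (d01 : ℝ) {U : Cfg P j N → ℝ}
    (hU : ∀ φ, U φ = (∑ y : Site P j, w * ‖φ y‖ ^ 4) + 1 / 2 * d01 * massForm w φ) : ExpGrowth U := by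
  have e : U = fun φ => (∑ y : Site P j, w * ‖φ y‖ ^ 4) + 1 / 2 * d01 * massForm w φ := funext hU
  rw [e]
  exact (B3Eq122FirstOrderWick.expGrowth_V w).add ((expGrowth_massForm (P := P) (j := j) (N := N) w).const_mul _)

omit C η c m2 μ2 in
/-- **the Boltzmann factor `e^{−λU}` (`λ ≥ 0`) is a positive observable of exponential-linear growth** (bounded by `e^{λK}`).
[cite: Balaban1983Higgs3, (1.20) p.416] -/
theorem expGrowth_expU (hw : 0 ≤ w) (d01 : ℝ) {lam : ℝ} (hlam : 0 ≤ lam) {U : Cfg P j N → ℝ}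
    (hU : ∀ φ, U φ = (∑ y : Site P j, w * ‖φ y‖ ^ 4) + 1 / 2 * d01 * massForm w φ) :
    ExpGrowth (fun φ : Cfg P j N => Real.exp (-(lam * U φ))) := by
  have hUc : Continuous U := (expGrowth_U w d01 hU).1
  refine ⟨(continuous_const.mul hUc).neg.rexp, Real.exp (lam * (Fintype.card (Site P j) * (w * d01 ^ 2 / 16))), 0,
    (Real.exp_pos _).le, le_rfl, fun φ => ?_⟩
  rw [zero_mul, Real.exp_zero, mul_one, abs_of_pos (Real.exp_pos _)]
  have hK := neg_le_U w hw d01 hU φ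
  exact Real.exp_le_exp.mpr (by nlinarith [mul_nonneg hlam (show (0:ℝ) ≤ U φ + Fintype.card (Site P j) * (w * d01 ^ 2 / 16) by
    linarith)])

/-- **`∂²_e G^{ct}(·,λ)∣_{e=0}` FOR EVERY `λ ≥ 0`, AS FREE-FIELD MOMENTS** (§3 with `F₀ = e^{−λU}`, `F = e^{−λU}φ_a(x)φ_b(x′)`, curve
`c_λ`, `½c_λ″(0) = δm²_{(2,0)} + δm²_{(2,1)}λ`): writing `I_λ(g) = ∫W₀e^{−λU}g`, `L = φ_a(x)φ_b(x′)`, `Q = Σ_xη^d∣φ(x)∣²`, `κ_λ =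
δm²_{(2,0)} + δm²_{(2,1)}λ`,
`iteratedDeriv 2 (G^{ct}(·,λ)) 0 = [(I_λ(XL) − κ_λI_λ(QL))·I_λ(1) − I_λ(L)·(I_λ(X) − κ_λI_λ(Q))] / I_λ(1)²`.
[cite: Balaban1983Higgs3, (1.19)–(1.22) p.416, (1.23) p.417] -/
theorem iteratedDeriv_two_twoPtCt_eq_moments (hw : 0 < w) (hm : 0 < m2) (hμ : 0 < μ2) (d20 d01 d21 d40 : ℝ) {lam : ℝ}
    (hlam : 0 ≤ lam) {X U : Cfg P j N → ℝ}
    (hX : ∀ φ, X φ = (∑ b : PBond P j, w * (c ^ 2 * η ^ 2) * G w c μ2 b.src b.src * ⟪φ b.src, C.q (C.q (φ b.tgt))⟫_ℝ)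
      + ∑ b : PBond P j, ∑ b' : PBond P j, (w * (c ^ 2 * η)) * (w * (c ^ 2 * η)) *
          (G w c μ2 b.src b'.src * if b.dir = b'.dir then 1 else 0) *
            (⟪φ b.src, C.q (φ b.tgt)⟫_ℝ * ⟪φ b'.src, C.q (φ b'.tgt)⟫_ℝ))
    (hU : ∀ φ, U φ = (∑ y : Site P j, w * ‖φ y‖ ^ 4) + 1 / 2 * d01 * massForm w φ) (a b : Fin N) (x x' : Site P j) :
    iteratedDeriv 2 (fun e : ℝ =>
        (∫ p : JCfg P j N, J C η w c (m2 + (d20 * e ^ 2 + d01 * lam + d21 * (e ^ 2 * lam) + d40 * e ^ 4)) μ2 e p *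
            (Real.exp (-(lam * ∑ y : Site P j, w * ‖p.2 y‖ ^ 4)) * legs a b x x' p.2)) /
          ∫ p : JCfg P j N, J C η w c (m2 + (d20 * e ^ 2 + d01 * lam + d21 * (e ^ 2 * lam) + d40 * e ^ 4)) μ2 e p *
            Real.exp (-(lam * ∑ y : Site P j, w * ‖p.2 y‖ ^ 4))) 0 =
      (((∫ φ : Cfg P j N, weight C η w c m2 (0 : VecField P j ℝ) φ * (Real.exp (-(lam * U φ)) * (X φ * legs a b x x' φ)))
            - (d20 + d21 * lam) *
              ∫ φ : Cfg P j N, weight C η w c m2 (0 : VecField P j ℝ) φ * (Real.exp (-(lam * U φ)) * (massForm w φ * legs a b x x' φ)))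
          * (∫ φ : Cfg P j N, weight C η w c m2 (0 : VecField P j ℝ) φ * (Real.exp (-(lam * U φ)) * 1))
        - (∫ φ : Cfg P j N, weight C η w c m2 (0 : VecField P j ℝ) φ * (Real.exp (-(lam * U φ)) * legs a b x x' φ)) *
          ((∫ φ : Cfg P j N, weight C η w c m2 (0 : VecField P j ℝ) φ * (Real.exp (-(lam * U φ)) * X φ))
            - (d20 + d21 * lam) *
              ∫ φ : Cfg P j N, weight C η w c m2 (0 : VecField P j ℝ) φ * (Real.exp (-(lam * U φ)) * massForm w φ))) /
        (∫ φ : Cfg P j N, weight C η w c m2 (0 : VecField P j ℝ) φ * (Real.exp (-(lam * U φ)) * 1)) ^ 2 := by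
  -- the curve `c_λ(e) = κ_λe² + δm²_{(4,0)}e⁴`
  set ct : ℝ → ℝ := fun e => (d20 + d21 * lam) * e ^ 2 + d40 * e ^ 4 with hct
  set ct' : ℝ → ℝ := fun e => 2 * (d20 + d21 * lam) * e + 4 * d40 * e ^ 3 with hct'
  set ct'' : ℝ → ℝ := fun e => 2 * (d20 + d21 * lam) + 12 * d40 * e ^ 2 with hct''
  have hd : ∀ e, HasDerivAt ct (ct' e) e := fun e => by
    have h := ((hasDerivAt_pow 2 e).const_mul (d20 + d21 * lam)).add ((hasDerivAt_pow 4 e).const_mul d40)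
    refine h.congr_deriv ?_
    simp only [hct', Nat.cast_ofNat]
    ring
  have hd' : ∀ e, HasDerivAt ct' (ct'' e) e := fun e => by
    have h := (((hasDerivAt_id e).const_mul (2 * (d20 + d21 * lam)))).add ((hasDerivAt_pow 3 e).const_mul (4 * d40))
    refine h.congr_deriv ?_
    simp only [hct'', Nat.cast_ofNat]
    ring
  have hc'' : ContinuousAt ct'' 0 := (continuous_const.add (continuous_const.mul (continuous_pow 2))).continuousAt
  have h0 : ct 0 = 0 := by simp only [hct]; ring
  have h0' : ct' 0 = 0 := by simp only [hct']; ring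
  have hκ : 1 / 2 * ct'' 0 = d20 + d21 * lam := by simp only [hct'']; ring
  -- the observables
  have hE := expGrowth_expU w hw.le d01 hlam hU
  have hEL : ExpGrowth (fun φ : Cfg P j N => Real.exp (-(lam * U φ)) * legs a b x x' φ) := hE.mul (expGrowth_legs a b x x')
  have hEpos : ∀ φ : Cfg P j N, 0 < Real.exp (-(lam * U φ)) := fun φ => Real.exp_pos _
  have hmain := iteratedDeriv_two_quot_curve_eq_moments C η w c m2 μ2 hw hm hμ hEL hE hEpos hd hd' hc'' h0 h0' hX
  rw [twoPtCt_eq_quot C η w c m2 μ2 d20 d01 d21 d40 lam hU a b x x']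
  have hfun : (fun e : ℝ => (∫ p : JCfg P j N, J C η w c (m2 + ((d20 + d21 * lam) * e ^ 2 + d40 * e ^ 4)) μ2 e p *
          (Real.exp (-(lam * U p.2)) * legs a b x x' p.2)) /
        ∫ p : JCfg P j N, J C η w c (m2 + ((d20 + d21 * lam) * e ^ 2 + d40 * e ^ 4)) μ2 e p * Real.exp (-(lam * U p.2))) =
      fun e : ℝ => (∫ p : JCfg P j N, J C η w c (m2 + ct e) μ2 e p *
          (fun φ : Cfg P j N => Real.exp (-(lam * U φ)) * legs a b x x' φ) p.2) /
        ∫ p : JCfg P j N, J C η w c (m2 + ct e) μ2 e p * (fun φ : Cfg P j N => Real.exp (-(lam * U φ))) p.2 := by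
    funext e; rfl
  rw [hfun, hmain, hκ]
  -- linearity of the moments in the observable
  have hmF := expGrowth_massForm (P := P) (j := j) (N := N) w
  have hXg := expGrowth_X C η w c μ2 hX
  have hL := expGrowth_legs (P := P) (j := j) a b x x'
  have i1 := (hE.mul (hXg.mul hL)).integrable C η w c m2 hw hm
  have i2 := (hE.mul (hmF.mul hL)).integrable C η w c m2 hw hm
  have i3 := (hE.mul hXg).integrable C η w c m2 hw hm
  have i4 := (hE.mul hmF).integrable C η w c m2 hw hm
  have e1 : (∫ φ : Cfg P j N, weight C η w c m2 (0 : VecField P j ℝ) φ *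
      ((X φ - (d20 + d21 * lam) * massForm w φ) * (fun φ : Cfg P j N => Real.exp (-(lam * U φ)) * legs a b x x' φ) φ)) =
      (∫ φ : Cfg P j N, weight C η w c m2 (0 : VecField P j ℝ) φ * (Real.exp (-(lam * U φ)) * (X φ * legs a b x x' φ)))
        - (d20 + d21 * lam) *
          ∫ φ : Cfg P j N, weight C η w c m2 (0 : VecField P j ℝ) φ * (Real.exp (-(lam * U φ)) * (massForm w φ * legs a b x x' φ)) := by
    rw [← integral_const_mul, ← integral_sub i1 (i2.const_mul _)]
    exact integral_congr_ae (Filter.Eventually.of_forall fun φ => by dsimp only; ring)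
  have e2 : (∫ φ : Cfg P j N, weight C η w c m2 (0 : VecField P j ℝ) φ *
      ((X φ - (d20 + d21 * lam) * massForm w φ) * (fun φ : Cfg P j N => Real.exp (-(lam * U φ))) φ)) =
      (∫ φ : Cfg P j N, weight C η w c m2 (0 : VecField P j ℝ) φ * (Real.exp (-(lam * U φ)) * X φ))
        - (d20 + d21 * lam) *
          ∫ φ : Cfg P j N, weight C η w c m2 (0 : VecField P j ℝ) φ * (Real.exp (-(lam * U φ)) * massForm w φ) := by
    rw [← integral_const_mul, ← integral_sub i3 (i4.const_mul _)]
    exact integral_congr_ae (Filter.Eventually.of_forall fun φ => by dsimp only; ring)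
  have e3 : (∫ φ : Cfg P j N, weight C η w c m2 (0 : VecField P j ℝ) φ * (fun φ : Cfg P j N => Real.exp (-(lam * U φ))) φ) =
      ∫ φ : Cfg P j N, weight C η w c m2 (0 : VecField P j ℝ) φ * (Real.exp (-(lam * U φ)) * 1) :=
    integral_congr_ae (Filter.Eventually.of_forall fun φ => by dsimp only; ring)
  have e4 : (∫ φ : Cfg P j N, weight C η w c m2 (0 : VecField P j ℝ) φ *
      (fun φ : Cfg P j N => Real.exp (-(lam * U φ)) * legs a b x x' φ) φ) =
      ∫ φ : Cfg P j N, weight C η w c m2 (0 : VecField P j ℝ) φ * (Real.exp (-(lam * U φ)) * legs a b x x' φ) :=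
    integral_congr_ae (Filter.Eventually.of_forall fun φ => by dsimp only)
  rw [e1, e2, e3, e4]


/-- **THE INDEX `(2,1)` OF PRINT'S RECURSION, DERIVED FROM THE MEASURE (cumulant form).**  For the two-point function (1.19)
of the action (1.20) with `δm² = δm²_{(2,0)}e² + δm²_{(0,1)}λ + δm²_{(2,1)}e²λ + δm²_{(4,0)}e⁴` inserted,
`G^{ct}_{ab}(e,λ;x,x′) = ∫dA dφ e^{−S^ε}e^{−λV}φ_a(x)φ_b(x′)/∫dA dφ e^{−S^ε}e^{−λV}` (the letters `d20, d01, d21, d40`; `V =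
Σ_yη^d∣φ(y)∣⁴`), the function `λ ↦ ∂²_e G^{ct}(·,λ)∣_{e=0}` (`λ ≥ 0`, §4's moment expression: every `I_λ(g) = ∫W₀e^{−λU}g` is
right-differentiable at `0⁺` with derivative `−∫W₀Ug` by BRICK 1's one-sided dominated differentiation, `U` being bounded below)
is right-differentiable at `λ = 0⁺` and
**`∂_λ⁺∂²_e G^{ct}∣₀ = −κ₃(L, Y, U) − δm²_{(2,1)}·κ₂(L, Q)`**, `L = φ_a(x)φ_b(x′)`, `Q = Σ_xη^d∣φ(x)∣²`, **`Y = X − δm²_{(2,0)}Q`**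
(the `A`-averaged order-`e²` insertion ②+④ MINUS its counterterm), **`U = V + ½δm²_{(0,1)}Q`** (the quartic interaction PLUS the
order-`λ` counterterm), cumulants of the free field `⟨·⟩ = Z₀⁻¹∫W₀(·)`:
`κ₃(L,Y,U) = ⟨LYU⟩ − ⟨LY⟩⟨U⟩ − ⟨LU⟩⟨Y⟩ − ⟨L⟩⟨YU⟩ + 2⟨L⟩⟨Y⟩⟨U⟩`, `κ₂(L,Q) = ⟨LQ⟩ − ⟨L⟩⟨Q⟩`.  Print's coefficient of `e²λ` is
`(2!·1!)⁻¹` times this number (p. 417: *"expanded into power series in e, λ"*); its equation *"−δm²_{(2,1)} + Σ_xε^dΣ^ε_{(2,1)}(x) =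
0"* constrains `d21` through the last term, `−δm²_{(2,1)}κ₂(L,Q) = 2·[C₀(−δm²_{(2,1)})C₀]_{ab}(x,x′)` (§5 `kappa2_legs_massForm`:
`κ₂(L,Q) = 2δ_{ab}Σ_zη^dC₀(x,z)C₀(x′,z)`, lattice products carrying the volume element `η^d`), the cumulant
`κ₃` being the sum of all CONNECTED graphs with the three vertex groups `L`, `Y`, `U` (Wick's theorem, §6 ff.).
[cite: Balaban1983Higgs3, (1.19)–(1.22) p.416, (1.23) p.417] [cite: GlimmJaffeQP1987, §8.4–8.5] -/
theorem hasDerivWithinAt_index21 (hw : 0 < w) (hm : 0 < m2) (hμ : 0 < μ2) (d20 d01 d21 d40 : ℝ) {X Y U : Cfg P j N → ℝ}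
    (hX : ∀ φ, X φ = (∑ b : PBond P j, w * (c ^ 2 * η ^ 2) * G w c μ2 b.src b.src * ⟪φ b.src, C.q (C.q (φ b.tgt))⟫_ℝ)
      + ∑ b : PBond P j, ∑ b' : PBond P j, (w * (c ^ 2 * η)) * (w * (c ^ 2 * η)) *
          (G w c μ2 b.src b'.src * if b.dir = b'.dir then 1 else 0) *
            (⟪φ b.src, C.q (φ b.tgt)⟫_ℝ * ⟪φ b'.src, C.q (φ b'.tgt)⟫_ℝ))
    (hY : ∀ φ, Y φ = X φ - d20 * massForm w φ)
    (hU : ∀ φ, U φ = (∑ y : Site P j, w * ‖φ y‖ ^ 4) + 1 / 2 * d01 * massForm w φ) (a b : Fin N) (x x' : Site P j) :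
    HasDerivWithinAt (fun lam : ℝ => iteratedDeriv 2 (fun e : ℝ =>
        (∫ p : JCfg P j N, J C η w c (m2 + (d20 * e ^ 2 + d01 * lam + d21 * (e ^ 2 * lam) + d40 * e ^ 4)) μ2 e p *
            (Real.exp (-(lam * ∑ y : Site P j, w * ‖p.2 y‖ ^ 4)) * legs a b x x' p.2)) /
          ∫ p : JCfg P j N, J C η w c (m2 + (d20 * e ^ 2 + d01 * lam + d21 * (e ^ 2 * lam) + d40 * e ^ 4)) μ2 e p *
            Real.exp (-(lam * ∑ y : Site P j, w * ‖p.2 y‖ ^ 4))) 0)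
      (-((∫ φ : Cfg P j N, weight C η w c m2 (0 : VecField P j ℝ) φ * (U φ * (Y φ * legs a b x x' φ))) /
              (∫ φ : Cfg P j N, weight C η w c m2 (0 : VecField P j ℝ) φ)
            - (∫ φ : Cfg P j N, weight C η w c m2 (0 : VecField P j ℝ) φ * (Y φ * legs a b x x' φ)) *
                (∫ φ : Cfg P j N, weight C η w c m2 (0 : VecField P j ℝ) φ * U φ) /
              (∫ φ : Cfg P j N, weight C η w c m2 (0 : VecField P j ℝ) φ) ^ 2
            - (∫ φ : Cfg P j N, weight C η w c m2 (0 : VecField P j ℝ) φ * (U φ * legs a b x x' φ)) *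
                (∫ φ : Cfg P j N, weight C η w c m2 (0 : VecField P j ℝ) φ * Y φ) /
              (∫ φ : Cfg P j N, weight C η w c m2 (0 : VecField P j ℝ) φ) ^ 2
            - (∫ φ : Cfg P j N, weight C η w c m2 (0 : VecField P j ℝ) φ * legs a b x x' φ) *
                (∫ φ : Cfg P j N, weight C η w c m2 (0 : VecField P j ℝ) φ * (U φ * Y φ)) /
              (∫ φ : Cfg P j N, weight C η w c m2 (0 : VecField P j ℝ) φ) ^ 2
            + 2 * (∫ φ : Cfg P j N, weight C η w c m2 (0 : VecField P j ℝ) φ * legs a b x x' φ) *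
                (∫ φ : Cfg P j N, weight C η w c m2 (0 : VecField P j ℝ) φ * Y φ) *
                (∫ φ : Cfg P j N, weight C η w c m2 (0 : VecField P j ℝ) φ * U φ) /
              (∫ φ : Cfg P j N, weight C η w c m2 (0 : VecField P j ℝ) φ) ^ 3)
        - d21 * ((∫ φ : Cfg P j N, weight C η w c m2 (0 : VecField P j ℝ) φ * (massForm w φ * legs a b x x' φ)) /
              (∫ φ : Cfg P j N, weight C η w c m2 (0 : VecField P j ℝ) φ)
            - (∫ φ : Cfg P j N, weight C η w c m2 (0 : VecField P j ℝ) φ * legs a b x x' φ) *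
                (∫ φ : Cfg P j N, weight C η w c m2 (0 : VecField P j ℝ) φ * massForm w φ) /
              (∫ φ : Cfg P j N, weight C η w c m2 (0 : VecField P j ℝ) φ) ^ 2))
      (Set.Ici 0) 0 := by
  -- THE `λ`-STEP: every `I_λ(g) = ∫W₀e^{−λU}g` is right-differentiable at `0⁺` with derivative `−∫W₀Ug`
  -- (BRICK 1 `hasDerivWithinAt_gaussInt_exp_neg_of_le`, `U ≥ −∣T∣η^dδm²_{(0,1)}²/16`), and the quotient rule
  have hUg := expGrowth_U w d01 hU
  have hK : ∀ φ : Cfg P j N, -(Fintype.card (Site P j) * (w * d01 ^ 2 / 16)) ≤ U φ := neg_le_U w hw.le d01 hU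
  have hXg := expGrowth_X C η w c μ2 hX
  have hL := expGrowth_legs (P := P) (j := j) a b x x'
  have hmF := expGrowth_massForm (P := P) (j := j) (N := N) w
  have h1 := B3Eq122FirstOrderWick.hasDerivWithinAt_gaussInt_exp_neg_of_le C η w c m2 hw hm hUg hK (hXg.mul hL)
  have h2 := B3Eq122FirstOrderWick.hasDerivWithinAt_gaussInt_exp_neg_of_le C η w c m2 hw hm hUg hK (hmF.mul hL)
  have h3 := B3Eq122FirstOrderWick.hasDerivWithinAt_gaussInt_exp_neg_of_le C η w c m2 hw hm hUg hK (ExpGrowth.const (1 : ℝ))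
  have h4 := B3Eq122FirstOrderWick.hasDerivWithinAt_gaussInt_exp_neg_of_le C η w c m2 hw hm hUg hK hL
  have h5 := B3Eq122FirstOrderWick.hasDerivWithinAt_gaussInt_exp_neg_of_le C η w c m2 hw hm hUg hK hXg
  have h6 := B3Eq122FirstOrderWick.hasDerivWithinAt_gaussInt_exp_neg_of_le C η w c m2 hw hm hUg hK hmF
  have hκ : HasDerivWithinAt (fun lam : ℝ => d20 + d21 * lam) d21 (Set.Ici 0) 0 := by
    have h := ((hasDerivAt_id (0 : ℝ)).const_mul d21).const_add d20
    simp only [mul_one] at h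
    exact h.hasDerivWithinAt
  have hZ : 0 < ∫ φ : Cfg P j N, weight C η w c m2 (0 : VecField P j ℝ) φ := B3WT226Traces.Z_pos C η w c m2 hw hm
  have hden0 : (∫ φ : Cfg P j N, weight C η w c m2 (0 : VecField P j ℝ) φ * (Real.exp (-(0 * U φ)) * 1)) =
      ∫ φ : Cfg P j N, weight C η w c m2 (0 : VecField P j ℝ) φ := by
    rw [B3Eq122FirstOrderWick.gaussInt_exp_neg_zero]; simp only [mul_one]
  have h := (((h1.sub (hκ.mul h2)).mul h3).sub (h4.mul (h5.sub (hκ.mul h6)))).div (h3.pow 2) (by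
    show (∫ φ : Cfg P j N, weight C η w c m2 (0 : VecField P j ℝ) φ * (Real.exp (-(0 * U φ)) * 1)) ^ 2 ≠ 0
    rw [hden0]; exact pow_ne_zero 2 hZ.ne')
  -- on `[0, ∞)` the function is §4's moment expression, pointwise (`iteratedDeriv_two_twoPtCt_eq_moments`)
  have h0 := iteratedDeriv_two_twoPtCt_eq_moments C η w c m2 μ2 hw hm hμ d20 d01 d21 d40 (le_refl (0 : ℝ)) hX hU a b x x'
  refine HasDerivWithinAt.congr_deriv (h.congr_of_eventuallyEq (eventually_nhdsWithin_of_forall fun lam hlam =>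
    iteratedDeriv_two_twoPtCt_eq_moments C η w c m2 μ2 hw hm hμ d20 d01 d21 d40 hlam hX hU a b x x') h0) ?_
  -- the value: `e^{0} = 1`, `Y = X − δm²_{(2,0)}Q` by linearity of the moments, and the cumulant algebra
  have lin : ∀ {g : Cfg P j N → ℝ}, ExpGrowth g →
      (∫ φ : Cfg P j N, weight C η w c m2 (0 : VecField P j ℝ) φ * (g φ * Y φ)) =
        (∫ φ : Cfg P j N, weight C η w c m2 (0 : VecField P j ℝ) φ * (g φ * X φ))
          - d20 * ∫ φ : Cfg P j N, weight C η w c m2 (0 : VecField P j ℝ) φ * (g φ * massForm w φ) := by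
    intro g hg
    rw [← integral_const_mul, ← integral_sub ((hg.mul hXg).integrable C η w c m2 hw hm)
      (((hg.mul hmF).integrable C η w c m2 hw hm).const_mul _)]
    exact integral_congr_ae (Filter.Eventually.of_forall fun φ => by dsimp only; rw [hY]; ring)
  have e1 : (∫ φ : Cfg P j N, weight C η w c m2 (0 : VecField P j ℝ) φ * (U φ * (Y φ * legs a b x x' φ))) =
      (∫ φ : Cfg P j N, weight C η w c m2 (0 : VecField P j ℝ) φ * (U φ * (X φ * legs a b x x' φ)))
        - d20 * ∫ φ : Cfg P j N, weight C η w c m2 (0 : VecField P j ℝ) φ * (U φ * (massForm w φ * legs a b x x' φ)) := by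
    have h' := lin (hUg.mul hL)
    have r1 : (∫ φ : Cfg P j N, weight C η w c m2 (0 : VecField P j ℝ) φ * (U φ * (Y φ * legs a b x x' φ))) =
        ∫ φ : Cfg P j N, weight C η w c m2 (0 : VecField P j ℝ) φ * ((U φ * legs a b x x' φ) * Y φ) :=
      integral_congr_ae (Filter.Eventually.of_forall fun φ => by dsimp only; ring)
    have r2 : (∫ φ : Cfg P j N, weight C η w c m2 (0 : VecField P j ℝ) φ * (U φ * (X φ * legs a b x x' φ))) =
        ∫ φ : Cfg P j N, weight C η w c m2 (0 : VecField P j ℝ) φ * ((U φ * legs a b x x' φ) * X φ) :=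
      integral_congr_ae (Filter.Eventually.of_forall fun φ => by dsimp only; ring)
    have r3 : (∫ φ : Cfg P j N, weight C η w c m2 (0 : VecField P j ℝ) φ * (U φ * (massForm w φ * legs a b x x' φ))) =
        ∫ φ : Cfg P j N, weight C η w c m2 (0 : VecField P j ℝ) φ * ((U φ * legs a b x x' φ) * massForm w φ) :=
      integral_congr_ae (Filter.Eventually.of_forall fun φ => by dsimp only; ring)
    rw [r1, r2, r3, h']
  have e2 : (∫ φ : Cfg P j N, weight C η w c m2 (0 : VecField P j ℝ) φ * (Y φ * legs a b x x' φ)) =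
      (∫ φ : Cfg P j N, weight C η w c m2 (0 : VecField P j ℝ) φ * (X φ * legs a b x x' φ))
        - d20 * ∫ φ : Cfg P j N, weight C η w c m2 (0 : VecField P j ℝ) φ * (massForm w φ * legs a b x x' φ) := by
    have h' := lin hL
    have r1 : ∀ g : Cfg P j N → ℝ, (∫ φ : Cfg P j N, weight C η w c m2 (0 : VecField P j ℝ) φ * (g φ * legs a b x x' φ)) =
        ∫ φ : Cfg P j N, weight C η w c m2 (0 : VecField P j ℝ) φ * (legs a b x x' φ * g φ) := fun g =>
      integral_congr_ae (Filter.Eventually.of_forall fun φ => by dsimp only; ring)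
    rw [r1, r1, r1, h']
  have e3 : (∫ φ : Cfg P j N, weight C η w c m2 (0 : VecField P j ℝ) φ * Y φ) =
      (∫ φ : Cfg P j N, weight C η w c m2 (0 : VecField P j ℝ) φ * X φ)
        - d20 * ∫ φ : Cfg P j N, weight C η w c m2 (0 : VecField P j ℝ) φ * massForm w φ := by
    have h' := lin (ExpGrowth.const (1 : ℝ))
    simp only [one_mul] at h'
    exact h'
  have e4 : (∫ φ : Cfg P j N, weight C η w c m2 (0 : VecField P j ℝ) φ * (U φ * Y φ)) =
      (∫ φ : Cfg P j N, weight C η w c m2 (0 : VecField P j ℝ) φ * (U φ * X φ))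
        - d20 * ∫ φ : Cfg P j N, weight C η w c m2 (0 : VecField P j ℝ) φ * (U φ * massForm w φ) := lin hUg
  rw [e1, e2, e3, e4]
  simp only [Pi.pow_apply, Pi.sub_apply, Pi.mul_apply, zero_mul, mul_zero, add_zero, neg_zero, Real.exp_zero, one_mul,
    mul_one]
  set Z : ℝ := ∫ φ : Cfg P j N, weight C η w c m2 (0 : VecField P j ℝ) φ
  set mL : ℝ := ∫ φ : Cfg P j N, weight C η w c m2 (0 : VecField P j ℝ) φ * legs a b x x' φ
  set mX : ℝ := ∫ φ : Cfg P j N, weight C η w c m2 (0 : VecField P j ℝ) φ * X φ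
  set mQ : ℝ := ∫ φ : Cfg P j N, weight C η w c m2 (0 : VecField P j ℝ) φ * massForm w φ
  set mU : ℝ := ∫ φ : Cfg P j N, weight C η w c m2 (0 : VecField P j ℝ) φ * U φ
  set mXL : ℝ := ∫ φ : Cfg P j N, weight C η w c m2 (0 : VecField P j ℝ) φ * (X φ * legs a b x x' φ)
  set mQL : ℝ := ∫ φ : Cfg P j N, weight C η w c m2 (0 : VecField P j ℝ) φ * (massForm w φ * legs a b x x' φ)
  set mUL : ℝ := ∫ φ : Cfg P j N, weight C η w c m2 (0 : VecField P j ℝ) φ * (U φ * legs a b x x' φ)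
  set mUX : ℝ := ∫ φ : Cfg P j N, weight C η w c m2 (0 : VecField P j ℝ) φ * (U φ * X φ)
  set mUQ : ℝ := ∫ φ : Cfg P j N, weight C η w c m2 (0 : VecField P j ℝ) φ * (U φ * massForm w φ)
  set mUXL : ℝ := ∫ φ : Cfg P j N, weight C η w c m2 (0 : VecField P j ℝ) φ * (U φ * (X φ * legs a b x x' φ))
  set mUQL : ℝ := ∫ φ : Cfg P j N, weight C η w c m2 (0 : VecField P j ℝ) φ * (U φ * (massForm w φ * legs a b x x' φ))
  have hZne : Z ≠ 0 := hZ.ne'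
  field_simp
  ring


/-! ## §5 The counterterm term: `κ₂(L, Q)` — the graph `C₀(−δm²_{(2,1)})C₀` (the `n = 1` term of (1.21) with the insertion
`−δm²` at order `e²λ`) -/

omit μ2 in
/-- the counterterm bubble `∫W₀·Σ_xη^d∣φ(x)∣² = Z₀·N·Σ_xη^dC₀(x,x)`. [cite: Balaban1983Higgs3, (1.7) p.413] -/
private theorem integral_W0_massForm (hw : 0 < w) (hm : 0 < m2) :
    ∫ φ : Cfg P j N, weight C η w c m2 (0 : VecField P j ℝ) φ * massForm w φ =
      (∫ φ : Cfg P j N, weight C η w c m2 (0 : VecField P j ℝ) φ) * ((N : ℝ) * ∑ x : Site P j, w * G w c m2 x x) := by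
  have hq : ∀ (φ : Cfg P j N) (x : Site P j),
      ‖φ x‖ ^ 2 = ⟪φ x, (1 : EuclideanSpace ℝ (Fin N) →L[ℝ] EuclideanSpace ℝ (Fin N)) (φ x)⟫_ℝ := fun φ x => by
    rw [one_apply_eq_self, real_inner_self_eq_norm_sq]
  have hint : ∀ x : Site P j, Integrable (fun φ : Cfg P j N => weight C η w c m2 (0 : VecField P j ℝ) φ *
      ⟪φ x, (1 : EuclideanSpace ℝ (Fin N) →L[ℝ] EuclideanSpace ℝ (Fin N)) (φ x)⟫_ℝ) := fun x =>
    ExpGrowth.integrable C η w c m2 hw hm (ExpGrowth.inner_op_apply x x _)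
  have htr : trE (1 : EuclideanSpace ℝ (Fin N) →L[ℝ] EuclideanSpace ℝ (Fin N)) = N := by
    unfold trE
    simp only [one_apply_eq_self, (EuclideanSpace.basisFun (Fin N) ℝ).orthonormal.1, real_inner_self_eq_norm_sq,
      one_pow, Finset.sum_const, Finset.card_univ, Fintype.card_fin, nsmul_eq_mul, mul_one]
  unfold massForm
  simp_rw [hq, Finset.mul_sum]
  have hre : ∀ φ : Cfg P j N, (∑ x : Site P j, weight C η w c m2 (0 : VecField P j ℝ) φ *
      (w * ⟪φ x, (1 : EuclideanSpace ℝ (Fin N) →L[ℝ] EuclideanSpace ℝ (Fin N)) (φ x)⟫_ℝ)) =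
      ∑ x : Site P j, w * (weight C η w c m2 (0 : VecField P j ℝ) φ *
        ⟪φ x, (1 : EuclideanSpace ℝ (Fin N) →L[ℝ] EuclideanSpace ℝ (Fin N)) (φ x)⟫_ℝ) := fun φ =>
    Finset.sum_congr rfl fun x _ => by ring
  simp_rw [hre]
  rw [integral_finsetSum _ fun x _ => (hint x).const_mul w]
  simp_rw [integral_const_mul, moment2_op C η w c m2 hw hm, htr]
  exact Finset.sum_congr rfl fun x _ => by ring

omit μ2 in
/-- `∫W₀·Σ_zη^d∣φ(z)∣²·φ_a(x)φ_b(x′) = Z₀·δ_{ab}·[2Σ_zη^dC₀(x,z)C₀(x′,z) + N·(Σ_zη^dC₀(z,z))·C₀(x,x′)]` — the mass vertex (1.7) against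
the two legs: both legs into the vertex (the amputated insertion `2C₀(x,z)C₀(z,x′)`), or the bubble times the free line.
[cite: Balaban1983Higgs3, (1.7) p.413, (1.21) p.416] [cite: GlimmJaffeQP1987, Prop. 8.3.1 (8.3.3)–(8.3.5)] -/
theorem integral_W0_massForm_legs (hw : 0 < w) (hm : 0 < m2) (a b : Fin N) (x x' : Site P j) :
    ∫ φ : Cfg P j N, weight C η w c m2 (0 : VecField P j ℝ) φ * (massForm w φ * legs a b x x' φ) =
      (∫ φ : Cfg P j N, weight C η w c m2 (0 : VecField P j ℝ) φ) * ⟪EuclideanSpace.basisFun (Fin N) ℝ a,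
          EuclideanSpace.basisFun (Fin N) ℝ b⟫_ℝ * (2 * ∑ z : Site P j, w * (G w c m2 x z * G w c m2 x' z))
        + (N : ℝ) * (∑ z : Site P j, w * G w c m2 z z) *
          ((∫ φ : Cfg P j N, weight C η w c m2 (0 : VecField P j ℝ) φ) * (G w c m2 x x' *
            ⟪EuclideanSpace.basisFun (Fin N) ℝ a, EuclideanSpace.basisFun (Fin N) ℝ b⟫_ℝ)) := by
  have hL := expGrowth_legs (P := P) (j := j) a b x x'
  have hterm : ∀ z : Site P j, ∫ φ : Cfg P j N, weight C η w c m2 (0 : VecField P j ℝ) φ * (‖φ z‖ ^ 2 * legs a b x x' φ) =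
      (∫ φ : Cfg P j N, weight C η w c m2 (0 : VecField P j ℝ) φ) * ⟪EuclideanSpace.basisFun (Fin N) ℝ a,
          EuclideanSpace.basisFun (Fin N) ℝ b⟫_ℝ * (2 * (G w c m2 x z * G w c m2 x' z))
        + (N : ℝ) * G w c m2 z z * ((∫ φ : Cfg P j N, weight C η w c m2 (0 : VecField P j ℝ) φ) * (G w c m2 x x' *
            ⟪EuclideanSpace.basisFun (Fin N) ℝ a, EuclideanSpace.basisFun (Fin N) ℝ b⟫_ℝ)) := by
    intro z
    have i1 := ((expGrowth_wick2 (P := P) (j := j) (N := N) w c m2 z).mul hL).integrable C η w c m2 hw hm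
    have i2 := ((ExpGrowth.const ((N : ℝ) * G w c m2 z z)).mul hL).integrable C η w c m2 hw hm
    have e : (fun φ : Cfg P j N => weight C η w c m2 (0 : VecField P j ℝ) φ * (‖φ z‖ ^ 2 * legs a b x x' φ)) =
        fun φ => weight C η w c m2 (0 : VecField P j ℝ) φ * (wick2 w c m2 z φ * legs a b x x' φ)
          + (N : ℝ) * G w c m2 z z * (weight C η w c m2 (0 : VecField P j ℝ) φ * legs a b x x' φ) := by
      funext φ; rw [wick2_def]; ring
    have e' : (fun φ : Cfg P j N => (N : ℝ) * G w c m2 z z * (weight C η w c m2 (0 : VecField P j ℝ) φ * legs a b x x' φ))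
        = fun φ => weight C η w c m2 (0 : VecField P j ℝ) φ * ((N : ℝ) * G w c m2 z z * legs a b x x' φ) := by
      funext φ; ring
    rw [e, integral_add i1 (by rw [e']; exact i2), integral_const_mul]
    simp only [legs]
    rw [B3Eq122FirstOrderWick.integral_wick2_legs C η w c m2 hw hm a b x x' z,
      B3Eq122FirstOrderWick.integral_legs C η w c m2 hw hm a b x x']
  have hint : ∀ z : Site P j, Integrable (fun φ : Cfg P j N => weight C η w c m2 (0 : VecField P j ℝ) φ *
      (w * (‖φ z‖ ^ 2 * legs a b x x' φ))) := fun z =>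
    (((ExpGrowth.norm_sq_apply z).mul hL).const_mul w).integrable C η w c m2 hw hm
  have e1 : (fun φ : Cfg P j N => weight C η w c m2 (0 : VecField P j ℝ) φ * (massForm w φ * legs a b x x' φ)) =
      fun φ => ∑ z : Site P j, weight C η w c m2 (0 : VecField P j ℝ) φ * (w * (‖φ z‖ ^ 2 * legs a b x x' φ)) := by
    funext φ; rw [massForm, Finset.sum_mul, Finset.mul_sum]; exact Finset.sum_congr rfl fun z _ => by ring
  rw [e1, integral_finsetSum _ (fun z _ => hint z)]
  have e2 : ∀ z : Site P j, (∫ φ : Cfg P j N, weight C η w c m2 (0 : VecField P j ℝ) φ * (w * (‖φ z‖ ^ 2 * legs a b x x' φ)))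
      = w * ∫ φ : Cfg P j N, weight C η w c m2 (0 : VecField P j ℝ) φ * (‖φ z‖ ^ 2 * legs a b x x' φ) := fun z => by
    rw [← integral_const_mul]; exact integral_congr_ae (Filter.Eventually.of_forall fun φ => by dsimp only; ring)
  simp_rw [e2, hterm]
  simp only [Finset.mul_sum, Finset.sum_mul]
  rw [← Finset.sum_add_distrib]
  exact Finset.sum_congr rfl fun z _ => by ring

omit μ2 in
/-- **GRAPH (d): `κ₂(L,Q) = ⟨LQ⟩ − ⟨L⟩⟨Q⟩ = 2δ_{ab}Σ_zη^dC₀(x,z)C₀(z,x′)`** — the bubble times the free line cancels (linked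
cluster), both legs of the mass vertex are contracted into the external legs: `−δm²_{(2,1)}κ₂(L,Q)·(2!1!)⁻¹ =
δ_{ab}Σ_zη^dC₀(x,z)(−δm²_{(2,1)})C₀(z,x′)`, the `n = 1` term of (1.21) carrying the order-`e²λ` counterterm.
[cite: Balaban1983Higgs3, (1.7) p.413, (1.21) p.416, (1.23) p.417] [cite: GlimmJaffeQP1987, §8.3] -/
theorem kappa2_legs_massForm (hw : 0 < w) (hm : 0 < m2) (a b : Fin N) (x x' : Site P j) :
    (∫ φ : Cfg P j N, weight C η w c m2 (0 : VecField P j ℝ) φ * (massForm w φ * legs a b x x' φ)) /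
          (∫ φ : Cfg P j N, weight C η w c m2 (0 : VecField P j ℝ) φ)
        - (∫ φ : Cfg P j N, weight C η w c m2 (0 : VecField P j ℝ) φ * legs a b x x' φ) *
            (∫ φ : Cfg P j N, weight C η w c m2 (0 : VecField P j ℝ) φ * massForm w φ) /
          (∫ φ : Cfg P j N, weight C η w c m2 (0 : VecField P j ℝ) φ) ^ 2 =
      ⟪EuclideanSpace.basisFun (Fin N) ℝ a, EuclideanSpace.basisFun (Fin N) ℝ b⟫_ℝ *
        (2 * ∑ z : Site P j, w * (G w c m2 x z * G w c m2 x' z)) := by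
  have hZ : (∫ φ : Cfg P j N, weight C η w c m2 (0 : VecField P j ℝ) φ) ≠ 0 := (B3WT226Traces.Z_pos C η w c m2 hw hm).ne'
  have hLm : (∫ φ : Cfg P j N, weight C η w c m2 (0 : VecField P j ℝ) φ * legs a b x x' φ) =
      (∫ φ : Cfg P j N, weight C η w c m2 (0 : VecField P j ℝ) φ) * (G w c m2 x x' *
        ⟪EuclideanSpace.basisFun (Fin N) ℝ a, EuclideanSpace.basisFun (Fin N) ℝ b⟫_ℝ) := by
    simp only [legs]; exact B3Eq122FirstOrderWick.integral_legs C η w c m2 hw hm a b x x'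
  rw [integral_W0_massForm_legs C η w c m2 hw hm, integral_W0_massForm C η w c m2 hw hm, hLm]
  field_simp
  ring


/-! ## §6 AT PRINT'S `δm²_{(0,1)} = −4(N+2)C^ε_0(0)` THE INTERACTION IS WICK-ORDERED: `U = Σ_yη^d:∣φ(y)∣⁴: − const`, so in the
cumulant `κ₃(L, Y, U)` no quartic vertex carries a self-line — every TADPOLE INSERTION on a line of an order-`e²` graph (print's
picture «④ with a tadpole loop on the internal scalar line», p. 417, second row of (1.23)) is cancelled by the corresponding
`δm²_{(0,1)}`-insertion (print's ⑦, `+e²Σε^{2d}Σ_μq(∂^ε_μC^ε_0)(x−x″)δm₁²(C^ε_0∂^{ε*}_μ)(x″−x′)qC^ε(x−x′)` at its `λ`-part), and every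
one-particle-REDUCIBLE chain `C₀X_{(2,0)}C₀X_{(0,1)}C₀` vanishes with `X_{(0,1)} = Σ^ε_{(0,1)} − δm²_{(0,1)}δ^ε ≡ 0` (BRICK 10
`condition_01_iff`): what is left is `−[⟨V_:·Y·L⟩ − ⟨L⟩⟨V_:·Y⟩] − δm²_{(2,1)}κ₂(L,Q)`, `V_: = Σ_yη^d:∣φ(y)∣⁴:` -/

omit C η μ2 in
/-- **print's `δm²_{(0,1)}` Wick-orders the quartic interaction**: with `δm²_{(0,1)} = −4(N+2)C₀(0)` (`C₀(0) = C₀(y,y)` on the torus),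
`Σ_yη^d∣φ(y)∣⁴ + ½δm²_{(0,1)}Σ_yη^d∣φ(y)∣² = Σ_yη^d:∣φ(y)∣⁴: − ∣T∣·η^d·N(N+2)C₀(0)²` (Glimm–Jaffe (9.1.5): `:∣φ∣⁴: = ∣φ∣⁴ −
2(N+2)C₀(0)∣φ∣² + N(N+2)C₀(0)²`). [cite: Balaban1983Higgs3, (1.22)–(1.23) pp.416–417] [cite: GlimmJaffeQP1987, (9.1.5)] -/
theorem U_eq_sumWick4_of_print (d01 : ℝ) (hd01 : d01 = -(4 * (N + 2) * C0 (P := P) (j := j) w c m2)) {U : Cfg P j N → ℝ}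
    (hU : ∀ φ, U φ = (∑ y : Site P j, w * ‖φ y‖ ^ 4) + 1 / 2 * d01 * massForm w φ) (φ : Cfg P j N) :
    U φ = (∑ y : Site P j, w * wick4 w c m2 y φ) -
      Fintype.card (Site P j) * (w * (N * (N + 2) * C0 (P := P) (j := j) w c m2 ^ 2)) := by
  rw [hU, massForm, Finset.mul_sum, ← Finset.sum_add_distrib]
  have hy : ∀ y : Site P j, w * ‖φ y‖ ^ 4 + 1 / 2 * d01 * (w * ‖φ y‖ ^ 2) =
      w * wick4 w c m2 y φ - w * (N * (N + 2) * C0 (P := P) (j := j) w c m2 ^ 2) := fun y => by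
    rw [wick4_def, G_diag w c m2 y, hd01]; ring
  simp_rw [hy]
  rw [Finset.sum_sub_distrib, Finset.sum_const, Finset.card_univ, nsmul_eq_mul]

/-- **THE INDEX `(2,1)` AT PRINT'S `δm²_{(0,1)}`** — with the quartic interaction Wick-ordered by the order-`λ` counterterm, the
free-field means `⟨V_:⟩ = 0` and `⟨V_:·L⟩ = 0` (a Wick-ordered quartic vertex cannot absorb only two legs: BRICK 1
`integral_sumWick4`, `integral_sumWick4_mul_legs`) kill three of the five terms of `κ₃(L, Y, U)` and the constant in `U` drops out of
every cumulant: **`∂_λ⁺∂²_e G^{ct}∣₀ = −[⟨V_:·Y·L⟩ − ⟨L⟩⟨V_:·Y⟩] − δm²_{(2,1)}κ₂(L,Q)`**, `V_: = Σ_yη^d:∣φ(y)∣⁴:`, `Y = X − δm²_{(2,0)}Q` —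
ALL FOUR LEGS of each quartic vertex are contracted into the order-`e²` insertion `Y` and the external legs `L` (Glimm–Jaffe Cor.
8.3.2: no self-lines): no tadpole insertions, no chains (§6 header). [cite: Balaban1983Higgs3, (1.19)–(1.23) pp.416–417]
[cite: GlimmJaffeQP1987, Cor. 8.3.2 (8.3.8)–(8.3.9)] -/
theorem derivWithin_index21_at_print_d01 (hw : 0 < w) (hm : 0 < m2) (hμ : 0 < μ2) (d20 d01 d21 d40 : ℝ)
    (hd01 : d01 = -(4 * (N + 2) * C0 (P := P) (j := j) w c m2)) {X Y U W : Cfg P j N → ℝ}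
    (hX : ∀ φ, X φ = (∑ b : PBond P j, w * (c ^ 2 * η ^ 2) * G w c μ2 b.src b.src * ⟪φ b.src, C.q (C.q (φ b.tgt))⟫_ℝ)
      + ∑ b : PBond P j, ∑ b' : PBond P j, (w * (c ^ 2 * η)) * (w * (c ^ 2 * η)) *
          (G w c μ2 b.src b'.src * if b.dir = b'.dir then 1 else 0) *
            (⟪φ b.src, C.q (φ b.tgt)⟫_ℝ * ⟪φ b'.src, C.q (φ b'.tgt)⟫_ℝ))
    (hY : ∀ φ, Y φ = X φ - d20 * massForm w φ)
    (hU : ∀ φ, U φ = (∑ y : Site P j, w * ‖φ y‖ ^ 4) + 1 / 2 * d01 * massForm w φ)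
    (hW : ∀ φ, W φ = ∑ y : Site P j, w * wick4 w c m2 y φ) (a b : Fin N) (x x' : Site P j) :
    derivWithin (fun lam : ℝ => iteratedDeriv 2 (fun e : ℝ =>
        (∫ p : JCfg P j N, J C η w c (m2 + (d20 * e ^ 2 + d01 * lam + d21 * (e ^ 2 * lam) + d40 * e ^ 4)) μ2 e p *
            (Real.exp (-(lam * ∑ y : Site P j, w * ‖p.2 y‖ ^ 4)) * legs a b x x' p.2)) /
          ∫ p : JCfg P j N, J C η w c (m2 + (d20 * e ^ 2 + d01 * lam + d21 * (e ^ 2 * lam) + d40 * e ^ 4)) μ2 e p *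
            Real.exp (-(lam * ∑ y : Site P j, w * ‖p.2 y‖ ^ 4))) 0) (Set.Ici 0) 0 =
      -((∫ φ : Cfg P j N, weight C η w c m2 (0 : VecField P j ℝ) φ * (W φ * (Y φ * legs a b x x' φ))) /
            (∫ φ : Cfg P j N, weight C η w c m2 (0 : VecField P j ℝ) φ)
          - (∫ φ : Cfg P j N, weight C η w c m2 (0 : VecField P j ℝ) φ * legs a b x x' φ) *
              (∫ φ : Cfg P j N, weight C η w c m2 (0 : VecField P j ℝ) φ * (W φ * Y φ)) /
            (∫ φ : Cfg P j N, weight C η w c m2 (0 : VecField P j ℝ) φ) ^ 2)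
        - d21 * ((∫ φ : Cfg P j N, weight C η w c m2 (0 : VecField P j ℝ) φ * (massForm w φ * legs a b x x' φ)) /
              (∫ φ : Cfg P j N, weight C η w c m2 (0 : VecField P j ℝ) φ)
            - (∫ φ : Cfg P j N, weight C η w c m2 (0 : VecField P j ℝ) φ * legs a b x x' φ) *
                (∫ φ : Cfg P j N, weight C η w c m2 (0 : VecField P j ℝ) φ * massForm w φ) /
              (∫ φ : Cfg P j N, weight C η w c m2 (0 : VecField P j ℝ) φ) ^ 2) := by
  rw [(hasDerivWithinAt_index21 C η w c m2 μ2 hw hm hμ d20 d01 d21 d40 hX hY hU a b x x').derivWithin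
    (uniqueDiffOn_Ici (0 : ℝ) 0 Set.self_mem_Ici)]
  -- `U = V_: − K₀`
  set K₀ : ℝ := Fintype.card (Site P j) * (w * (N * (N + 2) * C0 (P := P) (j := j) w c m2 ^ 2)) with hK₀
  have hUW : ∀ φ, U φ = W φ - K₀ := fun φ => by rw [U_eq_sumWick4_of_print w c m2 d01 hd01 hU φ, hW]
  have hWg : ExpGrowth W := by
    have e : W = fun φ => ∑ y : Site P j, w * wick4 w c m2 y φ := funext hW
    rw [e]; exact B3Eq122FirstOrderWick.expGrowth_sum_wick4 w c m2
  have hXg := expGrowth_X C η w c μ2 hX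
  have hL := expGrowth_legs (P := P) (j := j) a b x x'
  have hmF := expGrowth_massForm (P := P) (j := j) (N := N) w
  have hYg : ExpGrowth Y := by
    have e : Y = fun φ => X φ - d20 * massForm w φ := funext hY
    rw [e]; exact hXg.sub (hmF.const_mul d20)
  -- linearity: `M(U·t) = M(V_:·t) − K₀M(t)`
  have lin : ∀ {t : Cfg P j N → ℝ}, ExpGrowth t →
      (∫ φ : Cfg P j N, weight C η w c m2 (0 : VecField P j ℝ) φ * (U φ * t φ)) =
        (∫ φ : Cfg P j N, weight C η w c m2 (0 : VecField P j ℝ) φ * (W φ * t φ))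
          - K₀ * ∫ φ : Cfg P j N, weight C η w c m2 (0 : VecField P j ℝ) φ * t φ := by
    intro t ht
    rw [← integral_const_mul, ← integral_sub ((hWg.mul ht).integrable C η w c m2 hw hm)
      ((ht.integrable C η w c m2 hw hm).const_mul _)]
    exact integral_congr_ae (Filter.Eventually.of_forall fun φ => by dsimp only; rw [hUW]; ring)
  have e1 := lin (hYg.mul hL)
  have e2 : (∫ φ : Cfg P j N, weight C η w c m2 (0 : VecField P j ℝ) φ * U φ) =
      (∫ φ : Cfg P j N, weight C η w c m2 (0 : VecField P j ℝ) φ * (W φ * 1))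
        - K₀ * ∫ φ : Cfg P j N, weight C η w c m2 (0 : VecField P j ℝ) φ * 1 := by
    rw [← lin (ExpGrowth.const (1 : ℝ))]; simp only [mul_one]
  have e3 := lin hL
  have e4 := lin hYg
  -- `⟨V_:⟩ = 0`, `⟨V_:·L⟩ = 0`
  have z1 : (∫ φ : Cfg P j N, weight C η w c m2 (0 : VecField P j ℝ) φ * (W φ * 1)) = 0 := by
    simp only [mul_one]; simp_rw [hW]; exact B3Eq122FirstOrderWick.integral_sumWick4 C η w c m2 hw hm
  have z2 : (∫ φ : Cfg P j N, weight C η w c m2 (0 : VecField P j ℝ) φ * (W φ * legs a b x x' φ)) = 0 := by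
    simp_rw [hW]; simp only [legs]; exact B3Eq122FirstOrderWick.integral_sumWick4_mul_legs C η w c m2 hw hm a b x x'
  rw [e1, e2, e3, e4, z1, z2]
  simp only [mul_one]
  have hZ : (∫ φ : Cfg P j N, weight C η w c m2 (0 : VecField P j ℝ) φ) ≠ 0 := (B3WT226Traces.Z_pos C η w c m2 hw hm).ne'
  field_simp
  ring


/-! ## §7 Wick's theorem for a Wick-ordered quartic vertex against the two legs and an observable: ALL FOUR legs of `:∣φ(y)∣⁴:`
are contracted (Glimm–Jaffe Cor. 8.3.2), two into the external legs and two into the observable — the only pattern for an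
observable whose third derivatives along the field vanish (a bilinear `⟪φ(u),Mφ(v)⟫`: print's ② and the mass vertex; a product
of two antisymmetric currents `⟪φ(b₋),qφ(b₊)⟫⟪φ(b′₋),qφ(b′₊)⟫`: print's ④ — the second derivative of a single current at one point
vanishes by `q* = −q`) -/

section WickFour

omit C η w c m2 μ2 in
/-- `⟪e_i, e_a⟫ = δ_{ia}`. [folklore] -/
private theorem inner_basis' (i a : Fin N) :
    ⟪EuclideanSpace.basisFun (Fin N) ℝ i, EuclideanSpace.basisFun (Fin N) ℝ a⟫_ℝ = if i = a then 1 else 0 := by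
  classical
  exact orthonormal_iff_ite.mp (EuclideanSpace.basisFun (Fin N) ℝ).orthonormal i a

omit C η w c m2 μ2 in
/-- `Σ_i ⟪e_i,e_a⟫·f(i) = f(a)`. [folklore] -/
private theorem sum_inner_basis_mul_fun (a : Fin N) (f : Fin N → ℝ) :
    ∑ i : Fin N, ⟪EuclideanSpace.basisFun (Fin N) ℝ i, EuclideanSpace.basisFun (Fin N) ℝ a⟫_ℝ * f i = f a := by
  classical
  simp_rw [inner_basis']
  rw [Finset.sum_eq_single a (fun i _ hi => by rw [if_neg hi, zero_mul]) (fun h => absurd (Finset.mem_univ a) h),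
    if_pos rfl, one_mul]

omit C η w c m2 μ2 in
/-- `Σ_i ⟪e_i,e_a⟫⟪e_i,e_b⟫ = ⟪e_a,e_b⟫`. [folklore] -/
private theorem sum_inner_basis_mul_basis (a b : Fin N) :
    ∑ i : Fin N, ⟪EuclideanSpace.basisFun (Fin N) ℝ i, EuclideanSpace.basisFun (Fin N) ℝ a⟫_ℝ *
      ⟪EuclideanSpace.basisFun (Fin N) ℝ i, EuclideanSpace.basisFun (Fin N) ℝ b⟫_ℝ =
      ⟪EuclideanSpace.basisFun (Fin N) ℝ a, EuclideanSpace.basisFun (Fin N) ℝ b⟫_ℝ := by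
  rw [sum_inner_basis_mul_fun, real_inner_comm]

omit μ2 in
/-- **`∫W₀·:∣φ(y)∣⁴:·F·φ_a(x)φ_b(x′) = 4C₀(x,y)C₀(x′,y)·[δ_{ab}Σ_i∫W₀F″_{ii} + ∫W₀F″_{ab} + ∫W₀F″_{ba}]`** for an observable `F` whose
second derivatives `F″_{ik} = D_{y,k}D_{y,i}F` along the site directions at `y` have vanishing derivative there (third derivatives
zero): the four legs of the Wick-ordered vertex go two into the external legs (`C₀(x,y)C₀(x′,y)`), two into `F`; the `O(N)`
index either runs around the loop through `F` (`δ_{ab}·Σ_iF″_{ii}`, a trace) or threads the external line through `F` (`F″_{ab} +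
F″_{ba}`). (`B3WickVertexCalculus.integral_wick4_mul` with the fourth derivative of `F·φ_aφ_b` computed by Leibniz.)
[cite: GlimmJaffeQP1987, Cor. 8.3.2 (8.3.8)–(8.3.9)] [cite: Balaban1983Higgs3, (1.22)–(1.23) pp.416–417] -/
theorem integral_wick4_obs_legs (hw : 0 < w) (hm : 0 < m2) (y : Site P j) (a b : Fin N) (x x' : Site P j)
    {F : Cfg P j N → ℝ} {F1 : Fin N → Cfg P j N → ℝ} {F2 : Fin N → Fin N → Cfg P j N → ℝ}
    (hF : ExpGrowth F) (hF1 : ∀ i, ExpGrowth (F1 i)) (hF2 : ∀ i k, ExpGrowth (F2 i k))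
    (dF : ∀ i, DerivAlong (hx w c m2 y i) F (F1 i)) (dF1 : ∀ i k, DerivAlong (hx w c m2 y k) (F1 i) (F2 i k))
    (dF2 : ∀ i k l, DerivAlong (hx w c m2 y l) (F2 i k) (fun _ => 0)) :
    ∫ φ : Cfg P j N, weight C η w c m2 (0 : VecField P j ℝ) φ * (wick4 w c m2 y φ * (F φ * legs a b x x' φ)) =
      4 * (G w c m2 x y * G w c m2 x' y) *
        (⟪EuclideanSpace.basisFun (Fin N) ℝ a, EuclideanSpace.basisFun (Fin N) ℝ b⟫_ℝ *
            (∑ i : Fin N, ∫ φ : Cfg P j N, weight C η w c m2 (0 : VecField P j ℝ) φ * F2 i i φ)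
          + (∫ φ : Cfg P j N, weight C η w c m2 (0 : VecField P j ℝ) φ * F2 a b φ)
          + ∫ φ : Cfg P j N, weight C η w c m2 (0 : VecField P j ℝ) φ * F2 b a φ) := by
  -- the legs and their derivatives along `h_{y,i}` (constants `h_i = C₀(x,y)δ_{ia}`, `l_i = C₀(x′,y)δ_{ib}`)
  set bE := EuclideanSpace.basisFun (Fin N) ℝ with hbE
  set hh : Fin N → ℝ := fun i => G w c m2 x y * ⟪bE i, bE a⟫_ℝ with hhh
  set ll : Fin N → ℝ := fun i => G w c m2 x' y * ⟪bE i, bE b⟫_ℝ with hll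
  set L1 : Fin N → Cfg P j N → ℝ := fun i φ => hh i * ⟪φ x', bE b⟫_ℝ + ⟪φ x, bE a⟫_ℝ * ll i with hL1
  have hLg : ExpGrowth (legs a b x x' : Cfg P j N → ℝ) := expGrowth_legs a b x x'
  have hL1g : ∀ i, ExpGrowth (L1 i) := fun i =>
    ((ExpGrowth.inner_apply x' _).const_mul _).add ((ExpGrowth.inner_apply x _).mul (ExpGrowth.const _))
  have dL : ∀ i, DerivAlong (hx w c m2 y i) (legs a b x x' : Cfg P j N → ℝ) (L1 i) := fun i =>
    B3Eq122FirstOrderWick.derivAlong_legs w c m2 a b x x' y i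
  have dL1 : ∀ i k, DerivAlong (hx w c m2 y k) (L1 i) (fun _ => hh i * ll k + hh k * ll i) := fun i k =>
    (((DerivAlong.inner_apply (hx w c m2 y k) x' (bE b)).const_mul (hh i)).add
      ((DerivAlong.inner_apply (hx w c m2 y k) x (bE a)).mul (DerivAlong.const _ (ll i)))).congr
      fun φ => by simp only [hhh, hll, inner_hx_left]; ring
  -- the four derivatives of `R = F·legs`
  set R : Cfg P j N → ℝ := fun φ => F φ * legs a b x x' φ with hR
  set R₁ : Fin N → Cfg P j N → ℝ := fun i φ => F1 i φ * legs a b x x' φ + F φ * L1 i φ with hR₁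
  set R₂ : Fin N → Cfg P j N → ℝ := fun i φ =>
    F2 i i φ * legs a b x x' φ + 2 * (F1 i φ * L1 i φ) + F φ * (2 * (hh i * ll i)) with hR₂
  set R₃ : Fin N → Fin N → Cfg P j N → ℝ := fun i k φ =>
    F2 i i φ * L1 k φ + 2 * (F2 i k φ * L1 i φ) + 2 * (F1 i φ * (hh i * ll k + hh k * ll i))
      + F1 k φ * (2 * (hh i * ll i)) with hR₃
  set R₄ : Fin N → Fin N → Cfg P j N → ℝ := fun i k φ =>
    2 * (hh k * ll k) * F2 i i φ + 4 * (hh i * ll k + hh k * ll i) * F2 i k φ + 2 * (hh i * ll i) * F2 k k φ with hR₄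
  have gR : ExpGrowth R := hF.mul hLg
  have gR₁ : ∀ i, ExpGrowth (R₁ i) := fun i => ((hF1 i).mul hLg).add (hF.mul (hL1g i))
  have gR₂ : ∀ i, ExpGrowth (R₂ i) := fun i =>
    (((hF2 i i).mul hLg).add (((hF1 i).mul (hL1g i)).const_mul 2)).add (hF.mul (ExpGrowth.const _))
  have gR₃ : ∀ i k, ExpGrowth (R₃ i k) := fun i k =>
    ((((hF2 i i).mul (hL1g k)).add (((hF2 i k).mul (hL1g i)).const_mul 2)).add
      (((hF1 i).mul (ExpGrowth.const _)).const_mul 2)).add ((hF1 k).mul (ExpGrowth.const _))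
  have gR₄ : ∀ i k, ExpGrowth (R₄ i k) := fun i k =>
    ((((hF2 i i).const_mul _)).add ((hF2 i k).const_mul _)).add ((hF2 k k).const_mul _)
  have dR : ∀ i, DerivAlong (hx w c m2 y i) R (R₁ i) := fun i => (dF i).mul (dL i)
  have dR₁ : ∀ i, DerivAlong (hx w c m2 y i) (R₁ i) (R₂ i) := fun i =>
    (((dF1 i i).mul (dL i)).add ((dF i).mul (dL1 i i))).congr fun φ => by simp only [hR₂]; ring
  have dR₂ : ∀ i k, DerivAlong (hx w c m2 y k) (R₂ i) (R₃ i k) := fun i k =>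
    ((((dF2 i i k).mul (dL k)).add (((dF1 i k).mul (dL1 i k)).const_mul 2)).add
      ((dF k).mul (DerivAlong.const _ _))).congr fun φ => by simp only [hR₃]; ring
  have dR₃ : ∀ i k, DerivAlong (hx w c m2 y k) (R₃ i k) (R₄ i k) := fun i k =>
    (((((dF2 i i k).mul (dL1 k k)).add (((dF2 i k k).mul (dL1 i k)).const_mul 2)).add
      (((dF1 i k).mul (DerivAlong.const _ _)).const_mul 2)).add
        ((dF1 k k).mul (DerivAlong.const _ _))).congr fun φ => by simp only [hR₄]; ring
  have hmain := integral_wick4_mul C η w c m2 hw hm y gR gR₁ gR₂ gR₃ gR₄ dR dR₁ dR₂ dR₃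
  have eR : (fun φ : Cfg P j N => weight C η w c m2 (0 : VecField P j ℝ) φ * (wick4 w c m2 y φ * (F φ * legs a b x x' φ)))
      = fun φ => weight C η w c m2 (0 : VecField P j ℝ) φ * (wick4 w c m2 y φ * R φ) := by
    funext φ; simp only [hR]
  rw [eR, hmain]
  -- integrate `R₄`
  have hI : ∀ i k, ∫ φ : Cfg P j N, weight C η w c m2 (0 : VecField P j ℝ) φ * R₄ i k φ =
      2 * (hh k * ll k) * (∫ φ : Cfg P j N, weight C η w c m2 (0 : VecField P j ℝ) φ * F2 i i φ)
        + 4 * (hh i * ll k + hh k * ll i) * (∫ φ : Cfg P j N, weight C η w c m2 (0 : VecField P j ℝ) φ * F2 i k φ)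
        + 2 * (hh i * ll i) * (∫ φ : Cfg P j N, weight C η w c m2 (0 : VecField P j ℝ) φ * F2 k k φ) := by
    intro i k
    have j1 := ((hF2 i i).integrable C η w c m2 hw hm).const_mul (2 * (hh k * ll k))
    have j2 := ((hF2 i k).integrable C η w c m2 hw hm).const_mul (4 * (hh i * ll k + hh k * ll i))
    have j3 := ((hF2 k k).integrable C η w c m2 hw hm).const_mul (2 * (hh i * ll i))
    have e : (fun φ : Cfg P j N => weight C η w c m2 (0 : VecField P j ℝ) φ * R₄ i k φ) = fun φ =>
        2 * (hh k * ll k) * (weight C η w c m2 (0 : VecField P j ℝ) φ * F2 i i φ)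
          + 4 * (hh i * ll k + hh k * ll i) * (weight C η w c m2 (0 : VecField P j ℝ) φ * F2 i k φ)
          + 2 * (hh i * ll i) * (weight C η w c m2 (0 : VecField P j ℝ) φ * F2 k k φ) := by
      funext φ; simp only [hR₄]; ring
    have j12 : Integrable (fun φ : Cfg P j N => 2 * (hh k * ll k) * (weight C η w c m2 (0 : VecField P j ℝ) φ * F2 i i φ)
        + 4 * (hh i * ll k + hh k * ll i) * (weight C η w c m2 (0 : VecField P j ℝ) φ * F2 i k φ)) := j1.add j2
    rw [e, integral_add j12 j3, integral_add j1 j2, integral_const_mul, integral_const_mul, integral_const_mul]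
  simp_rw [hI]
  -- the index sums
  set I : Fin N → Fin N → ℝ := fun i k => ∫ φ : Cfg P j N, weight C η w c m2 (0 : VecField P j ℝ) φ * F2 i k φ with hIdef
  have s1 : ∑ i : Fin N, ∑ k : Fin N, 2 * (hh k * ll k) * I i i =
      2 * (G w c m2 x y * G w c m2 x' y) * (⟪bE a, bE b⟫_ℝ * ∑ i : Fin N, I i i) := by
    have hk : ∑ k : Fin N, hh k * ll k = G w c m2 x y * G w c m2 x' y * ⟪bE a, bE b⟫_ℝ := by
      simp only [hhh, hll]
      rw [← sum_inner_basis_mul_basis a b, Finset.mul_sum]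
      exact Finset.sum_congr rfl fun k _ => by ring
    have inner : ∀ i : Fin N, ∑ k : Fin N, 2 * (hh k * ll k) * I i i =
        2 * (G w c m2 x y * G w c m2 x' y * ⟪bE a, bE b⟫_ℝ) * I i i := fun i => by
      rw [← Finset.sum_mul, ← Finset.mul_sum, hk]
    simp_rw [inner]
    rw [← Finset.mul_sum]
    ring
  have s2 : ∑ i : Fin N, ∑ k : Fin N, 4 * (hh i * ll k + hh k * ll i) * I i k =
      4 * (G w c m2 x y * G w c m2 x' y) * (I a b + I b a) := by
    have e : ∀ i k, 4 * (hh i * ll k + hh k * ll i) * I i k =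
        4 * (G w c m2 x y * G w c m2 x' y) * (⟪bE i, bE a⟫_ℝ * (⟪bE k, bE b⟫_ℝ * I i k))
          + 4 * (G w c m2 x y * G w c m2 x' y) * (⟪bE k, bE a⟫_ℝ * (⟪bE i, bE b⟫_ℝ * I i k)) := fun i k => by
      simp only [hhh, hll]; ring
    simp_rw [e, Finset.sum_add_distrib, ← Finset.mul_sum]
    rw [sum_inner_basis_mul_fun a, sum_inner_basis_mul_fun b, Finset.sum_comm]
    simp_rw [← Finset.mul_sum]
    rw [sum_inner_basis_mul_fun a, sum_inner_basis_mul_fun b]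
    ring
  have s3 : ∑ i : Fin N, ∑ k : Fin N, 2 * (hh i * ll i) * I k k =
      2 * (G w c m2 x y * G w c m2 x' y) * (⟪bE a, bE b⟫_ℝ * ∑ k : Fin N, I k k) := by
    have hk : ∑ i : Fin N, hh i * ll i = G w c m2 x y * G w c m2 x' y * ⟪bE a, bE b⟫_ℝ := by
      simp only [hhh, hll]
      rw [← sum_inner_basis_mul_basis a b, Finset.mul_sum]
      exact Finset.sum_congr rfl fun k _ => by ring
    simp_rw [← Finset.mul_sum]
    rw [← Finset.sum_mul, show ∑ i : Fin N, 2 * (hh i * ll i) = 2 * ∑ i : Fin N, hh i * ll i by rw [Finset.mul_sum], hk]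
    ring
  simp only [Finset.sum_add_distrib]
  rw [s1, s2, s3]
  ring

end WickFour


section WickPieces

omit μ2 in
/-- **a Wick-ordered quartic vertex against an observable with vanishing third derivatives has zero mean**: `∫W₀:∣φ(y)∣⁴:F = 0`
(no external legs to absorb the other two legs of the vertex). [cite: GlimmJaffeQP1987, Cor. 8.3.2 (8.3.8)–(8.3.9)] -/
theorem integral_wick4_obs (hw : 0 < w) (hm : 0 < m2) (y : Site P j)
    {F : Cfg P j N → ℝ} {F1 : Fin N → Cfg P j N → ℝ} {F2 : Fin N → Fin N → Cfg P j N → ℝ}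
    (hF : ExpGrowth F) (hF1 : ∀ i, ExpGrowth (F1 i)) (hF2 : ∀ i k, ExpGrowth (F2 i k))
    (dF : ∀ i, DerivAlong (hx w c m2 y i) F (F1 i)) (dF1 : ∀ i k, DerivAlong (hx w c m2 y k) (F1 i) (F2 i k))
    (dF2 : ∀ i k l, DerivAlong (hx w c m2 y l) (F2 i k) (fun _ => 0)) :
    ∫ φ : Cfg P j N, weight C η w c m2 (0 : VecField P j ℝ) φ * (wick4 w c m2 y φ * F φ) = 0 := by
  have h := integral_wick4_mul C η w c m2 hw hm y (R := F) (R₁ := F1) (R₂ := fun i => F2 i i) (R₃ := fun _ _ _ => 0)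
    (R₄ := fun _ _ _ => 0) hF hF1 (fun i => hF2 i i) (fun _ _ => ExpGrowth.const 0) (fun _ _ => ExpGrowth.const 0)
    dF (fun i => dF1 i i) (fun i k => dF2 i i k) (fun _ _ => DerivAlong.const _ 0)
  simpa using h

/-- **A BILINEAR VERTEX ON THE LOOP OF THE WICK-ORDERED TADPOLE**:
`∫W₀·:∣φ(y)∣⁴:·⟪φ(u),Mφ(v)⟫·φ_a(x)φ_b(x′) = 8Z₀·C₀(x,y)C₀(x′,y)C₀(u,y)C₀(v,y)·[δ_{ab}tr M + ⟪e_a,Me_b⟫ + ⟪e_b,Me_a⟫]` — the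
two external legs at the quartic vertex `y`, a scalar loop `y → u —M— v → y` through the bilinear vertex (`δ_{ab}tr M`), or the
external index threaded through it (`M_{ab} + M_{ba}`): print's ② (`M = q²`, `(u,v) = (b₋,b₊)`) and the mass vertex (`M = 1`,
`u = v`) inserted on the tadpole loop. [cite: Balaban1983Higgs3, (1.22)–(1.23) pp.416–417] [cite: GlimmJaffeQP1987, Cor. 8.3.2] -/
theorem integral_wick4_bil_legs (hw : 0 < w) (hm : 0 < m2) (y u v : Site P j)
    (M : EuclideanSpace ℝ (Fin N) →L[ℝ] EuclideanSpace ℝ (Fin N)) (a b : Fin N) (x x' : Site P j) :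
    ∫ φ : Cfg P j N, weight C η w c m2 (0 : VecField P j ℝ) φ * (wick4 w c m2 y φ * (⟪φ u, M (φ v)⟫_ℝ * legs a b x x' φ)) =
      8 * (∫ φ : Cfg P j N, weight C η w c m2 (0 : VecField P j ℝ) φ) *
        (G w c m2 x y * G w c m2 x' y * (G w c m2 u y * G w c m2 v y)) *
          (⟪EuclideanSpace.basisFun (Fin N) ℝ a, EuclideanSpace.basisFun (Fin N) ℝ b⟫_ℝ * trE M
            + ⟪EuclideanSpace.basisFun (Fin N) ℝ a, M (EuclideanSpace.basisFun (Fin N) ℝ b)⟫_ℝ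
            + ⟪EuclideanSpace.basisFun (Fin N) ℝ b, M (EuclideanSpace.basisFun (Fin N) ℝ a)⟫_ℝ) := by
  set bE := EuclideanSpace.basisFun (Fin N) ℝ with hbE
  set F1 : Fin N → Cfg P j N → ℝ := fun i φ =>
    G w c m2 u y * ⟪φ v, ContinuousLinearMap.adjoint M (bE i)⟫_ℝ + G w c m2 v y * ⟪φ u, M (bE i)⟫_ℝ with hF1
  set F2 : Fin N → Fin N → Cfg P j N → ℝ := fun i k _ =>
    G w c m2 u y * (G w c m2 v y * ⟪bE k, ContinuousLinearMap.adjoint M (bE i)⟫_ℝ)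
      + G w c m2 v y * (G w c m2 u y * ⟪bE k, M (bE i)⟫_ℝ) with hF2
  have hF : ExpGrowth (fun φ : Cfg P j N => ⟪φ u, M (φ v)⟫_ℝ) := ExpGrowth.inner_op_apply u v M
  have hF1g : ∀ i, ExpGrowth (F1 i) := fun i =>
    ((ExpGrowth.inner_apply v _).const_mul _).add ((ExpGrowth.inner_apply u _).const_mul _)
  have hF2g : ∀ i k, ExpGrowth (F2 i k) := fun i k => ExpGrowth.const _
  have dF : ∀ i, DerivAlong (hx w c m2 y i) (fun φ : Cfg P j N => ⟪φ u, M (φ v)⟫_ℝ) (F1 i) := fun i =>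
    (DerivAlong.inner_op_apply (hx w c m2 y i) u v M).congr fun φ => by
      simp only [hF1]
      rw [inner_hx_left, op_hx, inner_smul_right, ContinuousLinearMap.adjoint_inner_right, real_inner_comm (bE i)]
  have dF1 : ∀ i k, DerivAlong (hx w c m2 y k) (F1 i) (F2 i k) := fun i k =>
    (((DerivAlong.inner_apply (hx w c m2 y k) v _).const_mul _).add
      ((DerivAlong.inner_apply (hx w c m2 y k) u _).const_mul _)).congr fun φ => by
      simp only [hF2]; rw [inner_hx_left, inner_hx_left]
  have dF2 : ∀ i k l, DerivAlong (hx w c m2 y l) (F2 i k) (fun _ => 0) := fun i k l => DerivAlong.const _ _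
  rw [integral_wick4_obs_legs C η w c m2 hw hm y a b x x' hF hF1g hF2g dF dF1 dF2]
  have hI : ∀ i k, ∫ φ : Cfg P j N, weight C η w c m2 (0 : VecField P j ℝ) φ * F2 i k φ =
      (∫ φ : Cfg P j N, weight C η w c m2 (0 : VecField P j ℝ) φ) * (G w c m2 u y * G w c m2 v y *
        (⟪bE i, M (bE k)⟫_ℝ + ⟪bE k, M (bE i)⟫_ℝ)) := fun i k => by
    simp only [hF2]
    rw [integral_mul_const, ContinuousLinearMap.adjoint_inner_right, real_inner_comm (bE i)]
    ring
  simp_rw [hI]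
  rw [← Finset.mul_sum]
  have htr : ∑ i : Fin N, (⟪bE i, M (bE i)⟫_ℝ + ⟪bE i, M (bE i)⟫_ℝ) = 2 * trE M := by
    rw [trE, two_mul, ← Finset.sum_add_distrib]
  rw [show ∑ i : Fin N, G w c m2 u y * G w c m2 v y * (⟪bE i, M (bE i)⟫_ℝ + ⟪bE i, M (bE i)⟫_ℝ) =
      G w c m2 u y * G w c m2 v y * (2 * trE M) by rw [← Finset.mul_sum, htr]]
  ring

omit η w c m2 μ2 in
/-- `⟪e_i, qφ(t)⟫ = −⟪φ(t), qe_i⟫` (`q* = −q`). [cite: Balaban1982Higgs1, (1.7) p.605] -/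
private theorem inner_q_apply_left (vv u' : EuclideanSpace ℝ (Fin N)) : ⟪vv, C.q u'⟫_ℝ = -⟪u', C.q vv⟫_ℝ := by
  rw [← B3WT226Pairings.inner_q_left C u' vv, real_inner_comm]

omit μ2 in
/-- the derivative of a current `J_b = ⟪φ(s),qφ(t)⟫` along `h_{y,i}`: `J_b^{(i)} = C₀(t,y)⟪φ(s),qe_i⟫ − C₀(s,y)⟪φ(t),qe_i⟫`.
[cite: Balaban1983Higgs3, (1.8) p.413] [cite: GlimmJaffeQP1987, (9.1.3)] -/
theorem derivAlong_cur (y s t : Site P j) (i : Fin N) :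
    DerivAlong (hx w c m2 y i) (fun φ : Cfg P j N => ⟪φ s, C.q (φ t)⟫_ℝ)
      (fun φ => G w c m2 t y * ⟪φ s, C.q (EuclideanSpace.basisFun (Fin N) ℝ i)⟫_ℝ
        - G w c m2 s y * ⟪φ t, C.q (EuclideanSpace.basisFun (Fin N) ℝ i)⟫_ℝ) :=
  (DerivAlong.inner_op_apply (hx w c m2 y i) s t C.q).congr fun φ => by
    rw [inner_hx_left, op_hx, inner_smul_right, inner_q_apply_left C]; ring

omit μ2 in
/-- **the second derivative of a single current at one point vanishes**: `D_{y,k}J_b^{(i)} = C₀(s,y)C₀(t,y)(⟪e_k,qe_i⟫ − ⟪e_k,qe_i⟫)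
= 0` — a cubic vertex cannot have both scalar legs contracted into the same symmetric vertex (this kills the two-loop graph «quartic
vertex with one external leg + cubic pair» and the vacuum graph `⟨:∣φ(y)∣⁴:·J_bJ_{b′}⟩`). [cite: Balaban1983Higgs3, (1.8) p.413]
[cite: GlimmJaffeQP1987, (9.1.3)] -/
theorem derivAlong_cur_deriv (y s t : Site P j) (i k : Fin N) :
    DerivAlong (hx w c m2 y k)
      (fun φ : Cfg P j N => G w c m2 t y * ⟪φ s, C.q (EuclideanSpace.basisFun (Fin N) ℝ i)⟫_ℝ
        - G w c m2 s y * ⟪φ t, C.q (EuclideanSpace.basisFun (Fin N) ℝ i)⟫_ℝ) (fun _ => 0) :=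
  (((DerivAlong.inner_apply (hx w c m2 y k) s _).const_mul _).sub
    ((DerivAlong.inner_apply (hx w c m2 y k) t _).const_mul _)).congr fun φ => by
    rw [inner_hx_left, inner_hx_left]; ring

omit μ2 in
/-- the free two-point function of two differentiated currents:
`∫W₀J_b^{(i)}J_{b′}^{(k)} = Z₀·⟪e_i,q²e_k⟫·Bk(b,b′;y,y)` (BRICK 7's connected four-propagator bracket `Bk` at coinciding external
points). [cite: Balaban1983Higgs3, (1.22) term ④ p.416] [cite: GlimmJaffeQP1987, §8.3] -/
theorem integral_curDeriv_curDeriv (hw : 0 < w) (hm : 0 < m2) (y : Site P j) (l l' : PBond P j) (i k : Fin N) :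
    ∫ φ : Cfg P j N, weight C η w c m2 (0 : VecField P j ℝ) φ *
        ((G w c m2 l.tgt y * ⟪φ l.src, C.q (EuclideanSpace.basisFun (Fin N) ℝ i)⟫_ℝ
            - G w c m2 l.src y * ⟪φ l.tgt, C.q (EuclideanSpace.basisFun (Fin N) ℝ i)⟫_ℝ) *
          (G w c m2 l'.tgt y * ⟪φ l'.src, C.q (EuclideanSpace.basisFun (Fin N) ℝ k)⟫_ℝ
            - G w c m2 l'.src y * ⟪φ l'.tgt, C.q (EuclideanSpace.basisFun (Fin N) ℝ k)⟫_ℝ)) =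
      (∫ φ : Cfg P j N, weight C η w c m2 (0 : VecField P j ℝ) φ) *
        (⟪EuclideanSpace.basisFun (Fin N) ℝ i, C.q (C.q (EuclideanSpace.basisFun (Fin N) ℝ k))⟫_ℝ * Bk w c m2 l l' y y) := by
  set bE := EuclideanSpace.basisFun (Fin N) ℝ with hbE
  have i1 := integrable_weight_mul_inner_inner C η w c m2 hw hm l.src l'.src (C.q (bE i)) (C.q (bE k))
  have i2 := integrable_weight_mul_inner_inner C η w c m2 hw hm l.src l'.tgt (C.q (bE i)) (C.q (bE k))
  have i3 := integrable_weight_mul_inner_inner C η w c m2 hw hm l.tgt l'.src (C.q (bE i)) (C.q (bE k))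
  have i4 := integrable_weight_mul_inner_inner C η w c m2 hw hm l.tgt l'.tgt (C.q (bE i)) (C.q (bE k))
  have e : (fun φ : Cfg P j N => weight C η w c m2 (0 : VecField P j ℝ) φ *
        ((G w c m2 l.tgt y * ⟪φ l.src, C.q (bE i)⟫_ℝ - G w c m2 l.src y * ⟪φ l.tgt, C.q (bE i)⟫_ℝ) *
          (G w c m2 l'.tgt y * ⟪φ l'.src, C.q (bE k)⟫_ℝ - G w c m2 l'.src y * ⟪φ l'.tgt, C.q (bE k)⟫_ℝ))) = fun φ =>
      (G w c m2 l.tgt y * G w c m2 l'.tgt y) * (weight C η w c m2 (0 : VecField P j ℝ) φ *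
          (⟪φ l.src, C.q (bE i)⟫_ℝ * ⟪φ l'.src, C.q (bE k)⟫_ℝ))
        - (G w c m2 l.tgt y * G w c m2 l'.src y) * (weight C η w c m2 (0 : VecField P j ℝ) φ *
          (⟪φ l.src, C.q (bE i)⟫_ℝ * ⟪φ l'.tgt, C.q (bE k)⟫_ℝ))
        - (G w c m2 l.src y * G w c m2 l'.tgt y) * (weight C η w c m2 (0 : VecField P j ℝ) φ *
          (⟪φ l.tgt, C.q (bE i)⟫_ℝ * ⟪φ l'.src, C.q (bE k)⟫_ℝ))
        + (G w c m2 l.src y * G w c m2 l'.src y) * (weight C η w c m2 (0 : VecField P j ℝ) φ *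
          (⟪φ l.tgt, C.q (bE i)⟫_ℝ * ⟪φ l'.tgt, C.q (bE k)⟫_ℝ)) := by
    funext φ; ring
  have j1 : Integrable (fun φ : Cfg P j N => (G w c m2 l.tgt y * G w c m2 l'.tgt y) *
      (weight C η w c m2 (0 : VecField P j ℝ) φ * (⟪φ l.src, C.q (bE i)⟫_ℝ * ⟪φ l'.src, C.q (bE k)⟫_ℝ))) := i1.const_mul _
  have j2 : Integrable (fun φ : Cfg P j N => (G w c m2 l.tgt y * G w c m2 l'.src y) *
      (weight C η w c m2 (0 : VecField P j ℝ) φ * (⟪φ l.src, C.q (bE i)⟫_ℝ * ⟪φ l'.tgt, C.q (bE k)⟫_ℝ))) := i2.const_mul _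
  have j3 : Integrable (fun φ : Cfg P j N => (G w c m2 l.src y * G w c m2 l'.tgt y) *
      (weight C η w c m2 (0 : VecField P j ℝ) φ * (⟪φ l.tgt, C.q (bE i)⟫_ℝ * ⟪φ l'.src, C.q (bE k)⟫_ℝ))) := i3.const_mul _
  have j4 : Integrable (fun φ : Cfg P j N => (G w c m2 l.src y * G w c m2 l'.src y) *
      (weight C η w c m2 (0 : VecField P j ℝ) φ * (⟪φ l.tgt, C.q (bE i)⟫_ℝ * ⟪φ l'.tgt, C.q (bE k)⟫_ℝ))) := i4.const_mul _
  have j12 : Integrable (fun φ : Cfg P j N => (G w c m2 l.tgt y * G w c m2 l'.tgt y) *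
      (weight C η w c m2 (0 : VecField P j ℝ) φ * (⟪φ l.src, C.q (bE i)⟫_ℝ * ⟪φ l'.src, C.q (bE k)⟫_ℝ))
      - (G w c m2 l.tgt y * G w c m2 l'.src y) *
      (weight C η w c m2 (0 : VecField P j ℝ) φ * (⟪φ l.src, C.q (bE i)⟫_ℝ * ⟪φ l'.tgt, C.q (bE k)⟫_ℝ))) := j1.sub j2
  have j123 : Integrable (fun φ : Cfg P j N => (G w c m2 l.tgt y * G w c m2 l'.tgt y) *
      (weight C η w c m2 (0 : VecField P j ℝ) φ * (⟪φ l.src, C.q (bE i)⟫_ℝ * ⟪φ l'.src, C.q (bE k)⟫_ℝ))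
      - (G w c m2 l.tgt y * G w c m2 l'.src y) *
      (weight C η w c m2 (0 : VecField P j ℝ) φ * (⟪φ l.src, C.q (bE i)⟫_ℝ * ⟪φ l'.tgt, C.q (bE k)⟫_ℝ))
      - (G w c m2 l.src y * G w c m2 l'.tgt y) *
      (weight C η w c m2 (0 : VecField P j ℝ) φ * (⟪φ l.tgt, C.q (bE i)⟫_ℝ * ⟪φ l'.src, C.q (bE k)⟫_ℝ))) := j12.sub j3
  rw [e, integral_add j123 j4, integral_sub j12 j3, integral_sub j1 j2, integral_const_mul, integral_const_mul,
    integral_const_mul, integral_const_mul, moment2 C η w c m2 hw hm, moment2 C η w c m2 hw hm, moment2 C η w c m2 hw hm,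
    moment2 C η w c m2 hw hm, inner_q_q C, Bk]
  ring

/-- **THE VECTOR-EXCHANGE INSERTION ④ ON THE LOOP OF THE WICK-ORDERED TADPOLE**:
`∫W₀·:∣φ(y)∣⁴:·⟪φ(b₋),qφ(b₊)⟫⟪φ(b′₋),qφ(b′₊)⟫·φ_a(x)φ_b(x′) = 8Z₀·C₀(x,y)C₀(x′,y)·Bk(b,b′;y,y)·[δ_{ab}tr q² + 2⟪e_a,q²e_b⟫]` — each
cubic vertex has exactly ONE scalar leg on the quartic vertex `y` (both legs there gives zero, `derivAlong_cur_deriv`), the other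
two legs form the internal scalar line of ④; the vertex `y` carries the two external legs. [cite: Balaban1983Higgs3, (1.22) term ④
p.416, (1.23) p.417] [cite: GlimmJaffeQP1987, Cor. 8.3.2] -/
theorem integral_wick4_curcur_legs (hw : 0 < w) (hm : 0 < m2) (y : Site P j) (l l' : PBond P j) (a b : Fin N)
    (x x' : Site P j) :
    ∫ φ : Cfg P j N, weight C η w c m2 (0 : VecField P j ℝ) φ *
        (wick4 w c m2 y φ * (⟪φ l.src, C.q (φ l.tgt)⟫_ℝ * ⟪φ l'.src, C.q (φ l'.tgt)⟫_ℝ * legs a b x x' φ)) =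
      8 * (∫ φ : Cfg P j N, weight C η w c m2 (0 : VecField P j ℝ) φ) * (G w c m2 x y * G w c m2 x' y) *
        Bk w c m2 l l' y y *
          (⟪EuclideanSpace.basisFun (Fin N) ℝ a, EuclideanSpace.basisFun (Fin N) ℝ b⟫_ℝ * trE (C.q.comp C.q)
            + 2 * ⟪EuclideanSpace.basisFun (Fin N) ℝ a, C.q (C.q (EuclideanSpace.basisFun (Fin N) ℝ b))⟫_ℝ) := by
  set bE := EuclideanSpace.basisFun (Fin N) ℝ with hbE
  set J : Cfg P j N → ℝ := fun φ => ⟪φ l.src, C.q (φ l.tgt)⟫_ℝ with hJ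
  set J' : Cfg P j N → ℝ := fun φ => ⟪φ l'.src, C.q (φ l'.tgt)⟫_ℝ with hJ'
  set Ji : Fin N → Cfg P j N → ℝ := fun i φ =>
    G w c m2 l.tgt y * ⟪φ l.src, C.q (bE i)⟫_ℝ - G w c m2 l.src y * ⟪φ l.tgt, C.q (bE i)⟫_ℝ with hJi
  set Ji' : Fin N → Cfg P j N → ℝ := fun i φ =>
    G w c m2 l'.tgt y * ⟪φ l'.src, C.q (bE i)⟫_ℝ - G w c m2 l'.src y * ⟪φ l'.tgt, C.q (bE i)⟫_ℝ with hJi'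
  set F1 : Fin N → Cfg P j N → ℝ := fun i φ => Ji i φ * J' φ + J φ * Ji' i φ with hF1
  set F2 : Fin N → Fin N → Cfg P j N → ℝ := fun i k φ => Ji i φ * Ji' k φ + Ji k φ * Ji' i φ with hF2
  have gJ : ExpGrowth J := ExpGrowth.inner_op_apply l.src l.tgt C.q
  have gJ' : ExpGrowth J' := ExpGrowth.inner_op_apply l'.src l'.tgt C.q
  have gJi : ∀ i, ExpGrowth (Ji i) := fun i =>
    ((ExpGrowth.inner_apply l.src _).const_mul _).sub ((ExpGrowth.inner_apply l.tgt _).const_mul _)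
  have gJi' : ∀ i, ExpGrowth (Ji' i) := fun i =>
    ((ExpGrowth.inner_apply l'.src _).const_mul _).sub ((ExpGrowth.inner_apply l'.tgt _).const_mul _)
  have dJ : ∀ i, DerivAlong (hx w c m2 y i) J (Ji i) := fun i => derivAlong_cur C w c m2 y l.src l.tgt i
  have dJ' : ∀ i, DerivAlong (hx w c m2 y i) J' (Ji' i) := fun i => derivAlong_cur C w c m2 y l'.src l'.tgt i
  have dJi : ∀ i k, DerivAlong (hx w c m2 y k) (Ji i) (fun _ => 0) := fun i k => derivAlong_cur_deriv C w c m2 y l.src l.tgt i k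
  have dJi' : ∀ i k, DerivAlong (hx w c m2 y k) (Ji' i) (fun _ => 0) := fun i k =>
    derivAlong_cur_deriv C w c m2 y l'.src l'.tgt i k
  have hF : ExpGrowth (fun φ : Cfg P j N => J φ * J' φ) := gJ.mul gJ'
  have hF1g : ∀ i, ExpGrowth (F1 i) := fun i => ((gJi i).mul gJ').add (gJ.mul (gJi' i))
  have hF2g : ∀ i k, ExpGrowth (F2 i k) := fun i k => ((gJi i).mul (gJi' k)).add ((gJi k).mul (gJi' i))
  have dF : ∀ i, DerivAlong (hx w c m2 y i) (fun φ : Cfg P j N => J φ * J' φ) (F1 i) := fun i => (dJ i).mul (dJ' i)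
  have dF1 : ∀ i k, DerivAlong (hx w c m2 y k) (F1 i) (F2 i k) := fun i k =>
    (((dJi i k).mul (dJ' k)).add ((dJ k).mul (dJi' i k))).congr fun φ => by simp only [hF2]; ring
  have dF2 : ∀ i k m, DerivAlong (hx w c m2 y m) (F2 i k) (fun _ => 0) := fun i k m =>
    (((dJi i m).mul (dJi' k m)).add ((dJi k m).mul (dJi' i m))).congr fun φ => by ring
  have e0 : (fun φ : Cfg P j N => weight C η w c m2 (0 : VecField P j ℝ) φ *
        (wick4 w c m2 y φ * (⟪φ l.src, C.q (φ l.tgt)⟫_ℝ * ⟪φ l'.src, C.q (φ l'.tgt)⟫_ℝ * legs a b x x' φ))) = fun φ =>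
      weight C η w c m2 (0 : VecField P j ℝ) φ * (wick4 w c m2 y φ * ((fun φ : Cfg P j N => J φ * J' φ) φ * legs a b x x' φ)) := by
    funext φ; simp only [hJ, hJ']
  rw [e0, integral_wick4_obs_legs C η w c m2 hw hm y a b x x' hF hF1g hF2g dF dF1 dF2]
  have hI : ∀ i k, ∫ φ : Cfg P j N, weight C η w c m2 (0 : VecField P j ℝ) φ * F2 i k φ =
      (∫ φ : Cfg P j N, weight C η w c m2 (0 : VecField P j ℝ) φ) *
        ((⟪bE i, C.q (C.q (bE k))⟫_ℝ + ⟪bE k, C.q (C.q (bE i))⟫_ℝ) * Bk w c m2 l l' y y) := by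
    intro i k
    have j1 := ((gJi i).mul (gJi' k)).integrable C η w c m2 hw hm
    have j2 := ((gJi k).mul (gJi' i)).integrable C η w c m2 hw hm
    have e : (fun φ : Cfg P j N => weight C η w c m2 (0 : VecField P j ℝ) φ * F2 i k φ) = fun φ =>
        weight C η w c m2 (0 : VecField P j ℝ) φ * (Ji i φ * Ji' k φ) + weight C η w c m2 (0 : VecField P j ℝ) φ * (Ji k φ * Ji' i φ) := by
      funext φ; simp only [hF2]; ring
    rw [e, integral_add j1 j2]
    simp only [hJi, hJi']
    rw [integral_curDeriv_curDeriv C η w c m2 hw hm y l l' i k, integral_curDeriv_curDeriv C η w c m2 hw hm y l l' k i]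
    ring
  simp_rw [hI]
  rw [← Finset.mul_sum, ← Finset.sum_mul]
  have htr : ∑ i : Fin N, (⟪bE i, C.q (C.q (bE i))⟫_ℝ + ⟪bE i, C.q (C.q (bE i))⟫_ℝ) = 2 * trE (C.q.comp C.q) := by
    rw [trE, two_mul, ← Finset.sum_add_distrib]
    simp only [ContinuousLinearMap.coe_comp, Function.comp_apply, hbE]
  rw [htr, inner_qq_comm C (bE b) (bE a)]
  ring

end WickPieces


/-! ## §8 THE INDEX `(2,1)` AT PRINT'S `δm²_{(0,1)}` IN CLOSED FORM: the Wick-ordered tadpole at `y` (external legs `x → y`,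
`x′ → y`) whose LOOP carries the subtracted order-`e²` insertion — print's ② (the `A`-tadpole `C^ε(b₋,b₋)` on the point-split
bilinear `⟪φ(b₋),q²φ(b₊)⟫`), print's ④ (the vector exchange, BRICK 7's bracket `Bk(b,b′;y,y)`), and the `−δm²_{(2,0)}` bubble —
plus `C₀(−δm²_{(2,1)})C₀`; the two-loop graph «quartic vertex with one external leg + cubic pair» and `⟨V_:·Y⟩` vanish
(`derivAlong_cur_deriv`) -/

section Assembly

omit μ2 in
/-- `∫W₀:∣φ(y)∣⁴:⟪φ(u),Mφ(v)⟫ = 0` (a quartic Wick-ordered vertex cannot close on a single bilinear vertex).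
[cite: GlimmJaffeQP1987, Cor. 8.3.2 (8.3.8)–(8.3.9)] -/
theorem integral_wick4_bil (hw : 0 < w) (hm : 0 < m2) (y u v : Site P j)
    (M : EuclideanSpace ℝ (Fin N) →L[ℝ] EuclideanSpace ℝ (Fin N)) :
    ∫ φ : Cfg P j N, weight C η w c m2 (0 : VecField P j ℝ) φ * (wick4 w c m2 y φ * ⟪φ u, M (φ v)⟫_ℝ) = 0 := by
  set bE := EuclideanSpace.basisFun (Fin N) ℝ with hbE
  refine integral_wick4_mul_of_deg2 C η w c m2 hw hm y (ExpGrowth.inner_op_apply u v M)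
    (R₁ := fun i φ => G w c m2 u y * ⟪φ v, ContinuousLinearMap.adjoint M (bE i)⟫_ℝ + G w c m2 v y * ⟪φ u, M (bE i)⟫_ℝ)
    (R₂ := fun i _ => G w c m2 u y * (G w c m2 v y * ⟪bE i, ContinuousLinearMap.adjoint M (bE i)⟫_ℝ)
      + G w c m2 v y * (G w c m2 u y * ⟪bE i, M (bE i)⟫_ℝ))
    (fun i => ((ExpGrowth.inner_apply v _).const_mul _).add ((ExpGrowth.inner_apply u _).const_mul _))
    (fun i => ExpGrowth.const _) (fun i => ?_) (fun i => ?_) (fun i k => DerivAlong.const _ _)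
  · exact (DerivAlong.inner_op_apply (hx w c m2 y i) u v M).congr fun φ => by
      rw [inner_hx_left, op_hx, inner_smul_right, ContinuousLinearMap.adjoint_inner_right, real_inner_comm (bE i)]
  · exact (((DerivAlong.inner_apply (hx w c m2 y i) v _).const_mul _).add
      ((DerivAlong.inner_apply (hx w c m2 y i) u _).const_mul _)).congr fun φ => by
      rw [inner_hx_left, inner_hx_left]

/-- **`∫W₀:∣φ(y)∣⁴:·⟪φ(b₋),qφ(b₊)⟫⟪φ(b′₋),qφ(b′₊)⟫ = 0`** — the vacuum graph «quartic vertex + cubic pair» vanishes: each current would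
need both legs at `y` (`derivAlong_cur_deriv`). [cite: Balaban1983Higgs3, (1.24) p.417] [cite: GlimmJaffeQP1987, Cor. 8.3.2] -/
theorem integral_wick4_curcur (hw : 0 < w) (hm : 0 < m2) (y : Site P j) (l l' : PBond P j) :
    ∫ φ : Cfg P j N, weight C η w c m2 (0 : VecField P j ℝ) φ *
      (wick4 w c m2 y φ * (⟪φ l.src, C.q (φ l.tgt)⟫_ℝ * ⟪φ l'.src, C.q (φ l'.tgt)⟫_ℝ)) = 0 := by
  set bE := EuclideanSpace.basisFun (Fin N) ℝ with hbE
  set J : Cfg P j N → ℝ := fun φ => ⟪φ l.src, C.q (φ l.tgt)⟫_ℝ with hJ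
  set J' : Cfg P j N → ℝ := fun φ => ⟪φ l'.src, C.q (φ l'.tgt)⟫_ℝ with hJ'
  set Ji : Fin N → Cfg P j N → ℝ := fun i φ =>
    G w c m2 l.tgt y * ⟪φ l.src, C.q (bE i)⟫_ℝ - G w c m2 l.src y * ⟪φ l.tgt, C.q (bE i)⟫_ℝ with hJi
  set Ji' : Fin N → Cfg P j N → ℝ := fun i φ =>
    G w c m2 l'.tgt y * ⟪φ l'.src, C.q (bE i)⟫_ℝ - G w c m2 l'.src y * ⟪φ l'.tgt, C.q (bE i)⟫_ℝ with hJi'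
  have gJ : ExpGrowth J := ExpGrowth.inner_op_apply l.src l.tgt C.q
  have gJ' : ExpGrowth J' := ExpGrowth.inner_op_apply l'.src l'.tgt C.q
  have gJi : ∀ i, ExpGrowth (Ji i) := fun i =>
    ((ExpGrowth.inner_apply l.src _).const_mul _).sub ((ExpGrowth.inner_apply l.tgt _).const_mul _)
  have gJi' : ∀ i, ExpGrowth (Ji' i) := fun i =>
    ((ExpGrowth.inner_apply l'.src _).const_mul _).sub ((ExpGrowth.inner_apply l'.tgt _).const_mul _)
  have dJ : ∀ i, DerivAlong (hx w c m2 y i) J (Ji i) := fun i => derivAlong_cur C w c m2 y l.src l.tgt i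
  have dJ' : ∀ i, DerivAlong (hx w c m2 y i) J' (Ji' i) := fun i => derivAlong_cur C w c m2 y l'.src l'.tgt i
  have dJi : ∀ i k, DerivAlong (hx w c m2 y k) (Ji i) (fun _ => 0) := fun i k => derivAlong_cur_deriv C w c m2 y l.src l.tgt i k
  have dJi' : ∀ i k, DerivAlong (hx w c m2 y k) (Ji' i) (fun _ => 0) := fun i k =>
    derivAlong_cur_deriv C w c m2 y l'.src l'.tgt i k
  have h := integral_wick4_obs C η w c m2 hw hm y (F := fun φ => J φ * J' φ)
    (F1 := fun i φ => Ji i φ * J' φ + J φ * Ji' i φ) (F2 := fun i k φ => Ji i φ * Ji' k φ + Ji k φ * Ji' i φ)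
    (gJ.mul gJ') (fun i => ((gJi i).mul gJ').add (gJ.mul (gJi' i)))
    (fun i k => ((gJi i).mul (gJi' k)).add ((gJi k).mul (gJi' i))) (fun i => (dJ i).mul (dJ' i))
    (fun i k => (((dJi i k).mul (dJ' k)).add ((dJ k).mul (dJi' i k))).congr fun φ => by ring)
    (fun i k m => (((dJi i m).mul (dJi' k m)).add ((dJi k m).mul (dJi' i m))).congr fun φ => by ring)
  simpa only [hJ, hJ'] using h

omit C η w c m2 μ2 in
/-- `tr 1 = N`. [folklore] -/
private theorem trE_one' : trE (1 : EuclideanSpace ℝ (Fin N) →L[ℝ] EuclideanSpace ℝ (Fin N)) = N := by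
  unfold trE
  simp only [one_apply_eq_self, (EuclideanSpace.basisFun (Fin N) ℝ).orthonormal.1, real_inner_self_eq_norm_sq,
    one_pow, Finset.sum_const, Finset.card_univ, Fintype.card_fin, nsmul_eq_mul, mul_one]

/-- **`⟨:∣φ(y)∣⁴:·Y·L⟩₀` IN CLOSED FORM** (`Y = X − δm²_{(2,0)}Q`, `Z₀ = ∫W₀`): the loop of the Wick-ordered tadpole at `y` carries
② (`Σ_b η^dc²η²C^ε(b₋,b₋)·C₀(b₋,y)C₀(b₊,y)`), ④ (`Σ_{b,b′:μ=μ′}(η^dc²η)²C^ε(b₋,b′₋)·Bk(b,b′;y,y)`) — each with the index factor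
`δ_{ab}tr q² + 2(q²)_{ab}` — and the `−δm²_{(2,0)}` bubble (`(N+2)δ_{ab}Σ_zη^dC₀(z,y)²`), all times `8C₀(x,y)C₀(x′,y)`.
[cite: Balaban1983Higgs3, (1.22)–(1.23) pp.416–417] [cite: GlimmJaffeQP1987, Cor. 8.3.2] -/
theorem integral_wick4_Y_legs (hw : 0 < w) (hm : 0 < m2) (d20 : ℝ) {X Y : Cfg P j N → ℝ}
    (hX : ∀ φ, X φ = (∑ b : PBond P j, w * (c ^ 2 * η ^ 2) * G w c μ2 b.src b.src * ⟪φ b.src, C.q (C.q (φ b.tgt))⟫_ℝ)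
      + ∑ b : PBond P j, ∑ b' : PBond P j, (w * (c ^ 2 * η)) * (w * (c ^ 2 * η)) *
          (G w c μ2 b.src b'.src * if b.dir = b'.dir then 1 else 0) *
            (⟪φ b.src, C.q (φ b.tgt)⟫_ℝ * ⟪φ b'.src, C.q (φ b'.tgt)⟫_ℝ))
    (hY : ∀ φ, Y φ = X φ - d20 * massForm w φ) (y : Site P j) (a b : Fin N) (x x' : Site P j) :
    ∫ φ : Cfg P j N, weight C η w c m2 (0 : VecField P j ℝ) φ * (wick4 w c m2 y φ * (Y φ * legs a b x x' φ)) =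
      (∑ l : PBond P j, w * (c ^ 2 * η ^ 2) * G w c μ2 l.src l.src *
          (8 * (∫ φ : Cfg P j N, weight C η w c m2 (0 : VecField P j ℝ) φ) * (G w c m2 x y * G w c m2 x' y *
            (G w c m2 l.src y * G w c m2 l.tgt y)) *
            (⟪EuclideanSpace.basisFun (Fin N) ℝ a, EuclideanSpace.basisFun (Fin N) ℝ b⟫_ℝ * trE (C.q.comp C.q)
              + 2 * ⟪EuclideanSpace.basisFun (Fin N) ℝ a, C.q (C.q (EuclideanSpace.basisFun (Fin N) ℝ b))⟫_ℝ)))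
      + (∑ l : PBond P j, ∑ l' : PBond P j, (w * (c ^ 2 * η)) * (w * (c ^ 2 * η)) *
          (G w c μ2 l.src l'.src * if l.dir = l'.dir then 1 else 0) *
            (8 * (∫ φ : Cfg P j N, weight C η w c m2 (0 : VecField P j ℝ) φ) * (G w c m2 x y * G w c m2 x' y) *
              Bk w c m2 l l' y y *
              (⟪EuclideanSpace.basisFun (Fin N) ℝ a, EuclideanSpace.basisFun (Fin N) ℝ b⟫_ℝ * trE (C.q.comp C.q)
                + 2 * ⟪EuclideanSpace.basisFun (Fin N) ℝ a, C.q (C.q (EuclideanSpace.basisFun (Fin N) ℝ b))⟫_ℝ)))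
      - d20 * ∑ z : Site P j, w *
          (8 * (∫ φ : Cfg P j N, weight C η w c m2 (0 : VecField P j ℝ) φ) * (G w c m2 x y * G w c m2 x' y *
            (G w c m2 z y * G w c m2 z y)) *
            ((N + 2) * ⟪EuclideanSpace.basisFun (Fin N) ℝ a, EuclideanSpace.basisFun (Fin N) ℝ b⟫_ℝ)) := by
  set bE := EuclideanSpace.basisFun (Fin N) ℝ with hbE
  have hLg : ExpGrowth (legs a b x x' : Cfg P j N → ℝ) := expGrowth_legs a b x x'
  have hW4 := expGrowth_wick4 (P := P) (j := j) (N := N) w c m2 y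
  -- the three groups of integrands
  have hI1 : ∀ l : PBond P j, Integrable (fun φ : Cfg P j N => weight C η w c m2 (0 : VecField P j ℝ) φ *
      (wick4 w c m2 y φ * (⟪φ l.src, C.q (C.q (φ l.tgt))⟫_ℝ * legs a b x x' φ))) := fun l => by
    have h := (hW4.mul ((ExpGrowth.inner_op_apply (P := P) (j := j) l.src l.tgt (C.q.comp C.q)).mul hLg)).integrable
      C η w c m2 hw hm
    simpa only [ContinuousLinearMap.coe_comp, Function.comp_apply] using h
  have hI2 : ∀ l l' : PBond P j, Integrable (fun φ : Cfg P j N => weight C η w c m2 (0 : VecField P j ℝ) φ *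
      (wick4 w c m2 y φ * (⟪φ l.src, C.q (φ l.tgt)⟫_ℝ * ⟪φ l'.src, C.q (φ l'.tgt)⟫_ℝ * legs a b x x' φ))) := fun l l' =>
    (hW4.mul (((ExpGrowth.inner_op_apply l.src l.tgt C.q).mul (ExpGrowth.inner_op_apply l'.src l'.tgt C.q)).mul
      hLg)).integrable C η w c m2 hw hm
  have hI3 : ∀ z : Site P j, Integrable (fun φ : Cfg P j N => weight C η w c m2 (0 : VecField P j ℝ) φ *
      (wick4 w c m2 y φ * (⟪φ z, (1 : EuclideanSpace ℝ (Fin N) →L[ℝ] EuclideanSpace ℝ (Fin N)) (φ z)⟫_ℝ *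
        legs a b x x' φ))) := fun z =>
    (hW4.mul ((ExpGrowth.inner_op_apply z z _).mul hLg)).integrable C η w c m2 hw hm
  have hexp : (fun φ : Cfg P j N => weight C η w c m2 (0 : VecField P j ℝ) φ * (wick4 w c m2 y φ * (Y φ * legs a b x x' φ)))
      = fun φ =>
        (∑ l : PBond P j, (w * (c ^ 2 * η ^ 2) * G w c μ2 l.src l.src) *
            (weight C η w c m2 (0 : VecField P j ℝ) φ *
              (wick4 w c m2 y φ * (⟪φ l.src, C.q (C.q (φ l.tgt))⟫_ℝ * legs a b x x' φ))))
        + (∑ l : PBond P j, ∑ l' : PBond P j, ((w * (c ^ 2 * η)) * (w * (c ^ 2 * η)) *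
            (G w c μ2 l.src l'.src * if l.dir = l'.dir then 1 else 0)) *
            (weight C η w c m2 (0 : VecField P j ℝ) φ *
              (wick4 w c m2 y φ * (⟪φ l.src, C.q (φ l.tgt)⟫_ℝ * ⟪φ l'.src, C.q (φ l'.tgt)⟫_ℝ * legs a b x x' φ))))
        - d20 * ∑ z : Site P j, w * (weight C η w c m2 (0 : VecField P j ℝ) φ *
            (wick4 w c m2 y φ * (⟪φ z, (1 : EuclideanSpace ℝ (Fin N) →L[ℝ] EuclideanSpace ℝ (Fin N)) (φ z)⟫_ℝ *
              legs a b x x' φ))) := by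
    funext φ
    have hq : ∀ z : Site P j, ‖φ z‖ ^ 2 = ⟪φ z, (1 : EuclideanSpace ℝ (Fin N) →L[ℝ] EuclideanSpace ℝ (Fin N)) (φ z)⟫_ℝ :=
      fun z => by rw [one_apply_eq_self, real_inner_self_eq_norm_sq]
    rw [hY, hX, massForm]
    simp_rw [hq]
    simp only [Finset.sum_mul, Finset.mul_sum, sub_mul, add_mul, mul_sub, mul_add]
    congr 1
    · congr 1
      · exact Finset.sum_congr rfl fun l _ => by ring
      · exact Finset.sum_congr rfl fun l _ => Finset.sum_congr rfl fun l' _ => by ring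
    · exact Finset.sum_congr rfl fun z _ => by ring
  have hS1 : Integrable (fun φ : Cfg P j N => ∑ l : PBond P j, (w * (c ^ 2 * η ^ 2) * G w c μ2 l.src l.src) *
      (weight C η w c m2 (0 : VecField P j ℝ) φ *
        (wick4 w c m2 y φ * (⟪φ l.src, C.q (C.q (φ l.tgt))⟫_ℝ * legs a b x x' φ)))) :=
    integrable_finsetSum _ fun l _ => (hI1 l).const_mul _
  have hS2 : Integrable (fun φ : Cfg P j N => ∑ l : PBond P j, ∑ l' : PBond P j, ((w * (c ^ 2 * η)) * (w * (c ^ 2 * η)) *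
      (G w c μ2 l.src l'.src * if l.dir = l'.dir then 1 else 0)) *
      (weight C η w c m2 (0 : VecField P j ℝ) φ *
        (wick4 w c m2 y φ * (⟪φ l.src, C.q (φ l.tgt)⟫_ℝ * ⟪φ l'.src, C.q (φ l'.tgt)⟫_ℝ * legs a b x x' φ)))) :=
    integrable_finsetSum _ fun l _ => integrable_finsetSum _ fun l' _ => (hI2 l l').const_mul _
  have hS3 : Integrable (fun φ : Cfg P j N => d20 * ∑ z : Site P j, w * (weight C η w c m2 (0 : VecField P j ℝ) φ *
      (wick4 w c m2 y φ * (⟪φ z, (1 : EuclideanSpace ℝ (Fin N) →L[ℝ] EuclideanSpace ℝ (Fin N)) (φ z)⟫_ℝ *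
        legs a b x x' φ)))) :=
    (integrable_finsetSum _ fun z _ => (hI3 z).const_mul _).const_mul _
  have hS12 : Integrable (fun φ : Cfg P j N => (∑ l : PBond P j, (w * (c ^ 2 * η ^ 2) * G w c μ2 l.src l.src) *
      (weight C η w c m2 (0 : VecField P j ℝ) φ *
        (wick4 w c m2 y φ * (⟪φ l.src, C.q (C.q (φ l.tgt))⟫_ℝ * legs a b x x' φ))))
        + (∑ l : PBond P j, ∑ l' : PBond P j, ((w * (c ^ 2 * η)) * (w * (c ^ 2 * η)) *
      (G w c μ2 l.src l'.src * if l.dir = l'.dir then 1 else 0)) *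
      (weight C η w c m2 (0 : VecField P j ℝ) φ *
        (wick4 w c m2 y φ * (⟪φ l.src, C.q (φ l.tgt)⟫_ℝ * ⟪φ l'.src, C.q (φ l'.tgt)⟫_ℝ * legs a b x x' φ))))) := hS1.add hS2
  rw [hexp, integral_sub hS12 hS3, integral_add hS1 hS2, integral_const_mul,
    integral_finsetSum _ (fun l _ => (hI1 l).const_mul _),
    integral_finsetSum _ (fun l _ => integrable_finsetSum _ fun l' _ => (hI2 l l').const_mul _),
    integral_finsetSum _ (fun z _ => (hI3 z).const_mul _),
    Finset.sum_congr rfl fun l _ => integral_finsetSum _ (fun l' _ => (hI2 l l').const_mul _)]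
  have e1 : ∀ l : PBond P j, ∫ φ : Cfg P j N, (w * (c ^ 2 * η ^ 2) * G w c μ2 l.src l.src) *
      (weight C η w c m2 (0 : VecField P j ℝ) φ * (wick4 w c m2 y φ * (⟪φ l.src, C.q (C.q (φ l.tgt))⟫_ℝ * legs a b x x' φ))) =
      w * (c ^ 2 * η ^ 2) * G w c μ2 l.src l.src *
        (8 * (∫ φ : Cfg P j N, weight C η w c m2 (0 : VecField P j ℝ) φ) * (G w c m2 x y * G w c m2 x' y *
          (G w c m2 l.src y * G w c m2 l.tgt y)) * (⟪bE a, bE b⟫_ℝ * trE (C.q.comp C.q) + 2 * ⟪bE a, C.q (C.q (bE b))⟫_ℝ)) := by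
    intro l
    have h := integral_wick4_bil_legs C η w c m2 hw hm y l.src l.tgt (C.q.comp C.q) a b x x'
    simp only [ContinuousLinearMap.coe_comp, Function.comp_apply] at h
    rw [integral_const_mul, h, inner_qq_comm C (bE b) (bE a)]
    ring
  have e2 : ∀ l l' : PBond P j, ∫ φ : Cfg P j N, ((w * (c ^ 2 * η)) * (w * (c ^ 2 * η)) *
      (G w c μ2 l.src l'.src * if l.dir = l'.dir then 1 else 0)) *
      (weight C η w c m2 (0 : VecField P j ℝ) φ *
        (wick4 w c m2 y φ * (⟪φ l.src, C.q (φ l.tgt)⟫_ℝ * ⟪φ l'.src, C.q (φ l'.tgt)⟫_ℝ * legs a b x x' φ))) =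
      (w * (c ^ 2 * η)) * (w * (c ^ 2 * η)) * (G w c μ2 l.src l'.src * if l.dir = l'.dir then 1 else 0) *
        (8 * (∫ φ : Cfg P j N, weight C η w c m2 (0 : VecField P j ℝ) φ) * (G w c m2 x y * G w c m2 x' y) *
          Bk w c m2 l l' y y * (⟪bE a, bE b⟫_ℝ * trE (C.q.comp C.q) + 2 * ⟪bE a, C.q (C.q (bE b))⟫_ℝ)) := by
    intro l l'
    rw [integral_const_mul, integral_wick4_curcur_legs C η w c m2 hw hm y l l' a b x x']
  have e3 : ∀ z : Site P j, ∫ φ : Cfg P j N, w * (weight C η w c m2 (0 : VecField P j ℝ) φ *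
      (wick4 w c m2 y φ * (⟪φ z, (1 : EuclideanSpace ℝ (Fin N) →L[ℝ] EuclideanSpace ℝ (Fin N)) (φ z)⟫_ℝ *
        legs a b x x' φ))) =
      w * (8 * (∫ φ : Cfg P j N, weight C η w c m2 (0 : VecField P j ℝ) φ) * (G w c m2 x y * G w c m2 x' y *
        (G w c m2 z y * G w c m2 z y)) * ((N + 2) * ⟪bE a, bE b⟫_ℝ)) := by
    intro z
    rw [integral_const_mul, integral_wick4_bil_legs C η w c m2 hw hm y z z 1 a b x x', trE_one', one_apply_eq_self,
      one_apply_eq_self, real_inner_comm (bE a) (bE b)]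
    ring
  simp_rw [e1, e2, e3]

end Assembly


section Headline

/-- `∫W₀:∣φ(y)∣⁴:·Y = 0` — the Wick-ordered quartic vertex cannot close on the order-`e²` insertion alone (② and the mass vertex
are bilinear; for ④ each current would need both legs at `y`). [cite: Balaban1983Higgs3, (1.24) p.417]
[cite: GlimmJaffeQP1987, Cor. 8.3.2 (8.3.8)–(8.3.9)] -/
theorem integral_wick4_Y (hw : 0 < w) (hm : 0 < m2) (d20 : ℝ) {X Y : Cfg P j N → ℝ}
    (hX : ∀ φ, X φ = (∑ b : PBond P j, w * (c ^ 2 * η ^ 2) * G w c μ2 b.src b.src * ⟪φ b.src, C.q (C.q (φ b.tgt))⟫_ℝ)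
      + ∑ b : PBond P j, ∑ b' : PBond P j, (w * (c ^ 2 * η)) * (w * (c ^ 2 * η)) *
          (G w c μ2 b.src b'.src * if b.dir = b'.dir then 1 else 0) *
            (⟪φ b.src, C.q (φ b.tgt)⟫_ℝ * ⟪φ b'.src, C.q (φ b'.tgt)⟫_ℝ))
    (hY : ∀ φ, Y φ = X φ - d20 * massForm w φ) (y : Site P j) :
    ∫ φ : Cfg P j N, weight C η w c m2 (0 : VecField P j ℝ) φ * (wick4 w c m2 y φ * Y φ) = 0 := by
  have hW4 := expGrowth_wick4 (P := P) (j := j) (N := N) w c m2 y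
  have hI1 : ∀ l : PBond P j, Integrable (fun φ : Cfg P j N => weight C η w c m2 (0 : VecField P j ℝ) φ *
      (wick4 w c m2 y φ * ⟪φ l.src, C.q (C.q (φ l.tgt))⟫_ℝ)) := fun l => by
    have h := (hW4.mul (ExpGrowth.inner_op_apply (P := P) (j := j) l.src l.tgt (C.q.comp C.q))).integrable C η w c m2 hw hm
    simpa only [ContinuousLinearMap.coe_comp, Function.comp_apply] using h
  have hI2 : ∀ l l' : PBond P j, Integrable (fun φ : Cfg P j N => weight C η w c m2 (0 : VecField P j ℝ) φ *
      (wick4 w c m2 y φ * (⟪φ l.src, C.q (φ l.tgt)⟫_ℝ * ⟪φ l'.src, C.q (φ l'.tgt)⟫_ℝ))) := fun l l' =>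
    (hW4.mul ((ExpGrowth.inner_op_apply l.src l.tgt C.q).mul (ExpGrowth.inner_op_apply l'.src l'.tgt C.q))).integrable
      C η w c m2 hw hm
  have hI3 : ∀ z : Site P j, Integrable (fun φ : Cfg P j N => weight C η w c m2 (0 : VecField P j ℝ) φ *
      (wick4 w c m2 y φ * ⟪φ z, (1 : EuclideanSpace ℝ (Fin N) →L[ℝ] EuclideanSpace ℝ (Fin N)) (φ z)⟫_ℝ)) := fun z =>
    (hW4.mul (ExpGrowth.inner_op_apply z z _)).integrable C η w c m2 hw hm
  have hexp : (fun φ : Cfg P j N => weight C η w c m2 (0 : VecField P j ℝ) φ * (wick4 w c m2 y φ * Y φ)) = fun φ =>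
        (∑ l : PBond P j, (w * (c ^ 2 * η ^ 2) * G w c μ2 l.src l.src) *
            (weight C η w c m2 (0 : VecField P j ℝ) φ * (wick4 w c m2 y φ * ⟪φ l.src, C.q (C.q (φ l.tgt))⟫_ℝ)))
        + (∑ l : PBond P j, ∑ l' : PBond P j, ((w * (c ^ 2 * η)) * (w * (c ^ 2 * η)) *
            (G w c μ2 l.src l'.src * if l.dir = l'.dir then 1 else 0)) *
            (weight C η w c m2 (0 : VecField P j ℝ) φ *
              (wick4 w c m2 y φ * (⟪φ l.src, C.q (φ l.tgt)⟫_ℝ * ⟪φ l'.src, C.q (φ l'.tgt)⟫_ℝ))))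
        - d20 * ∑ z : Site P j, w * (weight C η w c m2 (0 : VecField P j ℝ) φ *
            (wick4 w c m2 y φ * ⟪φ z, (1 : EuclideanSpace ℝ (Fin N) →L[ℝ] EuclideanSpace ℝ (Fin N)) (φ z)⟫_ℝ)) := by
    funext φ
    have hq : ∀ z : Site P j, ‖φ z‖ ^ 2 = ⟪φ z, (1 : EuclideanSpace ℝ (Fin N) →L[ℝ] EuclideanSpace ℝ (Fin N)) (φ z)⟫_ℝ :=
      fun z => by rw [one_apply_eq_self, real_inner_self_eq_norm_sq]
    rw [hY, hX, massForm]
    simp_rw [hq]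
    simp only [Finset.mul_sum, mul_sub, mul_add]
    congr 1
    · congr 1
      · exact Finset.sum_congr rfl fun l _ => by ring
      · exact Finset.sum_congr rfl fun l _ => Finset.sum_congr rfl fun l' _ => by ring
    · exact Finset.sum_congr rfl fun z _ => by ring
  have hS1 : Integrable (fun φ : Cfg P j N => ∑ l : PBond P j, (w * (c ^ 2 * η ^ 2) * G w c μ2 l.src l.src) *
      (weight C η w c m2 (0 : VecField P j ℝ) φ * (wick4 w c m2 y φ * ⟪φ l.src, C.q (C.q (φ l.tgt))⟫_ℝ))) :=
    integrable_finsetSum _ fun l _ => (hI1 l).const_mul _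
  have hS2 : Integrable (fun φ : Cfg P j N => ∑ l : PBond P j, ∑ l' : PBond P j, ((w * (c ^ 2 * η)) * (w * (c ^ 2 * η)) *
      (G w c μ2 l.src l'.src * if l.dir = l'.dir then 1 else 0)) *
      (weight C η w c m2 (0 : VecField P j ℝ) φ *
        (wick4 w c m2 y φ * (⟪φ l.src, C.q (φ l.tgt)⟫_ℝ * ⟪φ l'.src, C.q (φ l'.tgt)⟫_ℝ)))) :=
    integrable_finsetSum _ fun l _ => integrable_finsetSum _ fun l' _ => (hI2 l l').const_mul _
  have hS12 : Integrable (fun φ : Cfg P j N => (∑ l : PBond P j, (w * (c ^ 2 * η ^ 2) * G w c μ2 l.src l.src) *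
      (weight C η w c m2 (0 : VecField P j ℝ) φ * (wick4 w c m2 y φ * ⟪φ l.src, C.q (C.q (φ l.tgt))⟫_ℝ)))
        + (∑ l : PBond P j, ∑ l' : PBond P j, ((w * (c ^ 2 * η)) * (w * (c ^ 2 * η)) *
      (G w c μ2 l.src l'.src * if l.dir = l'.dir then 1 else 0)) *
      (weight C η w c m2 (0 : VecField P j ℝ) φ *
        (wick4 w c m2 y φ * (⟪φ l.src, C.q (φ l.tgt)⟫_ℝ * ⟪φ l'.src, C.q (φ l'.tgt)⟫_ℝ))))) := hS1.add hS2
  have hS3 : Integrable (fun φ : Cfg P j N => d20 * ∑ z : Site P j, w * (weight C η w c m2 (0 : VecField P j ℝ) φ *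
      (wick4 w c m2 y φ * ⟪φ z, (1 : EuclideanSpace ℝ (Fin N) →L[ℝ] EuclideanSpace ℝ (Fin N)) (φ z)⟫_ℝ))) :=
    (integrable_finsetSum _ fun z _ => (hI3 z).const_mul _).const_mul _
  rw [hexp, integral_sub hS12 hS3, integral_add hS1 hS2, integral_const_mul,
    integral_finsetSum _ (fun l _ => (hI1 l).const_mul _),
    integral_finsetSum _ (fun l _ => integrable_finsetSum _ fun l' _ => (hI2 l l').const_mul _),
    integral_finsetSum _ (fun z _ => (hI3 z).const_mul _),
    Finset.sum_congr rfl fun l _ => integral_finsetSum _ (fun l' _ => (hI2 l l').const_mul _)]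
  simp_rw [integral_const_mul, integral_wick4_bil C η w c m2 hw hm, integral_wick4_curcur C η w c m2 hw hm]
  simp only [mul_zero, Finset.sum_const_zero, add_zero, sub_zero]
  have e1 : ∀ l : PBond P j, ∫ φ : Cfg P j N, weight C η w c m2 (0 : VecField P j ℝ) φ *
      (wick4 w c m2 y φ * ⟪φ l.src, C.q (C.q (φ l.tgt))⟫_ℝ) = 0 := fun l => by
    have h := integral_wick4_bil C η w c m2 hw hm y l.src l.tgt (C.q.comp C.q)
    simpa only [ContinuousLinearMap.coe_comp, Function.comp_apply] using h
  simp_rw [e1]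
  simp only [mul_zero, Finset.sum_const_zero]

/-- **`⟨V_:·Y⟩₀ = 0`** (`V_: = Σ_yη^d:∣φ(y)∣⁴:`): the disconnected term of §6 is absent. [cite: Balaban1983Higgs3, (1.24) p.417]
[cite: GlimmJaffeQP1987, Cor. 8.3.2] -/
theorem integral_W_Y (hw : 0 < w) (hm : 0 < m2) (d20 : ℝ) {X Y W : Cfg P j N → ℝ}
    (hX : ∀ φ, X φ = (∑ b : PBond P j, w * (c ^ 2 * η ^ 2) * G w c μ2 b.src b.src * ⟪φ b.src, C.q (C.q (φ b.tgt))⟫_ℝ)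
      + ∑ b : PBond P j, ∑ b' : PBond P j, (w * (c ^ 2 * η)) * (w * (c ^ 2 * η)) *
          (G w c μ2 b.src b'.src * if b.dir = b'.dir then 1 else 0) *
            (⟪φ b.src, C.q (φ b.tgt)⟫_ℝ * ⟪φ b'.src, C.q (φ b'.tgt)⟫_ℝ))
    (hY : ∀ φ, Y φ = X φ - d20 * massForm w φ) (hW : ∀ φ, W φ = ∑ y : Site P j, w * wick4 w c m2 y φ) :
    ∫ φ : Cfg P j N, weight C η w c m2 (0 : VecField P j ℝ) φ * (W φ * Y φ) = 0 := by
  have hXg := expGrowth_X C η w c μ2 hX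
  have hmF := expGrowth_massForm (P := P) (j := j) (N := N) w
  have hYg : ExpGrowth Y := by
    have e : Y = fun φ => X φ - d20 * massForm w φ := funext hY
    rw [e]; exact hXg.sub (hmF.const_mul d20)
  have hi : ∀ y : Site P j, Integrable (fun φ : Cfg P j N => weight C η w c m2 (0 : VecField P j ℝ) φ *
      (w * (wick4 w c m2 y φ * Y φ))) := fun y =>
    (((expGrowth_wick4 w c m2 y).mul hYg).const_mul w).integrable C η w c m2 hw hm
  have e1 : (fun φ : Cfg P j N => weight C η w c m2 (0 : VecField P j ℝ) φ * (W φ * Y φ)) =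
      fun φ => ∑ y : Site P j, weight C η w c m2 (0 : VecField P j ℝ) φ * (w * (wick4 w c m2 y φ * Y φ)) := by
    funext φ; rw [hW, Finset.sum_mul, Finset.mul_sum]; exact Finset.sum_congr rfl fun y _ => by ring
  rw [e1, integral_finsetSum _ (fun y _ => hi y)]
  refine Finset.sum_eq_zero fun y _ => ?_
  have e2 : (fun φ : Cfg P j N => weight C η w c m2 (0 : VecField P j ℝ) φ * (w * (wick4 w c m2 y φ * Y φ))) =
      fun φ => w * (weight C η w c m2 (0 : VecField P j ℝ) φ * (wick4 w c m2 y φ * Y φ)) := by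
    funext φ; ring
  rw [e2, integral_const_mul, integral_wick4_Y C η w c m2 μ2 hw hm d20 hX hY y, mul_zero]

/-- **`⟨V_:·Y·L⟩₀` summed over the position of the quartic vertex** (`Z₀` factored).
[cite: Balaban1983Higgs3, (1.22)–(1.23) pp.416–417] [cite: GlimmJaffeQP1987, Cor. 8.3.2] -/
theorem integral_W_Y_legs (hw : 0 < w) (hm : 0 < m2) (d20 : ℝ) {X Y W : Cfg P j N → ℝ}
    (hX : ∀ φ, X φ = (∑ b : PBond P j, w * (c ^ 2 * η ^ 2) * G w c μ2 b.src b.src * ⟪φ b.src, C.q (C.q (φ b.tgt))⟫_ℝ)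
      + ∑ b : PBond P j, ∑ b' : PBond P j, (w * (c ^ 2 * η)) * (w * (c ^ 2 * η)) *
          (G w c μ2 b.src b'.src * if b.dir = b'.dir then 1 else 0) *
            (⟪φ b.src, C.q (φ b.tgt)⟫_ℝ * ⟪φ b'.src, C.q (φ b'.tgt)⟫_ℝ))
    (hY : ∀ φ, Y φ = X φ - d20 * massForm w φ) (hW : ∀ φ, W φ = ∑ y : Site P j, w * wick4 w c m2 y φ)
    (a b : Fin N) (x x' : Site P j) :
    ∫ φ : Cfg P j N, weight C η w c m2 (0 : VecField P j ℝ) φ * (W φ * (Y φ * legs a b x x' φ)) =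
      (∫ φ : Cfg P j N, weight C η w c m2 (0 : VecField P j ℝ) φ) * ∑ y : Site P j, w *
        ((∑ l : PBond P j, w * (c ^ 2 * η ^ 2) * G w c μ2 l.src l.src *
            (8 * (G w c m2 x y * G w c m2 x' y * (G w c m2 l.src y * G w c m2 l.tgt y)) *
              (⟪EuclideanSpace.basisFun (Fin N) ℝ a, EuclideanSpace.basisFun (Fin N) ℝ b⟫_ℝ * trE (C.q.comp C.q)
                + 2 * ⟪EuclideanSpace.basisFun (Fin N) ℝ a, C.q (C.q (EuclideanSpace.basisFun (Fin N) ℝ b))⟫_ℝ)))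
        + (∑ l : PBond P j, ∑ l' : PBond P j, (w * (c ^ 2 * η)) * (w * (c ^ 2 * η)) *
            (G w c μ2 l.src l'.src * if l.dir = l'.dir then 1 else 0) *
              (8 * (G w c m2 x y * G w c m2 x' y) * Bk w c m2 l l' y y *
                (⟪EuclideanSpace.basisFun (Fin N) ℝ a, EuclideanSpace.basisFun (Fin N) ℝ b⟫_ℝ * trE (C.q.comp C.q)
                  + 2 * ⟪EuclideanSpace.basisFun (Fin N) ℝ a, C.q (C.q (EuclideanSpace.basisFun (Fin N) ℝ b))⟫_ℝ)))
        - d20 * ∑ z : Site P j, w *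
            (8 * (G w c m2 x y * G w c m2 x' y * (G w c m2 z y * G w c m2 z y)) *
              ((N + 2) * ⟪EuclideanSpace.basisFun (Fin N) ℝ a, EuclideanSpace.basisFun (Fin N) ℝ b⟫_ℝ))) := by
  have hXg := expGrowth_X C η w c μ2 hX
  have hmF := expGrowth_massForm (P := P) (j := j) (N := N) w
  have hLg : ExpGrowth (legs a b x x' : Cfg P j N → ℝ) := expGrowth_legs a b x x'
  have hYg : ExpGrowth Y := by
    have e : Y = fun φ => X φ - d20 * massForm w φ := funext hY
    rw [e]; exact hXg.sub (hmF.const_mul d20)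
  have hi : ∀ y : Site P j, Integrable (fun φ : Cfg P j N => weight C η w c m2 (0 : VecField P j ℝ) φ *
      (w * (wick4 w c m2 y φ * (Y φ * legs a b x x' φ)))) := fun y =>
    (((expGrowth_wick4 w c m2 y).mul (hYg.mul hLg)).const_mul w).integrable C η w c m2 hw hm
  have e1 : (fun φ : Cfg P j N => weight C η w c m2 (0 : VecField P j ℝ) φ * (W φ * (Y φ * legs a b x x' φ))) =
      fun φ => ∑ y : Site P j, weight C η w c m2 (0 : VecField P j ℝ) φ * (w * (wick4 w c m2 y φ * (Y φ * legs a b x x' φ))) := by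
    funext φ; rw [hW, Finset.sum_mul, Finset.mul_sum]; exact Finset.sum_congr rfl fun y _ => by ring
  rw [e1, integral_finsetSum _ (fun y _ => hi y), Finset.mul_sum]
  refine Finset.sum_congr rfl fun y _ => ?_
  have e2 : (fun φ : Cfg P j N => weight C η w c m2 (0 : VecField P j ℝ) φ * (w * (wick4 w c m2 y φ * (Y φ * legs a b x x' φ)))) =
      fun φ => w * (weight C η w c m2 (0 : VecField P j ℝ) φ * (wick4 w c m2 y φ * (Y φ * legs a b x x' φ))) := by
    funext φ; ring
  rw [e2, integral_const_mul, integral_wick4_Y_legs C η w c m2 μ2 hw hm d20 hX hY y a b x x']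
  simp only [Finset.mul_sum, mul_add, mul_sub]
  congr 1
  · congr 1
    · exact Finset.sum_congr rfl fun l _ => by ring
    · exact Finset.sum_congr rfl fun l _ => Finset.sum_congr rfl fun l' _ => by ring
  · exact Finset.sum_congr rfl fun z _ => by ring

/-- **THE INDEX `(2,1)` OF PRINT'S RECURSION AT PRINT'S `δm²_{(0,1)}`, IN CLOSED FORM.**  For (1.19)/(1.20) with `δm² =
δm²_{(2,0)}e² + δm²_{(0,1)}λ + δm²_{(2,1)}e²λ + δm²_{(4,0)}e⁴`, `δm²_{(0,1)} = −4(N+2)C^ε_0(0)` (print's first counterterm, (1.23)):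
`∂_λ⁺∂²_e G^{ct}_{ab}(x,x′)∣₀ = −Σ_yη^d·8C₀(x,y)C₀(x′,y)·{ [δ_{ab}tr q² + 2(q²)_{ab}]·[Σ_b η^dc²η²C^ε(b₋,b₋)C₀(b₋,y)C₀(b₊,y) +
Σ_{b,b′:μ=μ′}(η^dc²η)²C^ε(b₋,b′₋)Bk(b,b′;y,y)] − δm²_{(2,0)}·(N+2)δ_{ab}Σ_zη^dC₀(z,y)² } − 2δm²_{(2,1)}δ_{ab}Σ_zη^dC₀(x,z)C₀(x′,z)`:
THE TADPOLE LOOP AT `y` CARRYING THE ORDER-`e²` INSERTION (② = the `A`-tadpole on the point-split bilinear, ④ = the vector exchange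
in BRICK 7's unitarity form `Bk`) MINUS ITS COUNTERTERM BUBBLE `δm²_{(2,0)}`, and the `n = 1` term `C₀(−δm²_{(2,1)})C₀`.  No tadpole
insertions (Wick ordering, §6), no graph with both scalar legs of one cubic vertex on the quartic vertex («quartic vertex with one external leg + cubic pair»: §7 `derivAlong_cur_deriv`, `q* = −q`), no disconnected piece (§8
`integral_W_Y`).  Print's coefficient of `e²λ` in (1.19) is `(2!1!)⁻¹` times this; print displays at this order only ⑦ and the
picture «④ with a tadpole on the internal line» (p. 417), which cancel here — the surviving graphs are in its *"+ …"*.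
[cite: Balaban1983Higgs3, (1.19)–(1.23) pp.416–417] [cite: GlimmJaffeQP1987, Cor. 8.3.2, §8.4–8.5] -/
theorem derivWithin_index21_explicit (hw : 0 < w) (hm : 0 < m2) (hμ : 0 < μ2) (d20 d01 d21 d40 : ℝ)
    (hd01 : d01 = -(4 * (N + 2) * C0 (P := P) (j := j) w c m2)) (a b : Fin N) (x x' : Site P j) :
    derivWithin (fun lam : ℝ => iteratedDeriv 2 (fun e : ℝ =>
        (∫ p : JCfg P j N, J C η w c (m2 + (d20 * e ^ 2 + d01 * lam + d21 * (e ^ 2 * lam) + d40 * e ^ 4)) μ2 e p *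
            (Real.exp (-(lam * ∑ y : Site P j, w * ‖p.2 y‖ ^ 4)) * legs a b x x' p.2)) /
          ∫ p : JCfg P j N, J C η w c (m2 + (d20 * e ^ 2 + d01 * lam + d21 * (e ^ 2 * lam) + d40 * e ^ 4)) μ2 e p *
            Real.exp (-(lam * ∑ y : Site P j, w * ‖p.2 y‖ ^ 4))) 0) (Set.Ici 0) 0 =
      -(∑ y : Site P j, w *
          ((∑ l : PBond P j, w * (c ^ 2 * η ^ 2) * G w c μ2 l.src l.src *
              (8 * (G w c m2 x y * G w c m2 x' y * (G w c m2 l.src y * G w c m2 l.tgt y)) *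
                (⟪EuclideanSpace.basisFun (Fin N) ℝ a, EuclideanSpace.basisFun (Fin N) ℝ b⟫_ℝ * trE (C.q.comp C.q)
                  + 2 * ⟪EuclideanSpace.basisFun (Fin N) ℝ a, C.q (C.q (EuclideanSpace.basisFun (Fin N) ℝ b))⟫_ℝ)))
          + (∑ l : PBond P j, ∑ l' : PBond P j, (w * (c ^ 2 * η)) * (w * (c ^ 2 * η)) *
              (G w c μ2 l.src l'.src * if l.dir = l'.dir then 1 else 0) *
                (8 * (G w c m2 x y * G w c m2 x' y) * Bk w c m2 l l' y y *
                  (⟪EuclideanSpace.basisFun (Fin N) ℝ a, EuclideanSpace.basisFun (Fin N) ℝ b⟫_ℝ * trE (C.q.comp C.q)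
                    + 2 * ⟪EuclideanSpace.basisFun (Fin N) ℝ a, C.q (C.q (EuclideanSpace.basisFun (Fin N) ℝ b))⟫_ℝ)))
          - d20 * ∑ z : Site P j, w *
              (8 * (G w c m2 x y * G w c m2 x' y * (G w c m2 z y * G w c m2 z y)) *
                ((N + 2) * ⟪EuclideanSpace.basisFun (Fin N) ℝ a, EuclideanSpace.basisFun (Fin N) ℝ b⟫_ℝ))))
      - d21 * (⟪EuclideanSpace.basisFun (Fin N) ℝ a, EuclideanSpace.basisFun (Fin N) ℝ b⟫_ℝ *
          (2 * ∑ z : Site P j, w * (G w c m2 x z * G w c m2 x' z))) := by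
  -- the letters
  set X : Cfg P j N → ℝ := fun φ => (∑ b : PBond P j, w * (c ^ 2 * η ^ 2) * G w c μ2 b.src b.src *
      ⟪φ b.src, C.q (C.q (φ b.tgt))⟫_ℝ)
    + ∑ b : PBond P j, ∑ b' : PBond P j, (w * (c ^ 2 * η)) * (w * (c ^ 2 * η)) *
        (G w c μ2 b.src b'.src * if b.dir = b'.dir then 1 else 0) *
          (⟪φ b.src, C.q (φ b.tgt)⟫_ℝ * ⟪φ b'.src, C.q (φ b'.tgt)⟫_ℝ) with hXdef
  set Y : Cfg P j N → ℝ := fun φ => X φ - d20 * massForm w φ with hYdef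
  set U : Cfg P j N → ℝ := fun φ => (∑ y : Site P j, w * ‖φ y‖ ^ 4) + 1 / 2 * d01 * massForm w φ with hUdef
  set W : Cfg P j N → ℝ := fun φ => ∑ y : Site P j, w * wick4 w c m2 y φ with hWdef
  have hX : ∀ φ, X φ = (∑ b : PBond P j, w * (c ^ 2 * η ^ 2) * G w c μ2 b.src b.src * ⟪φ b.src, C.q (C.q (φ b.tgt))⟫_ℝ)
      + ∑ b : PBond P j, ∑ b' : PBond P j, (w * (c ^ 2 * η)) * (w * (c ^ 2 * η)) *
          (G w c μ2 b.src b'.src * if b.dir = b'.dir then 1 else 0) *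
            (⟪φ b.src, C.q (φ b.tgt)⟫_ℝ * ⟪φ b'.src, C.q (φ b'.tgt)⟫_ℝ) := fun φ => rfl
  have hY : ∀ φ, Y φ = X φ - d20 * massForm w φ := fun φ => rfl
  have hU : ∀ φ, U φ = (∑ y : Site P j, w * ‖φ y‖ ^ 4) + 1 / 2 * d01 * massForm w φ := fun φ => rfl
  have hW : ∀ φ, W φ = ∑ y : Site P j, w * wick4 w c m2 y φ := fun φ => rfl
  rw [derivWithin_index21_at_print_d01 C η w c m2 μ2 hw hm hμ d20 d01 d21 d40 hd01 hX hY hU hW a b x x',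
    integral_W_Y_legs C η w c m2 μ2 hw hm d20 hX hY hW a b x x', integral_W_Y C η w c m2 μ2 hw hm d20 hX hY hW,
    kappa2_legs_massForm C η w c m2 hw hm a b x x']
  have hZ : (∫ φ : Cfg P j N, weight C η w c m2 (0 : VecField P j ℝ) φ) ≠ 0 := (B3WT226Traces.Z_pos C η w c m2 hw hm).ne'
  rw [mul_zero, zero_div, sub_zero, mul_div_cancel_left₀ _ hZ]

end Headline


/-! ## §9 Dictionary with (1.21)/(1.23): for a charge matrix with scalar square (`q² = q2·1`, as for the rotation generator of
the `N = 2` models) the loop term is `δ_{ab}`-diagonal; the `e²λ` coefficient of (1.19) is the `n = 1` term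
`C₀[Σ^ε_{(2,1)} − δm²_{(2,1)}δ^ε]C₀` of (1.21) with a LOCAL amputated insertion `Σ^ε_{(2,1)}(y,y′) = K(y)δ^ε(y−y′)`, and print's
defining equation *"−δm²_{(2,1)} + Σ_{x∈T_ε}ε^dΣ^ε_{(2,1)}(x) = 0"* (p. 417) reads `δm²_{(2,1)} = K(x)` -/

section Dictionary

open B3Sect1TwoPoint

omit η w c m2 μ2 in
/-- `tr q² = N·q2` for `q² = q2·1`. [cite: Balaban1982Higgs1, (1.7) p.605] -/
private theorem trE_qq_of_scalar {q2 : ℝ} (hq2 : ∀ v : EuclideanSpace ℝ (Fin N), C.q (C.q v) = q2 • v) :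
    trE (C.q.comp C.q) = N * q2 := by
  unfold trE
  simp only [ContinuousLinearMap.coe_comp, Function.comp_apply, hq2, inner_smul_right,
    (EuclideanSpace.basisFun (Fin N) ℝ).orthonormal.1, real_inner_self_eq_norm_sq, one_pow, mul_one, Finset.sum_const,
    Finset.card_univ, Fintype.card_fin, nsmul_eq_mul]

/-- **THE `e²λ` COEFFICIENT OF (1.19) AS THE `n = 1` TERM OF (1.21)** (charge matrix with `q² = q2·1`, print's `δm²_{(0,1)}`): with
the LOCAL KERNEL **`K(y) = −4(N+2)·[q2·(Σ_b η^dc²η²C^ε(b₋,b₋)C₀(b₋,y)C₀(b₊,y) + Σ_{b,b′:μ=μ′}(η^dc²η)²C^ε(b₋,b′₋)Bk(b,b′;y,y)) −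
δm²_{(2,0)}Σ_zη^dC₀(z,y)²]`**, `(2!1!)⁻¹·∂_λ⁺∂²_e G^{ct}_{ab}(x,x′)∣₀ = δ_{ab}·Σ_yη^dC₀(x,y)·[K(y) − δm²_{(2,1)}]·C₀(y,x′)` — i.e.
`C₀[Σ^ε_{(2,1)} − δm²_{(2,1)}δ^ε]C₀` with `Σ^ε_{(2,1)}(y,y′) = K(y)δ^ε(y−y′)`: at print's `δm²_{(0,1)}` the amputated order-`e²λ`
part is LOCAL (both external legs at the Wick-ordered quartic vertex; the non-local graphs — ④ with a tadpole on its internal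
scalar line, ④ with the `δm²_{(0,1)}`-insertion = print's ⑦ at its `λ`-part — cancel in pairs, §6). [cite: Balaban1983Higgs3, (1.21)–(1.23) pp.416–417] -/
theorem index21_eq_local_insertion (hw : 0 < w) (hm : 0 < m2) (hμ : 0 < μ2) (d20 d01 d21 d40 q2 : ℝ)
    (hd01 : d01 = -(4 * (N + 2) * C0 (P := P) (j := j) w c m2)) (hq2 : ∀ v : EuclideanSpace ℝ (Fin N), C.q (C.q v) = q2 • v)
    {K : Site P j → ℝ}
    (hK : ∀ y, K y = -(4 * (N + 2)) * (q2 * ((∑ l : PBond P j, w * (c ^ 2 * η ^ 2) * G w c μ2 l.src l.src *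
        (G w c m2 l.src y * G w c m2 l.tgt y))
        + ∑ l : PBond P j, ∑ l' : PBond P j, (w * (c ^ 2 * η)) * (w * (c ^ 2 * η)) *
          (G w c μ2 l.src l'.src * if l.dir = l'.dir then 1 else 0) * Bk w c m2 l l' y y)
        - d20 * ∑ z : Site P j, w * G w c m2 z y ^ 2))
    (a b : Fin N) (x x' : Site P j) :
    (1 / 2 : ℝ) * derivWithin (fun lam : ℝ => iteratedDeriv 2 (fun e : ℝ =>
        (∫ p : JCfg P j N, J C η w c (m2 + (d20 * e ^ 2 + d01 * lam + d21 * (e ^ 2 * lam) + d40 * e ^ 4)) μ2 e p *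
            (Real.exp (-(lam * ∑ y : Site P j, w * ‖p.2 y‖ ^ 4)) * legs a b x x' p.2)) /
          ∫ p : JCfg P j N, J C η w c (m2 + (d20 * e ^ 2 + d01 * lam + d21 * (e ^ 2 * lam) + d40 * e ^ 4)) μ2 e p *
            Real.exp (-(lam * ∑ y : Site P j, w * ‖p.2 y‖ ^ 4))) 0) (Set.Ici 0) 0 =
      ⟪EuclideanSpace.basisFun (Fin N) ℝ a, EuclideanSpace.basisFun (Fin N) ℝ b⟫_ℝ *
        ∑ y : Site P j, w * (G w c m2 x y * (K y - d21) * G w c m2 y x') := by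
  rw [derivWithin_index21_explicit C η w c m2 μ2 hw hm hμ d20 d01 d21 d40 hd01 a b x x']
  set bE := EuclideanSpace.basisFun (Fin N) ℝ with hbE
  have hab : ⟪bE a, C.q (C.q (bE b))⟫_ℝ = q2 * ⟪bE a, bE b⟫_ℝ := by rw [hq2, inner_smul_right]
  have htr : trE (C.q.comp C.q) = N * q2 := trE_qq_of_scalar C hq2
  simp only [htr]
  have hGs : ∀ y : Site P j, G w c m2 y x' = G w c m2 x' y := fun y => G_symm w c m2 y x'
  simp_rw [hGs]
  have key : ∀ y : Site P j, w *
      ((∑ l : PBond P j, w * (c ^ 2 * η ^ 2) * G w c μ2 l.src l.src *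
          (8 * (G w c m2 x y * G w c m2 x' y * (G w c m2 l.src y * G w c m2 l.tgt y)) *
            (⟪bE a, bE b⟫_ℝ * (N * q2) + 2 * ⟪bE a, C.q (C.q (bE b))⟫_ℝ)))
      + (∑ l : PBond P j, ∑ l' : PBond P j, (w * (c ^ 2 * η)) * (w * (c ^ 2 * η)) *
          (G w c μ2 l.src l'.src * if l.dir = l'.dir then 1 else 0) *
            (8 * (G w c m2 x y * G w c m2 x' y) * Bk w c m2 l l' y y *
              (⟪bE a, bE b⟫_ℝ * (N * q2) + 2 * ⟪bE a, C.q (C.q (bE b))⟫_ℝ)))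
      - d20 * ∑ z : Site P j, w *
          (8 * (G w c m2 x y * G w c m2 x' y * (G w c m2 z y * G w c m2 z y)) * ((N + 2) * ⟪bE a, bE b⟫_ℝ))) =
      -2 * (⟪bE a, bE b⟫_ℝ * (w * (G w c m2 x y * K y * G w c m2 x' y))) := by
    intro y
    have e1 : (∑ l : PBond P j, w * (c ^ 2 * η ^ 2) * G w c μ2 l.src l.src *
        (8 * (G w c m2 x y * G w c m2 x' y * (G w c m2 l.src y * G w c m2 l.tgt y)) *
          (⟪bE a, bE b⟫_ℝ * (N * q2) + 2 * ⟪bE a, C.q (C.q (bE b))⟫_ℝ))) =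
        (8 * (G w c m2 x y * G w c m2 x' y) * ((N + 2) * q2 * ⟪bE a, bE b⟫_ℝ)) *
          ∑ l : PBond P j, w * (c ^ 2 * η ^ 2) * G w c μ2 l.src l.src * (G w c m2 l.src y * G w c m2 l.tgt y) := by
      rw [Finset.mul_sum]; exact Finset.sum_congr rfl fun l _ => by rw [hab]; ring
    have e2 : (∑ l : PBond P j, ∑ l' : PBond P j, (w * (c ^ 2 * η)) * (w * (c ^ 2 * η)) *
        (G w c μ2 l.src l'.src * if l.dir = l'.dir then 1 else 0) *
          (8 * (G w c m2 x y * G w c m2 x' y) * Bk w c m2 l l' y y *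
            (⟪bE a, bE b⟫_ℝ * (N * q2) + 2 * ⟪bE a, C.q (C.q (bE b))⟫_ℝ))) =
        (8 * (G w c m2 x y * G w c m2 x' y) * ((N + 2) * q2 * ⟪bE a, bE b⟫_ℝ)) *
          ∑ l : PBond P j, ∑ l' : PBond P j, (w * (c ^ 2 * η)) * (w * (c ^ 2 * η)) *
            (G w c μ2 l.src l'.src * if l.dir = l'.dir then 1 else 0) * Bk w c m2 l l' y y := by
      rw [Finset.mul_sum]
      refine Finset.sum_congr rfl fun l _ => ?_
      rw [Finset.mul_sum]
      exact Finset.sum_congr rfl fun l' _ => by rw [hab]; ring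
    have e3 : (∑ z : Site P j, w * (8 * (G w c m2 x y * G w c m2 x' y * (G w c m2 z y * G w c m2 z y)) *
        ((N + 2) * ⟪bE a, bE b⟫_ℝ))) =
        (8 * (G w c m2 x y * G w c m2 x' y) * ((N + 2) * ⟪bE a, bE b⟫_ℝ)) * ∑ z : Site P j, w * G w c m2 z y ^ 2 := by
      rw [Finset.mul_sum]; exact Finset.sum_congr rfl fun z _ => by ring
    rw [e1, e2, e3, hK y]
    ring
  rw [Finset.sum_congr rfl fun y _ => key y]
  have split : (∑ y : Site P j, w * (G w c m2 x y * (K y - d21) * G w c m2 x' y)) =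
      (∑ y : Site P j, w * (G w c m2 x y * K y * G w c m2 x' y)) - d21 * ∑ y : Site P j, w * (G w c m2 x y * G w c m2 x' y) := by
    rw [Finset.mul_sum, ← Finset.sum_sub_distrib]
    exact Finset.sum_congr rfl fun y _ => by ring
  have pull : (∑ y : Site P j, -2 * (⟪bE a, bE b⟫_ℝ * (w * (G w c m2 x y * K y * G w c m2 x' y)))) =
      -2 * (⟪bE a, bE b⟫_ℝ * ∑ y : Site P j, w * (G w c m2 x y * K y * G w c m2 x' y)) := by
    rw [Finset.mul_sum, Finset.mul_sum]
  rw [split, pull]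
  ring

omit C η c m2 μ2 in
/-- the row sum of a local kernel: `Σ_{y′}η^d·K(y)δ^ε(y−y′) = K(y)` (p26's `delta w y y′ = η^{−d}[y = y′]`).
[cite: Balaban1983Higgs3, (1.23) p.417] -/
theorem dm2Graph_local (hw : w ≠ 0) (K : Site P j → ℝ) (y : Site P j) :
    dm2Graph w (fun u u' => K u * delta w u u') y = K y := by
  classical
  unfold dm2Graph delta
  simp only [mul_ite, mul_zero]
  rw [Finset.sum_ite_eq]
  simp only [Finset.mem_univ, if_true]
  field_simp

/-- **PRINT'S DEFINING EQUATION AT THE INDEX `(2,1)`** (p. 417: *"The counterterms δm²_{(α,β)} are defined by the equations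
−δm²_{(α,β)} + Σ_{x∈T_ε}ε^dΣ^ε_{(α,β)}(x) = 0"*, written with r15's `dm2Graph` as for the per-graph counterterms): for the local
kernel `Σ^ε_{(2,1)}(y,y′) = K(y)δ^ε(y−y′)` of `index21_eq_local_insertion`, **the equation holds at `x` iff `δm²_{(2,1)} = K(x)`**;
`K` being translation invariant (`K_transl`), this is one number on the torus — the `(2,1)` analogue of BRICK 10's conditions
`(2,0)`, `(0,1)` and BRICK 12's `(0,2)`. [cite: Balaban1983Higgs3, (1.23) p.417] -/
theorem condition_21_iff (hw : 0 < w) (d21 : ℝ) (K : Site P j → ℝ) (x : Site P j) :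
    -d21 + dm2Graph w (fun u u' => K u * delta w u u') x = 0 ↔ d21 = K x := by
  rw [dm2Graph_local w hw.ne' K x]
  constructor <;> intro h <;> linarith

/-- **`K` IS TRANSLATION INVARIANT** (the torus propagators are: `B3WTCovariance.G_transl`; the bond sums are re-indexed by the
translated bonds `translBond`): print's `δm²_{(2,1)}` is a number, not a function of `x` (contrast p. 418: only after
`C^ε ↦ G^ε_K` do the counterterms acquire *"the dependence on x"*). [cite: Balaban1983Higgs3, (1.23) p.417, (1.26) p.418] -/
theorem K_transl (d20 q2 : ℝ) {K : Site P j → ℝ}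
    (hK : ∀ y, K y = -(4 * (N + 2)) * (q2 * ((∑ l : PBond P j, w * (c ^ 2 * η ^ 2) * G w c μ2 l.src l.src *
        (G w c m2 l.src y * G w c m2 l.tgt y))
        + ∑ l : PBond P j, ∑ l' : PBond P j, (w * (c ^ 2 * η)) * (w * (c ^ 2 * η)) *
          (G w c μ2 l.src l'.src * if l.dir = l'.dir then 1 else 0) * Bk w c m2 l l' y y)
        - d20 * ∑ z : Site P j, w * G w c m2 z y ^ 2))
    (t y : Site P j) : K (transl t y) = K y := by
  rw [hK, hK]
  have hsrc : ∀ l : PBond P j, (translBond t l).src = transl t l.src := fun l => rfl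
  have hdir : ∀ l : PBond P j, (translBond t l).dir = l.dir := fun l => rfl
  have h1 : (∑ l : PBond P j, w * (c ^ 2 * η ^ 2) * G w c μ2 l.src l.src * (G w c m2 l.src (transl t y) * G w c m2 l.tgt (transl t y)))
      = ∑ l : PBond P j, w * (c ^ 2 * η ^ 2) * G w c μ2 l.src l.src * (G w c m2 l.src y * G w c m2 l.tgt y) := by
    refine (Fintype.sum_equiv (translBond t) _ _ fun l => ?_).symm
    rw [hsrc, translBond_tgt, G_transl, G_transl, G_transl]
  have h2 : (∑ l : PBond P j, ∑ l' : PBond P j, (w * (c ^ 2 * η)) * (w * (c ^ 2 * η)) *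
      (G w c μ2 l.src l'.src * if l.dir = l'.dir then 1 else 0) * Bk w c m2 l l' (transl t y) (transl t y))
      = ∑ l : PBond P j, ∑ l' : PBond P j, (w * (c ^ 2 * η)) * (w * (c ^ 2 * η)) *
          (G w c μ2 l.src l'.src * if l.dir = l'.dir then 1 else 0) * Bk w c m2 l l' y y := by
    refine (Fintype.sum_equiv (translBond t) _ _ fun l => ?_).symm
    refine Fintype.sum_equiv (translBond t) _ _ fun l' => ?_
    simp only [Bk, hsrc, hdir, translBond_tgt, G_transl]
  have h3 : (∑ z : Site P j, w * G w c m2 z (transl t y) ^ 2) = ∑ z : Site P j, w * G w c m2 z y ^ 2 := by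
    refine (Fintype.sum_equiv (translEquiv t) _ _ fun z => ?_).symm
    show w * G w c m2 z y ^ 2 = w * G w c m2 (transl t z) (transl t y) ^ 2
    rw [G_transl]
  rw [h1, h2, h3]

/-- **`K` IS PRINT'S FIRST COUNTERTERM ① WITH ITS LOOP LINE CORRECTED AT ORDER `e²`**: for `q² = q2·1`,
`K(y) = −4(N+2)·[½∂²_e G_{aa}(y,y)∣_{e=0} − δm²_{(2,0)}Σ_zη^dC₀(z,y)²]` (no sum over `a`), where `G_{ab}(x,x′;e) = twoPt` is BRICK 7's
(1.19) at `λ = δm² = 0` as a function of the charge and `½∂²_eG∣₀ = C₀[② + ④]C₀` its order-`e²` coefficient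
(`B3Eq122ChargeWick.iteratedDeriv_two_twoPt_eq_wick`): print's `−4(N+2)λC^ε_0(0)` with the loop propagator `C^ε_0(0) = C₀(y,y)`
replaced by the order-`e²` coefficient of the loop line WITH its counterterm `−δm²_{(2,0)}` — the subtracted vector self-energy
inserted once on the tadpole loop. [cite: Balaban1983Higgs3, (1.22)–(1.23) pp.416–417] -/
theorem K_eq_firstCounterterm_loopCorrected (hw : 0 < w) (hm : 0 < m2) (hμ : 0 < μ2) (d20 q2 : ℝ)
    (hq2 : ∀ v : EuclideanSpace ℝ (Fin N), C.q (C.q v) = q2 • v) {K : Site P j → ℝ}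
    (hK : ∀ y, K y = -(4 * (N + 2)) * (q2 * ((∑ l : PBond P j, w * (c ^ 2 * η ^ 2) * G w c μ2 l.src l.src *
        (G w c m2 l.src y * G w c m2 l.tgt y))
        + ∑ l : PBond P j, ∑ l' : PBond P j, (w * (c ^ 2 * η)) * (w * (c ^ 2 * η)) *
          (G w c μ2 l.src l'.src * if l.dir = l'.dir then 1 else 0) * Bk w c m2 l l' y y)
        - d20 * ∑ z : Site P j, w * G w c m2 z y ^ 2))
    (a : Fin N) (y : Site P j) :
    K y = -(4 * (N + 2)) * ((1 / 2 : ℝ) * iteratedDeriv 2 (fun e : ℝ => twoPt C η w c m2 μ2 e a a y y) 0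
      - d20 * ∑ z : Site P j, w * G w c m2 z y ^ 2) := by
  rw [hK, iteratedDeriv_two_twoPt_eq_wick C η w c m2 μ2 hw hm hμ a a y y]
  have haa : ⟪EuclideanSpace.basisFun (Fin N) ℝ a, C.q (C.q (EuclideanSpace.basisFun (Fin N) ℝ a))⟫_ℝ = q2 := by
    rw [hq2, inner_smul_right, real_inner_self_eq_norm_sq, (EuclideanSpace.basisFun (Fin N) ℝ).orthonormal.1 a]
    ring
  rw [haa]
  have h1 : (∑ l : PBond P j, w * (c ^ 2 * η ^ 2) * G w c μ2 l.src l.src *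
      (G w c m2 l.src y * G w c m2 l.tgt y + G w c m2 l.tgt y * G w c m2 l.src y)) =
      2 * ∑ l : PBond P j, w * (c ^ 2 * η ^ 2) * G w c μ2 l.src l.src * (G w c m2 l.src y * G w c m2 l.tgt y) := by
    rw [Finset.mul_sum]
    exact Finset.sum_congr rfl fun l _ => by ring
  have h2 : (∑ l : PBond P j, ∑ l' : PBond P j, (w * (c ^ 2 * η)) * (w * (c ^ 2 * η)) *
      (G w c μ2 l.src l'.src * if l.dir = l'.dir then 1 else 0) * (Bk w c m2 l l' y y + Bk w c m2 l l' y y)) =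
      2 * ∑ l : PBond P j, ∑ l' : PBond P j, (w * (c ^ 2 * η)) * (w * (c ^ 2 * η)) *
        (G w c μ2 l.src l'.src * if l.dir = l'.dir then 1 else 0) * Bk w c m2 l l' y y := by
    rw [Finset.mul_sum]
    refine Finset.sum_congr rfl fun l _ => ?_
    rw [Finset.mul_sum]
    exact Finset.sum_congr rfl fun l' _ => by ring
  rw [h1, h2]
  ring

/-- **PRINT'S `(2,1)` EQUATION, SOLVED**: for `q² = q2·1` and print's `δm²_{(0,1)}`, the defining equation at the index `(2,1)`
holds iff **`δm²_{(2,1)} = −4(N+2)·[½∂²_eG_{aa}(x,x)∣_{e=0} − δm²_{(2,0)}Σ_zη^dC₀(z,x)²]`** — *"solved recursively"* (p. 417): the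
weight-4 counterterm from the weight-2 ones (`δm²_{(0,1)}` through the Wick ordering behind `K`, `δm²_{(2,0)}` explicitly) and
BRICK 7's order-`e²` two-point function at coinciding points. [cite: Balaban1983Higgs3, (1.23) p.417] -/
theorem condition_21_iff_loopCorrected (hw : 0 < w) (hm : 0 < m2) (hμ : 0 < μ2) (d20 d21 q2 : ℝ)
    (hq2 : ∀ v : EuclideanSpace ℝ (Fin N), C.q (C.q v) = q2 • v) {K : Site P j → ℝ}
    (hK : ∀ y, K y = -(4 * (N + 2)) * (q2 * ((∑ l : PBond P j, w * (c ^ 2 * η ^ 2) * G w c μ2 l.src l.src *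
        (G w c m2 l.src y * G w c m2 l.tgt y))
        + ∑ l : PBond P j, ∑ l' : PBond P j, (w * (c ^ 2 * η)) * (w * (c ^ 2 * η)) *
          (G w c μ2 l.src l'.src * if l.dir = l'.dir then 1 else 0) * Bk w c m2 l l' y y)
        - d20 * ∑ z : Site P j, w * G w c m2 z y ^ 2))
    (a : Fin N) (x : Site P j) :
    -d21 + dm2Graph w (fun u u' => K u * delta w u u') x = 0 ↔
      d21 = -(4 * (N + 2)) * ((1 / 2 : ℝ) * iteratedDeriv 2 (fun e : ℝ => twoPt C η w c m2 μ2 e a a x x) 0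
        - d20 * ∑ z : Site P j, w * G w c m2 z x ^ 2) := by
  rw [condition_21_iff w hw d21 K x, K_eq_firstCounterterm_loopCorrected C η w c m2 μ2 hw hm hμ d20 q2 hq2 hK a x]

end Dictionary


end Literature.MathematicalPhysics.QuantumFieldTheory.Balaban1983to89.B3Eq123IndexTwoOne

end
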